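import Mathlib
import Literature.NumberTheory.Sieve.ShnirelmanGoldbachBonferroni
import HarnessLib

/-!
# An explicit Shnirel'man–Goldbach theorem, continued (III): every integer `> 1` is a sum of at most `53` primes (`57` → `53`)

Topic `Literature/NumberTheory/Sieve`; namespace `Literature.NumberTheory.Sieve.ShnirelmanGoldbachExplicit` (continued —
these are §20–§21 of the story of `ShnirelmanGoldbachExplicit.lean` (§1–§12, `≤ 501`), `ShnirelmanGoldbachFlatten.lean`
(§13–§15, `≤ 77`) and `ShnirelmanGoldbachBonferroni.lean` (§16–§19, `≤ 59`), kept in its own module because those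
files are at the gate's size cap).  Cell `parity-ideate` seat p5, ROUND-35 «PAIR THRESHOLD»
(`round35/SchnirelmannShifts.lean` sha16 bbd3c2d18edd25e3, §1 and §3; its §2 = the Sylvester input is §19 of the
Bonferroni module) and ROUND-36 «LEVELS» (`round36/SchnirelmannLevels.lean` sha16 f57715e78fbfb211, §3 and the needed
§1 copies; its §2 = §19–§20 here), landed with statements and proofs verbatim (helpers `private`; the `private` helpers of the earlier
modules it calls are re-proved here as verbatim `private` copies, as in the source).  No named facts, no definitions,
no instances, no notation; the only definition is the `J = 400` level-sum constant `gHol4` (§21).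

## References
* [Nathanson1996] M. B. Nathanson, *Additive Number Theory: The Classical Bases*, GTM 164 (1996), §7.3 Lemma 7.6,
  Lemma 7.7, Theorem 7.8, Theorem 7.9 (Goldbach–Shnirel'man).
* [BatemanDiamond2004] P. T. Bateman, H. G. Diamond, *Analytic Number Theory: An Introductory Course* (2004), §13.4
  (13.13)–(13.14), Theorem 13.8: the explicit large-sieve/Selberg step behind `explicit_of_largeSieve_kappa`.
* [Sylvester1892] J. J. Sylvester, *On arithmetical series*, Messenger of Math. 21 (1892), 1–19, 87–120.

## Content

* §20 the pair sieve at the threshold of its regime: the tree's generic explicit large-sieve step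
  (`TwoResidueSelbergExplicit.explicit_of_largeSieve_kappa` with `GoldbachSieveEight.card_primePairs_mul_Qsum_le`)
  gives `#{p ≤ N : p, p + d prime} ≤ 13.82·f(d)·N/log²N` for `N ≥ e^250` (`pairCount_le_1382`; the tree's
  `pairCount_le_kappa` is `17.75` above `e^41`), which opens a fourth glue regime of TWELVE shifted copies of the
  primes, `(p+q)/2` for `q ∈ {3, 5, …, 41}` (`twelve_shift_count`: 66 pair terms, `f(18), …, f(38)`), on
  `[e^250, e^400]` (`half_count_ge_allN_bonf12S`, four regimes: one shift below `e^{1.8424h}`, four shifts to `e^150`,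
  seven to `e^250`, twelve to `e^400`); with Sylvester's first moment `0.441` (§19) and the tree's Hölder count
  `goldbach_even_count_ge_holder_gap10` at `(Λs, Λ₀, A, κ, h) = (390, 400, 13.59, 1/56, 28)`:
  `x/56` even Goldbach numbers above `e^400` (`goldbach_even_count_ge_56_exp400`), `σ(B) ≥ 1/28` and
  **`schnirelmann_goldbach_le_57`**: every `N ≥ 2` is a sum of at most `57` primes (unconditional; the conditional
  Rosser–Schoenfeld column stays at `51`, §18).
* §21 the levels of the staircase: the flattened first moment's geometric staircase cut to `J = 400` levels instead
  of `200` (ratio `1.01` unchanged), so `gHol(Λ₀) = (1 − 0.01/Λ₀)² + 85.71·δ ≈ 1.849` becomes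
  `gHol4(Λ₀) = (1 − 0.01/Λ₀)² + 98.07·δ₄ ≈ 1.966` (`q_pow_399_le`, `stair_lower_sum_ge400`, `stair_rm_le_main400`,
  `stair_rm_le_bottom400`, the Hölder count `goldbach_even_count_ge_holder400`: `F⁸` up by the factor `1.64`); the
  pair sieve at `e^215` (`pairCount_le_1392`) and the pointwise Chebyshev bound `π(n) ≥ (n+2)/45` below `10⁶` relax
  the four-regime glue to `h ≥ 23` (`half_count_ge_allN_lev`, `half_count_ge_allN_lev_RS`); at
  `(Λs, Λ₀, A) = (382, 394, 13.60)`: `x/52` even Goldbach numbers unconditionally (`goldbach_even_count_ge_52_exp394`,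
  `c₁ = 0.441`), `x/46` under (3.3) (`goldbach_even_count_ge_of_RS_46`, `c₁ = 0.4995`), `σ(B) ≥ 1/26` resp. `1/23`,
  and **`schnirelmann_goldbach_le_53`** / **`schnirelmann_goldbach_of_RS_le_47`**: every `N ≥ 2` is a sum of at most
  `53` primes unconditionally (passing Klimov's 1975 value `55`), of at most `47` under Rosser–Schoenfeld (3.3).

Table of the series (K unconditional / under Rosser–Schoenfeld (3.3)): §9 4329/3121 → §10 1581/1141 → §11 791/571 →
§12 501/379 → §13 379/289 → §14 113/105 → §15 77/65 → §16 65/55 → §17 63/53 → §18 61/51 → §19 59/51 → §20 57/51 →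
§21 53/47.
Print calibration (NOT formalised, not used): Klimov 1975 (`55`), Vaughan 1977 (`27`), Deshouillers 1977 (`26`),
Riesel–Vaughan 1983 (`19`), Ramaré 1995 (even `n`: `≤ 6` primes), Helfgott 2013 (`K ≤ 4`) — the constants here are
those of the ELEMENTARY method with kernel-checked inputs, not a record in print.
-/

namespace Literature.NumberTheory.Sieve.ShnirelmanGoldbachExplicit

open Finset Real
open scoped Classical Pointwise
open Literature.NumberTheory.Sieve Literature.Combinatorics.Additive
open Literature.NumberTheory.Sieve.GoldbachLinnik (oddSingularFactor oddSingularFactor_nonneg)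
open Literature.NumberTheory.Sieve.RomanoffExplicit (PrimeCountingLowerMul primeCountingLowerMul_09212
  primeCounting_ge_div45)

/-! ### Private copies (verbatim) of the helpers of §1–§19 used below -/

/-- `#{p ≤ y : p prime} = π(y)`. [folklore] -/
private theorem card_filter_prime_range (y : ℕ) : #{p ∈ range (y + 1) | p.Prime} = Nat.primeCounting y := by
  rw [Nat.primeCounting, ← Nat.primesBelow_card_eq_primeCounting']
  rfl

/-- The halving map: `#{even N ∈ (0, 2y] : N = p + q} ≤ #{b ∈ (0, y] : b ∈ B}`, `B = {0, 1} ∪ {m : 2m = p + q}`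
(`N ↦ N/2`). [folklore] -/
private theorem even_goldbach_card_le_half (y : ℕ) :
    #{N ∈ Ioc 0 (2 * y) | Even N ∧ ∃ p q : ℕ, p.Prime ∧ q.Prime ∧ p + q = N}
      ≤ #{b ∈ Ioc 0 y | b ∈ (({0, 1} : Set ℕ) ∪ {m | ∃ p q : ℕ, p.Prime ∧ q.Prime ∧ p + q = 2 * m})} := by
  refine card_le_card_of_injOn (fun N => N / 2) ?_ ?_
  · intro N hN
    rw [mem_coe, mem_filter, mem_Ioc] at hN
    obtain ⟨⟨hN0, hNy⟩, ⟨k, hk⟩, p, q, hp, hq, hpq⟩ := hN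
    rw [mem_coe, mem_filter, mem_Ioc]
    dsimp only
    exact ⟨⟨by omega, by omega⟩, Or.inr ⟨p, q, hp, hq, by omega⟩⟩
  · intro N hN N' hN' h
    rw [mem_coe, mem_filter] at hN hN'
    obtain ⟨k, hk⟩ := hN.2.1
    obtain ⟨k', hk'⟩ := hN'.2.1
    simp only at h
    omega

/-- `σ(S) ≥ 1/K` from `S(N) ≥ N/K` (`N ≥ 1`), for any set `S`. [folklore] -/
private theorem schnirelmannDensity_ge_of_count' {S : Set ℕ} [DecidablePred (· ∈ S)] {K : ℕ}
    (h : ∀ N : ℕ, 1 ≤ N → (N : ℝ) / K ≤ #{a ∈ Ioc 0 N | a ∈ S}) :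
    (1 : ℝ) / K ≤ schnirelmannDensity S := by
  rw [le_schnirelmannDensity_iff]
  intro n hn
  have hn' : (0 : ℝ) < n := by exact_mod_cast hn
  rw [le_div_iff₀ hn']
  have := h n hn
  calc (1 : ℝ) / K * n = (n : ℝ) / K := by ring
    _ ≤ _ := by convert this using 2

/-- `f(n) ≥ 1`. [folklore] -/
private theorem one_le_oddSingularFactor' (n : ℕ) : 1 ≤ oddSingularFactor n := by
  unfold oddSingularFactor
  have h : ∏ _p ∈ n.primeFactors.filter (2 < ·), (1 : ℝ)
      ≤ ∏ p ∈ n.primeFactors.filter (2 < ·), (((p : ℝ) - 1) / ((p : ℝ) - 2)) := by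
    refine Finset.prod_le_prod (fun _ _ => zero_le_one) fun p hp => ?_
    rw [Finset.mem_filter] at hp
    have hp3 : (3 : ℝ) ≤ p := by exact_mod_cast hp.2
    rw [le_div_iff₀ (by linarith)]
    linarith
  simpa using h

/-- `2⁵⁹ ≤ e⁴¹`. [folklore] -/
private theorem two_pow_59_le_exp_41 : (2 : ℝ) ^ 59 ≤ Real.exp 41 := by
  have he : (2.718281828 : ℝ) ≤ Real.exp 1 := by have := Real.exp_one_gt_d9; linarith
  have h := pow_le_pow_left₀ (by norm_num) he 41
  rw [← Real.exp_nat_mul] at h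
  norm_num at h
  exact le_trans (by norm_num) h

/-- `((2y − 3 : ℕ) : ℝ) = 2y − 3` for `y ≥ 2`. [folklore] -/
private theorem cast_two_mul_sub_three {y : ℕ} (hy : 2 ≤ y) : ((2 * y - 3 : ℕ) : ℝ) = 2 * (y : ℝ) - 3 := by
  have h3y : 3 ≤ 2 * y := by omega
  rw [Nat.cast_sub h3y]
  push_cast
  ring

/-- `log n ≤ 14` for `n < 10⁶` (`10⁶ ≤ 2.7¹⁴ ≤ e¹⁴`). [folklore] -/
private theorem log_le_14_of_lt {n : ℕ} (hn0 : 0 < n) (h6 : n < 10 ^ 6) : Real.log (n : ℝ) ≤ 14 := by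
  have hn0' : (0 : ℝ) < n := by exact_mod_cast hn0
  have hy6 : (n : ℝ) ≤ (2.7 : ℝ) ^ 14 := by
    have : (n : ℝ) < 10 ^ 6 := by exact_mod_cast h6
    have h27 : (10 : ℝ) ^ 6 ≤ (2.7 : ℝ) ^ 14 := by norm_num
    linarith
  have he : (2.7 : ℝ) ≤ Real.exp 1 := by have := Real.exp_one_gt_d9; linarith
  have h14 : (2.7 : ℝ) ^ 14 ≤ Real.exp 14 := by
    rw [show (14 : ℝ) = ((14 : ℕ) : ℝ) * 1 by norm_num, Real.exp_nat_mul]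
    exact pow_le_pow_left₀ (by norm_num) he 14
  have := Real.log_le_log hn0' (hy6.trans h14)
  rwa [Real.log_exp] at this

/-- Membership in the odd-prime finset: odd primes `≤ 2y − q`. [folklore] -/
private theorem mem_oddPrimes_iff {q y p : ℕ} :
    p ∈ ((range (2 * y - q + 1)).filter Nat.Prime).erase 2 ↔ p.Prime ∧ p ≠ 2 ∧ p ≤ 2 * y - q := by
  rw [mem_erase, mem_filter, mem_range]
  constructor
  · rintro ⟨h2, hlt, hp⟩
    exact ⟨hp, h2, by omega⟩
  · rintro ⟨hp, h2, hle⟩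
    exact ⟨h2, by omega, hp⟩

/-- A prime `≠ 2` is odd. [folklore] -/
private theorem prime_ne_two_mod {p : ℕ} (hp : p.Prime) (h2 : p ≠ 2) : p % 2 = 1 := by
  rcases hp.eq_two_or_odd with h | h
  · exact absurd h h2
  · exact h

/-- `#S_q(y) + 1 = π(2y − q)` for odd `q` with `2 ≤ 2y − q` (`p ↦ (p+q)/2` is injective on odd `p`). [folklore] -/
private theorem card_shiftImg {q y : ℕ} (hq : q % 2 = 1) (h2 : 2 ≤ 2 * y - q) :
    #(shiftImg q y) + 1 = Nat.primeCounting (2 * y - q) := by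
  unfold shiftImg
  have hinj : Set.InjOn (fun p : ℕ => (p + q) / 2) ↑(((range (2 * y - q + 1)).filter Nat.Prime).erase 2) := by
    intro p hp p' hp' hpp'
    rw [mem_coe, mem_oddPrimes_iff] at hp hp'
    simp only at hpp'
    have h1 := prime_ne_two_mod hp.1 hp.2.1
    have h1' := prime_ne_two_mod hp'.1 hp'.2.1
    omega
  rw [card_image_of_injOn hinj]
  have hmem : 2 ∈ (range (2 * y - q + 1)).filter Nat.Prime := by
    rw [mem_filter, mem_range]
    exact ⟨by omega, Nat.prime_two⟩
  have hpos : 1 ≤ #((range (2 * y - q + 1)).filter Nat.Prime) := card_pos.mpr ⟨2, hmem⟩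
  rw [card_erase_of_mem hmem]
  rw [card_filter_prime_range] at hpos ⊢
  omega

/-- `S_q(y) ⊆ (0, y] ∩ B` for an odd prime `q` (`2·((p+q)/2) = p + q`). [folklore] -/
private theorem shiftImg_subset {q y : ℕ} (hq : q.Prime) (hq2 : q ≠ 2) :
    shiftImg q y ⊆ {b ∈ Ioc 0 y | b ∈ (({0, 1} : Set ℕ) ∪ {m | ∃ p q : ℕ, p.Prime ∧ q.Prime ∧ p + q = 2 * m})} := by
  intro m hm
  unfold shiftImg at hm
  rw [mem_image] at hm
  obtain ⟨p, hp, rfl⟩ := hm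
  rw [mem_oddPrimes_iff] at hp
  obtain ⟨hpp, hp2, hple⟩ := hp
  have h1 := prime_ne_two_mod hpp hp2
  have h2 := prime_ne_two_mod hq hq2
  have hp3 := hpp.two_le
  have hq3 := hq.two_le
  rw [mem_filter, mem_Ioc]
  exact ⟨⟨by omega, by omega⟩, Or.inr ⟨p, q, hpp, hq, by omega⟩⟩

/-- `#(S_q ∩ S_{q+d}) ≤ #{p ≤ 2y prime : p + d prime}` for odd `q` and even `d > 0`: a common element
`m = (p+q)/2 = (p'+q+d)/2` gives the prime pair `(p', p' + d) = (p', p)`. [folklore] -/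
private theorem card_shiftImg_inter_le {q q' d y : ℕ} (hq : q % 2 = 1) (hq' : q' % 2 = 1) (hd : q' = q + d) :
    #(shiftImg q y ∩ shiftImg q' y) ≤ #((Nat.primesLE (2 * y)).filter (fun p => (p + d).Prime)) := by
  calc #(shiftImg q y ∩ shiftImg q' y)
      ≤ #(((Nat.primesLE (2 * y)).filter (fun p => (p + d).Prime)).image (fun p : ℕ => (p + q') / 2)) := by
        refine card_le_card ?_
        intro m hm
        rw [mem_inter] at hm
        obtain ⟨hm1, hm2⟩ := hm
        unfold shiftImg at hm1 hm2
        rw [mem_image] at hm1 hm2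
        obtain ⟨p, hp, hpm⟩ := hm1
        obtain ⟨p', hp', rfl⟩ := hm2
        rw [mem_oddPrimes_iff] at hp hp'
        have h1 := prime_ne_two_mod hp.1 hp.2.1
        have h2 := prime_ne_two_mod hp'.1 hp'.2.1
        have hpp' : p = p' + d := by omega
        rw [mem_image]
        refine ⟨p', ?_, rfl⟩
        rw [mem_filter, Nat.mem_primesLE]
        refine ⟨⟨by omega, hp'.1⟩, ?_⟩
        rw [← hpp']
        exact hp.1
    _ ≤ _ := card_image_le

/-- `((2y − q : ℕ) : ℝ) = 2y − q` for `q ≤ 2y`. [folklore] -/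
private theorem cast_two_mul_sub {y q : ℕ} (h : q ≤ 2 * y) : ((2 * y - q : ℕ) : ℝ) = 2 * (y : ℝ) - q := by
  rw [Nat.cast_sub h]
  push_cast
  ring

/-- `f(2) = 1`. [folklore] -/
private theorem oddSingularFactor_two' : oddSingularFactor 2 = 1 := by
  rw [show (2 : ℕ) = 2 ^ 1 * 1 by norm_num, GoldbachLinnik.oddSingularFactor_two_pow_mul 1 one_ne_zero,
    GoldbachLinnik.oddSingularFactor_one]

/-- `f(4) = 1`. [folklore] -/
private theorem oddSingularFactor_four : oddSingularFactor 4 = 1 := by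
  rw [show (4 : ℕ) = 2 ^ 2 * 1 by norm_num, GoldbachLinnik.oddSingularFactor_two_pow_mul 2 one_ne_zero,
    GoldbachLinnik.oddSingularFactor_one]

/-- `f(8) = 1`. [folklore] -/
private theorem oddSingularFactor_eight : oddSingularFactor 8 = 1 := by
  rw [show (8 : ℕ) = 2 ^ 3 * 1 by norm_num, GoldbachLinnik.oddSingularFactor_two_pow_mul 3 one_ne_zero,
    GoldbachLinnik.oddSingularFactor_one]

/-- `f(6) = 2` (the factor `(3−1)/(3−2)`). [folklore] -/
private theorem oddSingularFactor_six : oddSingularFactor 6 = 2 := by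
  rw [show (6 : ℕ) = 2 ^ 1 * 3 by norm_num, GoldbachLinnik.oddSingularFactor_two_pow_mul 1 (by norm_num)]
  show ∏ p ∈ (Nat.primeFactors 3).filter (2 < ·), (((p : ℝ) - 1) / ((p : ℝ) - 2)) = 2
  rw [Nat.prime_three.primeFactors, Finset.filter_singleton, if_pos (by norm_num), Finset.prod_singleton]
  norm_num

/-- `2^59 ≤ e^41` as a numeral. [folklore] -/
private theorem numeral_le_exp_41 : (576460752303423488 : ℝ) ≤ Real.exp 41 := by
  have := two_pow_59_le_exp_41
  norm_num at this
  exact this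

/-- `#(s ∩ ⋃ t) ≤ Σ_{u ∈ t} #(s ∩ u)`. [folklore] -/
private theorem card_inter_foldr_union_le (s : Finset ℕ) (t : List (Finset ℕ)) :
    #(s ∩ t.foldr (· ∪ ·) ∅) ≤ (t.map (fun u => #(s ∩ u))).sum := by
  induction t with
  | nil => simp
  | cons u v ih =>
    simp only [List.foldr_cons, List.map_cons, List.sum_cons]
    rw [inter_union_distrib_left]
    exact (card_union_le _ _).trans (Nat.add_le_add_left ih _)

/-- **Two-term Bonferroni lower bound for a list of finsets**, subtraction-free:
`Σ #Sᵢ ≤ #(⋃ Sᵢ) + Σ_{i<j} #(Sᵢ ∩ Sⱼ)`. [folklore] -/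
private theorem bonferroni_list (L : List (Finset ℕ)) :
    (L.map Finset.card).sum ≤ #(L.foldr (· ∪ ·) ∅) + pairInterSum L := by
  induction L with
  | nil => simp [pairInterSum]
  | cons s t ih =>
    simp only [List.map_cons, List.sum_cons, List.foldr_cons, pairInterSum]
    have h1 := card_union_add_card_inter s (t.foldr (· ∪ ·) ∅)
    have h2 := card_inter_foldr_union_le s t
    omega

/-- `f(10) = 4/3`. [folklore] -/
private theorem oddSingularFactor_ten : oddSingularFactor 10 = 4 / 3 := by
  rw [show (10 : ℕ) = 2 ^ 1 * 5 by norm_num, GoldbachLinnik.oddSingularFactor_two_pow_mul 1 (by norm_num)]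
  show ∏ p ∈ (Nat.primeFactors 5).filter (2 < ·), (((p : ℝ) - 1) / ((p : ℝ) - 2)) = 4 / 3
  rw [Nat.prime_five.primeFactors, Finset.filter_singleton, if_pos (by norm_num), Finset.prod_singleton]
  norm_num

/-- `f(12) = 2`. [folklore] -/
private theorem oddSingularFactor_twelve : oddSingularFactor 12 = 2 := by
  rw [show (12 : ℕ) = 2 ^ 2 * 3 by norm_num, GoldbachLinnik.oddSingularFactor_two_pow_mul 2 (by norm_num)]
  show ∏ p ∈ (Nat.primeFactors 3).filter (2 < ·), (((p : ℝ) - 1) / ((p : ℝ) - 2)) = 2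
  rw [Nat.prime_three.primeFactors, Finset.filter_singleton, if_pos (by norm_num), Finset.prod_singleton]
  norm_num

/-- `f(14) = 6/5`. [folklore] -/
private theorem oddSingularFactor_fourteen : oddSingularFactor 14 = 6 / 5 := by
  rw [show (14 : ℕ) = 2 ^ 1 * 7 by norm_num, GoldbachLinnik.oddSingularFactor_two_pow_mul 1 (by norm_num)]
  show ∏ p ∈ (Nat.primeFactors 7).filter (2 < ·), (((p : ℝ) - 1) / ((p : ℝ) - 2)) = 6 / 5
  rw [(by norm_num : Nat.Prime 7).primeFactors, Finset.filter_singleton, if_pos (by norm_num), Finset.prod_singleton]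
  norm_num

/-- `f(16) = 1`. [folklore] -/
private theorem oddSingularFactor_sixteen : oddSingularFactor 16 = 1 := by
  rw [show (16 : ℕ) = 2 ^ 4 * 1 by norm_num, GoldbachLinnik.oddSingularFactor_two_pow_mul 4 one_ne_zero,
    GoldbachLinnik.oddSingularFactor_one]

/-! ## §20 ROUND-35 «PAIR THRESHOLD»: the pair sieve run at the regime's own threshold (`13.82` above `e^250` for
`17.75` above `e^41`) opens a fourth, TWELVE-shift glue regime to `e^400` — `K = 57`

The near-miss of ROUND-34 at `h = 28` (`κ = 1/56`): the Hölder line needs `A ≤ 13.65`, i.e. `Λs ≳ 390`, but with the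
pair constant `17.75` (the tree's `pairCount_le_kappa`, valid from `e^41`) every k-shift window at `h = 28` ends below
`e^373` (`k = 12`: `[258.6, 372.6]`, `A(362) = 13.62`: no margin; more shifts close the window, since the pair weight grows
like `k²`).  ONE INPUT VARIED: the pair-sieve constant is the SAME generic large-sieve numerics
`17L² ≤ 16(A − 0.02)·TlowK(L/2 − 1.38632)` as the Goldbach constant `A(Λ)`, so above `e^250` it is `13.82`
(`pairCount_le_of_numeric41`, `pairCount_le_1382`).  With it the twelve-shift regime `q ∈ {3, 5, …, 41}` (66 pair terms,
differences `d ≤ 38`, `Σ m_d f(d) = 163061/1683 = 96.887`, weight `27.64·96.887 ≤ 2678`, main `24·0.93919 = 22.54056`)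
owns `L ∈ [158.8, 472.3]` at `h = 28`; the four-regime glue `half_count_ge_allN_bonf12S` (switch points `e^51.5872`,
`e^150`, `e^250`) reaches `Λ₀ = 400` (the cap of the tree's `goldbach_even_count_ge_holder_gap10`); the count runs at
`Λs = 390`, `A = 13.59` (`q(13.59, 390) = 1006 > 0`), `c₁ = 0.441`: `(1/56)⁷·259.55·13.59⁸ = 0.17485 ≤
(0.4409·gHol 400 − 0.0057)⁸ = 0.18066` (slack ×1.033); `σ(B) ≥ 1/28` and **`schnirelmann_goldbach_le_57`**.
(RS column: `h = 24` would need `Λs ≳ 500` and sixteen shifts with zero margin — not attempted; `51` stands in the tree.) -/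

/-! #### §3.1 The pair sieve at a threshold; odd singular factors up to `d = 38` -/

/-- `f(18) = 2`. [folklore] -/
private theorem oddSingularFactor_eighteen : oddSingularFactor 18 = 2 := by
  rw [show (18 : ℕ) = 2 ^ 1 * 9 by norm_num, GoldbachLinnik.oddSingularFactor_two_pow_mul 1 (by norm_num)]
  show ∏ p ∈ (Nat.primeFactors 9).filter (2 < ·), (((p : ℝ) - 1) / ((p : ℝ) - 2)) = 2
  rw [show (9 : ℕ) = 3 ^ 2 by norm_num, Nat.primeFactors_prime_pow (by norm_num) Nat.prime_three,
    Finset.filter_singleton, if_pos (by norm_num), Finset.prod_singleton]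
  norm_num

/-- `f(20) = 4 / 3`. [folklore] -/
private theorem oddSingularFactor_twenty : oddSingularFactor 20 = 4 / 3 := by
  rw [show (20 : ℕ) = 2 ^ 2 * 5 by norm_num, GoldbachLinnik.oddSingularFactor_two_pow_mul 2 (by norm_num)]
  show ∏ p ∈ (Nat.primeFactors 5).filter (2 < ·), (((p : ℝ) - 1) / ((p : ℝ) - 2)) = 4 / 3
  rw [Nat.prime_five.primeFactors, Finset.filter_singleton, if_pos (by norm_num), Finset.prod_singleton]
  norm_num

/-- `f(22) = 10 / 9`. [folklore] -/
private theorem oddSingularFactor_twentytwo : oddSingularFactor 22 = 10 / 9 := by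
  rw [show (22 : ℕ) = 2 ^ 1 * 11 by norm_num, GoldbachLinnik.oddSingularFactor_two_pow_mul 1 (by norm_num)]
  show ∏ p ∈ (Nat.primeFactors 11).filter (2 < ·), (((p : ℝ) - 1) / ((p : ℝ) - 2)) = 10 / 9
  rw [(by norm_num : Nat.Prime 11).primeFactors, Finset.filter_singleton, if_pos (by norm_num), Finset.prod_singleton]
  norm_num

/-- `f(24) = 2`. [folklore] -/
private theorem oddSingularFactor_twentyfour : oddSingularFactor 24 = 2 := by
  rw [show (24 : ℕ) = 2 ^ 3 * 3 by norm_num, GoldbachLinnik.oddSingularFactor_two_pow_mul 3 (by norm_num)]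
  show ∏ p ∈ (Nat.primeFactors 3).filter (2 < ·), (((p : ℝ) - 1) / ((p : ℝ) - 2)) = 2
  rw [Nat.prime_three.primeFactors, Finset.filter_singleton, if_pos (by norm_num), Finset.prod_singleton]
  norm_num

/-- `f(26) = 12 / 11`. [folklore] -/
private theorem oddSingularFactor_twentysix : oddSingularFactor 26 = 12 / 11 := by
  rw [show (26 : ℕ) = 2 ^ 1 * 13 by norm_num, GoldbachLinnik.oddSingularFactor_two_pow_mul 1 (by norm_num)]
  show ∏ p ∈ (Nat.primeFactors 13).filter (2 < ·), (((p : ℝ) - 1) / ((p : ℝ) - 2)) = 12 / 11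
  rw [(by norm_num : Nat.Prime 13).primeFactors, Finset.filter_singleton, if_pos (by norm_num), Finset.prod_singleton]
  norm_num

/-- `f(28) = 6 / 5`. [folklore] -/
private theorem oddSingularFactor_twentyeight : oddSingularFactor 28 = 6 / 5 := by
  rw [show (28 : ℕ) = 2 ^ 2 * 7 by norm_num, GoldbachLinnik.oddSingularFactor_two_pow_mul 2 (by norm_num)]
  show ∏ p ∈ (Nat.primeFactors 7).filter (2 < ·), (((p : ℝ) - 1) / ((p : ℝ) - 2)) = 6 / 5
  rw [(by norm_num : Nat.Prime 7).primeFactors, Finset.filter_singleton, if_pos (by norm_num), Finset.prod_singleton]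
  norm_num

/-- `f(30) = 8 / 3`. [folklore] -/
private theorem oddSingularFactor_thirty : oddSingularFactor 30 = 8 / 3 := by
  rw [show (30 : ℕ) = 2 ^ 1 * 15 by norm_num, GoldbachLinnik.oddSingularFactor_two_pow_mul 1 (by norm_num)]
  show ∏ p ∈ (Nat.primeFactors 15).filter (2 < ·), (((p : ℝ) - 1) / ((p : ℝ) - 2)) = 8 / 3
  rw [show (15 : ℕ) = 3 * 5 by norm_num, Nat.primeFactors_mul (by norm_num) (by norm_num),
    Nat.prime_three.primeFactors, Nat.prime_five.primeFactors, Finset.filter_union, Finset.filter_singleton,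
    Finset.filter_singleton, if_pos (by norm_num), if_pos (by norm_num), Finset.prod_union (by simp),
    Finset.prod_singleton, Finset.prod_singleton]
  norm_num

/-- `f(32) = 1`. [folklore] -/
private theorem oddSingularFactor_thirtytwo : oddSingularFactor 32 = 1 := by
  rw [show (32 : ℕ) = 2 ^ 5 * 1 by norm_num, GoldbachLinnik.oddSingularFactor_two_pow_mul 5 one_ne_zero,
    GoldbachLinnik.oddSingularFactor_one]

/-- `f(34) = 16 / 15`. [folklore] -/
private theorem oddSingularFactor_thirtyfour : oddSingularFactor 34 = 16 / 15 := by
  rw [show (34 : ℕ) = 2 ^ 1 * 17 by norm_num, GoldbachLinnik.oddSingularFactor_two_pow_mul 1 (by norm_num)]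
  show ∏ p ∈ (Nat.primeFactors 17).filter (2 < ·), (((p : ℝ) - 1) / ((p : ℝ) - 2)) = 16 / 15
  rw [(by norm_num : Nat.Prime 17).primeFactors, Finset.filter_singleton, if_pos (by norm_num), Finset.prod_singleton]
  norm_num

/-- `f(36) = 2`. [folklore] -/
private theorem oddSingularFactor_thirtysix : oddSingularFactor 36 = 2 := by
  rw [show (36 : ℕ) = 2 ^ 2 * 9 by norm_num, GoldbachLinnik.oddSingularFactor_two_pow_mul 2 (by norm_num)]
  show ∏ p ∈ (Nat.primeFactors 9).filter (2 < ·), (((p : ℝ) - 1) / ((p : ℝ) - 2)) = 2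
  rw [show (9 : ℕ) = 3 ^ 2 by norm_num, Nat.primeFactors_prime_pow (by norm_num) Nat.prime_three,
    Finset.filter_singleton, if_pos (by norm_num), Finset.prod_singleton]
  norm_num

/-- `f(38) = 18 / 17`. [folklore] -/
private theorem oddSingularFactor_thirtyeight : oddSingularFactor 38 = 18 / 17 := by
  rw [show (38 : ℕ) = 2 ^ 1 * 19 by norm_num, GoldbachLinnik.oddSingularFactor_two_pow_mul 1 (by norm_num)]
  show ∏ p ∈ (Nat.primeFactors 19).filter (2 < ·), (((p : ℝ) - 1) / ((p : ℝ) - 2)) = 18 / 17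
  rw [(by norm_num : Nat.Prime 19).primeFactors, Finset.filter_singleton, if_pos (by norm_num), Finset.prod_singleton]
  norm_num

/-- **Explicit pair sieve AT A THRESHOLD**: if `17L² ≤ 16(A − 0.02)·TlowK(L/2 − 1.38632)` for `L ≥ Λ ≥ 41`, then for
every `N ≥ e^Λ` and even `h ≠ 0`, `#{p ≤ N : p + h prime} ≤ A·f(h)·N/log²N` (the tree's `pairCount_le_kappa` is the case
`Λ = 41`, `A = 17.75`; same proof over the tree's generic `explicit_of_largeSieve_kappa`).
[cite: BatemanDiamond2004, Thm 13.8, §13.4–13.5 pp. 325–328 (explicit form proved here)] -/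
theorem pairCount_le_of_numeric41 {Λ A : ℝ} (hΛ : 41 ≤ Λ)
    (hA : ∀ L : ℝ, Λ ≤ L → 17 * L ^ 2 ≤ 16 * (A - 0.02) * TwoResidueSelbergExplicit.TlowK (L / 2 - 1.38632))
    {N h : ℕ} (hN : Real.exp Λ ≤ (N : ℝ)) (hh : h ≠ 0) (heven : Even h) :
    ((((Nat.primesLE N).filter fun p => (p + h).Prime).card : ℕ) : ℝ)
      ≤ A * oddSingularFactor h * (N : ℝ) / Real.log (N : ℝ) ^ 2 := by
  have h41 : Real.exp 41 ≤ (N : ℝ) := (Real.exp_le_exp.mpr hΛ).trans hN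
  have h20 : (2 : ℝ) ^ 20 ≤ (N : ℝ) := le_trans (by norm_num) (two_pow_59_le_exp_41.trans h41)
  have hX1 : 1 ≤ Nat.sqrt N / 4 := by
    have h20' : 2 ^ 20 ≤ N := by exact_mod_cast h20
    have hs : 1024 ≤ Nat.sqrt N := by
      rw [Nat.le_sqrt]
      calc 1024 * 1024 = 2 ^ 20 := by norm_num
        _ ≤ N := h20'
    omega
  have hBD := GoldbachSieveEight.card_primePairs_mul_Qsum_le 1 h N (Nat.sqrt N / 4) le_rfl
    (Nat.one_le_iff_ne_zero.mpr hh) (by simpa using heven) hX1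
  have hprod : (∏ p ∈ ((1 * h).primeFactors.filter (2 < ·)), (((p : ℝ) - 1) / ((p : ℝ) - 2)))
      = oddSingularFactor h := by rw [one_mul]; rfl
  rw [hprod] at hBD
  have hmain := TwoResidueSelbergExplicit.explicit_of_largeSieve_kappa (Λ := Λ) hΛ hA hN
    (one_le_oddSingularFactor' _) (by linarith) hBD
  have hcount : ((range (N + 1)).filter (fun p => p.Prime ∧ (1 * p + h).Prime)).card
      = ((Nat.primesLE N).filter fun p => (p + h).Prime).card := by
    congr 1
    ext p
    simp only [mem_filter, mem_range, Nat.mem_primesLE, one_mul, Nat.lt_succ_iff]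
    tauto
  rw [hcount] at hmain
  exact hmain

/-- Numerics at `Λ = 250` for the pair sieve: `17L² ≤ 16·13.80·TlowK(L/2 − 1.38632)` for `L ≥ 250`. [folklore] -/
private theorem kappa_numeric_250 {L : ℝ} (hL : 250 ≤ L) :
    17 * L ^ 2 ≤ 16 * (13.82 - 0.02) * TwoResidueSelbergExplicit.TlowK (L / 2 - 1.38632) := by
  unfold TwoResidueSelbergExplicit.TlowK
  nlinarith [hL, mul_self_nonneg (L - 250)]

/-- **Pair sieve from `e^250` with constant `13.82`**: `#{p ≤ N : p + h prime} ≤ 13.82·f(h)·N/log²N`. [cite: BatemanDiamond2004, §13.4 (13.13)–(13.14) (explicit pair-sieve constant at the threshold e^250; proved here)] -/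
theorem pairCount_le_1382 {N h : ℕ} (hN : Real.exp 250 ≤ (N : ℝ)) (hh : h ≠ 0) (heven : Even h) :
    ((((Nat.primesLE N).filter fun p => (p + h).Prime).card : ℕ) : ℝ)
      ≤ 13.82 * oddSingularFactor h * (N : ℝ) / Real.log (N : ℝ) ^ 2 :=
  pairCount_le_of_numeric41 (by norm_num) (fun _ hL => kappa_numeric_250 hL) hN hh heven

/-! #### §3.2 Twelve shifts -/

/-- **Twelve shifts with inclusion–exclusion**: for `2y ≥ 43`,
`Σ_{q ∈ {3,…,41} prime} π(2y−q) ≤ B(y) + 10 + Σ_d m_d·P_d` (66 pair terms, `d ≤ 38`). [cite: Nathanson1996, Theorem 7.8 (twelve shifted embeddings of the primes into the halved set, with two-term inclusion–exclusion; proved here)] -/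
theorem twelve_shift_count {y : ℕ} (hy : 43 ≤ 2 * y) :
    Nat.primeCounting (2 * y - 3) + Nat.primeCounting (2 * y - 5) + Nat.primeCounting (2 * y - 7)
      + Nat.primeCounting (2 * y - 11) + Nat.primeCounting (2 * y - 13) + Nat.primeCounting (2 * y - 17)
      + Nat.primeCounting (2 * y - 19) + Nat.primeCounting (2 * y - 23) + Nat.primeCounting (2 * y - 29)
      + Nat.primeCounting (2 * y - 31) + Nat.primeCounting (2 * y - 37) + Nat.primeCounting (2 * y - 41)
      ≤ #{b ∈ Ioc 0 y | b ∈ (({0, 1} : Set ℕ) ∪ {m | ∃ p q : ℕ, p.Prime ∧ q.Prime ∧ p + q = 2 * m})} + 10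
        + (5 * #((Nat.primesLE (2 * y)).filter (fun p => (p + 2).Prime))
            + 5 * #((Nat.primesLE (2 * y)).filter (fun p => (p + 4).Prime))
            + 7 * #((Nat.primesLE (2 * y)).filter (fun p => (p + 6).Prime))
            + 5 * #((Nat.primesLE (2 * y)).filter (fun p => (p + 8).Prime))
            + 5 * #((Nat.primesLE (2 * y)).filter (fun p => (p + 10).Prime))
            + 6 * #((Nat.primesLE (2 * y)).filter (fun p => (p + 12).Prime))
            + 4 * #((Nat.primesLE (2 * y)).filter (fun p => (p + 14).Prime))
            + 3 * #((Nat.primesLE (2 * y)).filter (fun p => (p + 16).Prime))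
            + 5 * #((Nat.primesLE (2 * y)).filter (fun p => (p + 18).Prime))
            + 3 * #((Nat.primesLE (2 * y)).filter (fun p => (p + 20).Prime))
            + 2 * #((Nat.primesLE (2 * y)).filter (fun p => (p + 22).Prime))
            + 4 * #((Nat.primesLE (2 * y)).filter (fun p => (p + 24).Prime))
            + 3 * #((Nat.primesLE (2 * y)).filter (fun p => (p + 26).Prime))
            + 2 * #((Nat.primesLE (2 * y)).filter (fun p => (p + 28).Prime))
            + 2 * #((Nat.primesLE (2 * y)).filter (fun p => (p + 30).Prime))
            + #((Nat.primesLE (2 * y)).filter (fun p => (p + 32).Prime))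
            + 2 * #((Nat.primesLE (2 * y)).filter (fun p => (p + 34).Prime))
            + #((Nat.primesLE (2 * y)).filter (fun p => (p + 36).Prime))
            + #((Nat.primesLE (2 * y)).filter (fun p => (p + 38).Prime))) := by
  have h3 := card_shiftImg (q := 3) (y := y) (by norm_num) (by omega)
  have h5 := card_shiftImg (q := 5) (y := y) (by norm_num) (by omega)
  have h7 := card_shiftImg (q := 7) (y := y) (by norm_num) (by omega)
  have h11 := card_shiftImg (q := 11) (y := y) (by norm_num) (by omega)
  have h13 := card_shiftImg (q := 13) (y := y) (by norm_num) (by omega)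
  have h17 := card_shiftImg (q := 17) (y := y) (by norm_num) (by omega)
  have h19 := card_shiftImg (q := 19) (y := y) (by norm_num) (by omega)
  have h23 := card_shiftImg (q := 23) (y := y) (by norm_num) (by omega)
  have h29 := card_shiftImg (q := 29) (y := y) (by norm_num) (by omega)
  have h31 := card_shiftImg (q := 31) (y := y) (by norm_num) (by omega)
  have h37 := card_shiftImg (q := 37) (y := y) (by norm_num) (by omega)
  have h41 := card_shiftImg (q := 41) (y := y) (by norm_num) (by omega)
  have hbon := bonferroni_list
    [shiftImg 3 y, shiftImg 5 y, shiftImg 7 y, shiftImg 11 y, shiftImg 13 y, shiftImg 17 y,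
      shiftImg 19 y, shiftImg 23 y, shiftImg 29 y, shiftImg 31 y, shiftImg 37 y, shiftImg 41 y]
  simp only [List.map_cons, List.map_nil, List.sum_cons, List.sum_nil, List.foldr_cons, List.foldr_nil,
    pairInterSum, add_zero, union_empty] at hbon
  have i3_5 := card_shiftImg_inter_le (q := 3) (q' := 5) (d := 2) (y := y) (by norm_num) (by norm_num)
    (by norm_num)
  have i3_7 := card_shiftImg_inter_le (q := 3) (q' := 7) (d := 4) (y := y) (by norm_num) (by norm_num)
    (by norm_num)
  have i3_11 := card_shiftImg_inter_le (q := 3) (q' := 11) (d := 8) (y := y) (by norm_num) (by norm_num)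
    (by norm_num)
  have i3_13 := card_shiftImg_inter_le (q := 3) (q' := 13) (d := 10) (y := y) (by norm_num) (by norm_num)
    (by norm_num)
  have i3_17 := card_shiftImg_inter_le (q := 3) (q' := 17) (d := 14) (y := y) (by norm_num) (by norm_num)
    (by norm_num)
  have i3_19 := card_shiftImg_inter_le (q := 3) (q' := 19) (d := 16) (y := y) (by norm_num) (by norm_num)
    (by norm_num)
  have i3_23 := card_shiftImg_inter_le (q := 3) (q' := 23) (d := 20) (y := y) (by norm_num) (by norm_num)
    (by norm_num)
  have i3_29 := card_shiftImg_inter_le (q := 3) (q' := 29) (d := 26) (y := y) (by norm_num) (by norm_num)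
    (by norm_num)
  have i3_31 := card_shiftImg_inter_le (q := 3) (q' := 31) (d := 28) (y := y) (by norm_num) (by norm_num)
    (by norm_num)
  have i3_37 := card_shiftImg_inter_le (q := 3) (q' := 37) (d := 34) (y := y) (by norm_num) (by norm_num)
    (by norm_num)
  have i3_41 := card_shiftImg_inter_le (q := 3) (q' := 41) (d := 38) (y := y) (by norm_num) (by norm_num)
    (by norm_num)
  have i5_7 := card_shiftImg_inter_le (q := 5) (q' := 7) (d := 2) (y := y) (by norm_num) (by norm_num)
    (by norm_num)
  have i5_11 := card_shiftImg_inter_le (q := 5) (q' := 11) (d := 6) (y := y) (by norm_num) (by norm_num)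
    (by norm_num)
  have i5_13 := card_shiftImg_inter_le (q := 5) (q' := 13) (d := 8) (y := y) (by norm_num) (by norm_num)
    (by norm_num)
  have i5_17 := card_shiftImg_inter_le (q := 5) (q' := 17) (d := 12) (y := y) (by norm_num) (by norm_num)
    (by norm_num)
  have i5_19 := card_shiftImg_inter_le (q := 5) (q' := 19) (d := 14) (y := y) (by norm_num) (by norm_num)
    (by norm_num)
  have i5_23 := card_shiftImg_inter_le (q := 5) (q' := 23) (d := 18) (y := y) (by norm_num) (by norm_num)
    (by norm_num)
  have i5_29 := card_shiftImg_inter_le (q := 5) (q' := 29) (d := 24) (y := y) (by norm_num) (by norm_num)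
    (by norm_num)
  have i5_31 := card_shiftImg_inter_le (q := 5) (q' := 31) (d := 26) (y := y) (by norm_num) (by norm_num)
    (by norm_num)
  have i5_37 := card_shiftImg_inter_le (q := 5) (q' := 37) (d := 32) (y := y) (by norm_num) (by norm_num)
    (by norm_num)
  have i5_41 := card_shiftImg_inter_le (q := 5) (q' := 41) (d := 36) (y := y) (by norm_num) (by norm_num)
    (by norm_num)
  have i7_11 := card_shiftImg_inter_le (q := 7) (q' := 11) (d := 4) (y := y) (by norm_num) (by norm_num)
    (by norm_num)
  have i7_13 := card_shiftImg_inter_le (q := 7) (q' := 13) (d := 6) (y := y) (by norm_num) (by norm_num)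
    (by norm_num)
  have i7_17 := card_shiftImg_inter_le (q := 7) (q' := 17) (d := 10) (y := y) (by norm_num) (by norm_num)
    (by norm_num)
  have i7_19 := card_shiftImg_inter_le (q := 7) (q' := 19) (d := 12) (y := y) (by norm_num) (by norm_num)
    (by norm_num)
  have i7_23 := card_shiftImg_inter_le (q := 7) (q' := 23) (d := 16) (y := y) (by norm_num) (by norm_num)
    (by norm_num)
  have i7_29 := card_shiftImg_inter_le (q := 7) (q' := 29) (d := 22) (y := y) (by norm_num) (by norm_num)
    (by norm_num)
  have i7_31 := card_shiftImg_inter_le (q := 7) (q' := 31) (d := 24) (y := y) (by norm_num) (by norm_num)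
    (by norm_num)
  have i7_37 := card_shiftImg_inter_le (q := 7) (q' := 37) (d := 30) (y := y) (by norm_num) (by norm_num)
    (by norm_num)
  have i7_41 := card_shiftImg_inter_le (q := 7) (q' := 41) (d := 34) (y := y) (by norm_num) (by norm_num)
    (by norm_num)
  have i11_13 := card_shiftImg_inter_le (q := 11) (q' := 13) (d := 2) (y := y) (by norm_num) (by norm_num)
    (by norm_num)
  have i11_17 := card_shiftImg_inter_le (q := 11) (q' := 17) (d := 6) (y := y) (by norm_num) (by norm_num)
    (by norm_num)
  have i11_19 := card_shiftImg_inter_le (q := 11) (q' := 19) (d := 8) (y := y) (by norm_num) (by norm_num)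
    (by norm_num)
  have i11_23 := card_shiftImg_inter_le (q := 11) (q' := 23) (d := 12) (y := y) (by norm_num) (by norm_num)
    (by norm_num)
  have i11_29 := card_shiftImg_inter_le (q := 11) (q' := 29) (d := 18) (y := y) (by norm_num) (by norm_num)
    (by norm_num)
  have i11_31 := card_shiftImg_inter_le (q := 11) (q' := 31) (d := 20) (y := y) (by norm_num) (by norm_num)
    (by norm_num)
  have i11_37 := card_shiftImg_inter_le (q := 11) (q' := 37) (d := 26) (y := y) (by norm_num) (by norm_num)
    (by norm_num)
  have i11_41 := card_shiftImg_inter_le (q := 11) (q' := 41) (d := 30) (y := y) (by norm_num) (by norm_num)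
    (by norm_num)
  have i13_17 := card_shiftImg_inter_le (q := 13) (q' := 17) (d := 4) (y := y) (by norm_num) (by norm_num)
    (by norm_num)
  have i13_19 := card_shiftImg_inter_le (q := 13) (q' := 19) (d := 6) (y := y) (by norm_num) (by norm_num)
    (by norm_num)
  have i13_23 := card_shiftImg_inter_le (q := 13) (q' := 23) (d := 10) (y := y) (by norm_num) (by norm_num)
    (by norm_num)
  have i13_29 := card_shiftImg_inter_le (q := 13) (q' := 29) (d := 16) (y := y) (by norm_num) (by norm_num)
    (by norm_num)
  have i13_31 := card_shiftImg_inter_le (q := 13) (q' := 31) (d := 18) (y := y) (by norm_num) (by norm_num)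
    (by norm_num)
  have i13_37 := card_shiftImg_inter_le (q := 13) (q' := 37) (d := 24) (y := y) (by norm_num) (by norm_num)
    (by norm_num)
  have i13_41 := card_shiftImg_inter_le (q := 13) (q' := 41) (d := 28) (y := y) (by norm_num) (by norm_num)
    (by norm_num)
  have i17_19 := card_shiftImg_inter_le (q := 17) (q' := 19) (d := 2) (y := y) (by norm_num) (by norm_num)
    (by norm_num)
  have i17_23 := card_shiftImg_inter_le (q := 17) (q' := 23) (d := 6) (y := y) (by norm_num) (by norm_num)
    (by norm_num)
  have i17_29 := card_shiftImg_inter_le (q := 17) (q' := 29) (d := 12) (y := y) (by norm_num) (by norm_num)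
    (by norm_num)
  have i17_31 := card_shiftImg_inter_le (q := 17) (q' := 31) (d := 14) (y := y) (by norm_num) (by norm_num)
    (by norm_num)
  have i17_37 := card_shiftImg_inter_le (q := 17) (q' := 37) (d := 20) (y := y) (by norm_num) (by norm_num)
    (by norm_num)
  have i17_41 := card_shiftImg_inter_le (q := 17) (q' := 41) (d := 24) (y := y) (by norm_num) (by norm_num)
    (by norm_num)
  have i19_23 := card_shiftImg_inter_le (q := 19) (q' := 23) (d := 4) (y := y) (by norm_num) (by norm_num)
    (by norm_num)
  have i19_29 := card_shiftImg_inter_le (q := 19) (q' := 29) (d := 10) (y := y) (by norm_num) (by norm_num)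
    (by norm_num)
  have i19_31 := card_shiftImg_inter_le (q := 19) (q' := 31) (d := 12) (y := y) (by norm_num) (by norm_num)
    (by norm_num)
  have i19_37 := card_shiftImg_inter_le (q := 19) (q' := 37) (d := 18) (y := y) (by norm_num) (by norm_num)
    (by norm_num)
  have i19_41 := card_shiftImg_inter_le (q := 19) (q' := 41) (d := 22) (y := y) (by norm_num) (by norm_num)
    (by norm_num)
  have i23_29 := card_shiftImg_inter_le (q := 23) (q' := 29) (d := 6) (y := y) (by norm_num) (by norm_num)
    (by norm_num)
  have i23_31 := card_shiftImg_inter_le (q := 23) (q' := 31) (d := 8) (y := y) (by norm_num) (by norm_num)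
    (by norm_num)
  have i23_37 := card_shiftImg_inter_le (q := 23) (q' := 37) (d := 14) (y := y) (by norm_num) (by norm_num)
    (by norm_num)
  have i23_41 := card_shiftImg_inter_le (q := 23) (q' := 41) (d := 18) (y := y) (by norm_num) (by norm_num)
    (by norm_num)
  have i29_31 := card_shiftImg_inter_le (q := 29) (q' := 31) (d := 2) (y := y) (by norm_num) (by norm_num)
    (by norm_num)
  have i29_37 := card_shiftImg_inter_le (q := 29) (q' := 37) (d := 8) (y := y) (by norm_num) (by norm_num)
    (by norm_num)
  have i29_41 := card_shiftImg_inter_le (q := 29) (q' := 41) (d := 12) (y := y) (by norm_num) (by norm_num)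
    (by norm_num)
  have i31_37 := card_shiftImg_inter_le (q := 31) (q' := 37) (d := 6) (y := y) (by norm_num) (by norm_num)
    (by norm_num)
  have i31_41 := card_shiftImg_inter_le (q := 31) (q' := 41) (d := 10) (y := y) (by norm_num) (by norm_num)
    (by norm_num)
  have i37_41 := card_shiftImg_inter_le (q := 37) (q' := 41) (d := 4) (y := y) (by norm_num) (by norm_num)
    (by norm_num)
  set U := shiftImg 3 y ∪ (shiftImg 5 y ∪ (shiftImg 7 y ∪ (shiftImg 11 y ∪ (shiftImg 13 y ∪ (shiftImg 17 y
    ∪ (shiftImg 19 y ∪ (shiftImg 23 y ∪ (shiftImg 29 y ∪ (shiftImg 31 y ∪ (shiftImg 37 y ∪ shiftImg 41 y)))))))))) with hU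
  have hUsub : U ⊆ {b ∈ Ioc 0 y | b ∈ (({0, 1} : Set ℕ) ∪ {m | ∃ p q : ℕ, p.Prime ∧ q.Prime ∧ p + q = 2 * m})} := by
    rw [hU]
    refine union_subset (shiftImg_subset Nat.prime_three (by norm_num)) ?_
    refine union_subset (shiftImg_subset (by norm_num) (by norm_num)) ?_
    refine union_subset (shiftImg_subset (by norm_num) (by norm_num)) ?_
    refine union_subset (shiftImg_subset (by norm_num) (by norm_num)) ?_
    refine union_subset (shiftImg_subset (by norm_num) (by norm_num)) ?_
    refine union_subset (shiftImg_subset (by norm_num) (by norm_num)) ?_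
    refine union_subset (shiftImg_subset (by norm_num) (by norm_num)) ?_
    refine union_subset (shiftImg_subset (by norm_num) (by norm_num)) ?_
    refine union_subset (shiftImg_subset (by norm_num) (by norm_num)) ?_
    refine union_subset (shiftImg_subset (by norm_num) (by norm_num)) ?_
    refine union_subset (shiftImg_subset (by norm_num) (by norm_num)) ?_
    exact shiftImg_subset (by norm_num) (by norm_num)
  have hmemU : ∀ m ∈ U, 3 ≤ m := by
    intro m hm
    rw [hU] at hm
    simp only [mem_union] at hm
    rcases hm with hm | hm | hm | hm | hm | hm | hm | hm | hm | hm | hm | hm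
    all_goals
      unfold shiftImg at hm
      rw [mem_image] at hm
      obtain ⟨p, hp, rfl⟩ := hm
      rw [mem_oddPrimes_iff] at hp
      have h1 := hp.1.two_le
      have h2 := hp.2.1
      omega
  have h2U : 2 ∉ U := fun h => by have := hmemU 2 h; omega
  have h1U : 1 ∉ insert 2 U := by
    rw [mem_insert]
    rintro (h | h)
    · omega
    · have := hmemU 1 h; omega
  have hsub : insert 1 (insert 2 U)
      ⊆ {b ∈ Ioc 0 y | b ∈ (({0, 1} : Set ℕ) ∪ {m | ∃ p q : ℕ, p.Prime ∧ q.Prime ∧ p + q = 2 * m})} := by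
    intro b hb
    rw [mem_insert, mem_insert] at hb
    rcases hb with rfl | rfl | hb
    · rw [mem_filter, mem_Ioc]
      exact ⟨⟨by omega, by omega⟩, Or.inl (by simp)⟩
    · rw [mem_filter, mem_Ioc]
      exact ⟨⟨by omega, by omega⟩, Or.inr ⟨2, 2, Nat.prime_two, Nat.prime_two, by norm_num⟩⟩
    · exact hUsub hb
  have hcard := card_le_card hsub
  rw [card_insert_of_notMem h1U, card_insert_of_notMem h2U] at hcard
  omega

/-! #### §3.3 The four-regime glue -/

set_option maxHeartbeats 4000000 in
/-- **All `y ≥ 1` for the halved set, FOUR-REGIME glue**: as the tree's `half_count_ge_allN_bonf7` (one shift with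
`c₀ = 0.9212` below `e^{L₁}`, `L₁ ≤ 1.8424h`; four / seven shifts on `[L₁, L₂]` / `[L₂, L₃]` with the pair constant `17.75`)
but with Sylvester's `0.93919` (`n ≥ 10¹²`) in the multi-shift main terms (`7.51352`, `13.14866`),
plus a TWELVE-shift regime `q ∈ {3,5,…,41}` on `[L₃, Λ₀]`, `L₃ ≥ 250`, whose 66 pair terms use the pair sieve run AT
THE THRESHOLD `e^250` (`pairCount_le_1382`: `13.82·f(d)·N/log²N` instead of `17.75`): main term `24·0.93919 = 22.54056`,
pair weight `27.64·Σ m_d f(d) = 27.64·96.8871 ≤ 2678`, i.e. `L² + h ≤ h·(22.54056·L − 2678)` on `[L₃, Λ₀]`.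
[cite: Nathanson1996, Thm 7.7 (all-`x` form); BatemanDiamond2004, Thm 13.8 (pair sieve, explicit form proved in the tree)] -/
theorem half_count_ge_allN_bonf12S {L₁ L₂ L₃ Λ₀ : ℝ} {h : ℕ} (h28 : 28 ≤ h) (h41 : 41 ≤ L₁) (hL₁h : L₁ ≤ 1.8424 * h)
    (hL₃ : 250 ≤ L₃) (hΛ4 : Λ₀ ≤ 10000)
    (hquad : ∀ L : ℝ, L₁ ≤ L → L ≤ L₂ → L ^ 2 + h ≤ h * (7.51352 * L - 248.5))
    (hquad7 : ∀ L : ℝ, L₂ ≤ L → L ≤ L₃ → L ^ 2 + h ≤ h * (13.14866 * L - 996.37))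
    (hquad12 : ∀ L : ℝ, L₃ ≤ L → L ≤ Λ₀ → L ^ 2 + h ≤ h * (22.54056 * L - 2678))
    (hlarge : ∀ x : ℕ, Real.exp Λ₀ ≤ (x : ℝ) →
      (x : ℝ) / (2 * h) ≤ #{N ∈ Ioc 0 x | Even N ∧ ∃ p q : ℕ, p.Prime ∧ q.Prime ∧ p + q = N})
    {y : ℕ} (hy : 1 ≤ y) :
    (y : ℝ) / h ≤ #{b ∈ Ioc 0 y | b ∈ (({0, 1} : Set ℕ) ∪ {m | ∃ p q : ℕ, p.Prime ∧ q.Prime ∧ p + q = 2 * m})} := by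
  set B : Set ℕ := ({0, 1} : Set ℕ) ∪ {m | ∃ p q : ℕ, p.Prime ∧ q.Prime ∧ p + q = 2 * m} with hB
  have hhr : (28 : ℝ) ≤ h := by exact_mod_cast h28
  have hh0 : (0 : ℝ) < h := by linarith
  have hL₁pos : (0 : ℝ) < L₁ := by linarith
  by_cases hbig : Real.exp Λ₀ ≤ ((2 * y : ℕ) : ℝ)
  · have h1 := hlarge (2 * y) hbig
    have h2 := even_goldbach_card_le_half y
    have e : ((2 * y : ℕ) : ℝ) / (2 * h) = (y : ℝ) / h := by
      push_cast
      field_simp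
    rw [e] at h1
    exact h1.trans (by exact_mod_cast h2)
  rw [not_le] at hbig
  by_cases hsmall : y ≤ h
  · have h1 : 1 ≤ #{b ∈ Ioc 0 y | b ∈ B} :=
      card_pos.mpr ⟨1, by
        rw [mem_filter, mem_Ioc]
        exact ⟨⟨by omega, hy⟩, Or.inl (by simp)⟩⟩
    have h1' : (1 : ℝ) ≤ #{b ∈ Ioc 0 y | b ∈ B} := by exact_mod_cast h1
    have h2 : (y : ℝ) / h ≤ 1 := by
      rw [div_le_one hh0]
      exact_mod_cast hsmall
    linarith
  rw [not_le] at hsmall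
  have hy29 : 29 ≤ y := by omega
  have hnr : ((2 * y - 3 : ℕ) : ℝ) = 2 * (y : ℝ) - 3 := cast_two_mul_sub_three (by omega)
  have hy29r : (29 : ℝ) ≤ y := by exact_mod_cast hy29
  have hy0 : (0 : ℝ) < y := by linarith
  have hn55 : 55 ≤ 2 * y - 3 := by omega
  have hn0 : (0 : ℝ) < ((2 * y - 3 : ℕ) : ℝ) := by rw [hnr]; linarith
  have hn1 : (1 : ℝ) < ((2 * y - 3 : ℕ) : ℝ) := by rw [hnr]; linarith
  have hlogpos : 0 < Real.log ((2 * y - 3 : ℕ) : ℝ) := Real.log_pos hn1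
  by_cases hmid : Real.log ((2 * y - 3 : ℕ) : ℝ) ≤ L₁
  · -- ONE SHIFT below `e^{L₁}` (§15)
    have hemb := primeCounting_shift_le_half_count (y := y) (by omega)
    have hembr : (Nat.primeCounting (2 * y - 3) : ℝ) + 1 ≤ #{b ∈ Ioc 0 y | b ∈ B} := by exact_mod_cast hemb
    refine le_trans ?_ hembr
    by_cases h6 : 10 ^ 6 ≤ 2 * y - 3
    · have hπ : 0.9212 * ((2 * y - 3 : ℕ) : ℝ) / Real.log ((2 * y - 3 : ℕ) : ℝ)
          ≤ (Nat.primeCounting (2 * y - 3) : ℝ) := by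
        have := primeCountingLowerMul_09212
        unfold PrimeCountingLowerMul at this
        exact this (2 * y - 3) h6
      have h2 : 0.9212 * ((2 * y - 3 : ℕ) : ℝ) / L₁
          ≤ 0.9212 * ((2 * y - 3 : ℕ) : ℝ) / Real.log ((2 * y - 3 : ℕ) : ℝ) :=
        div_le_div_of_nonneg_left (by positivity) hlogpos hmid
      have h3 : (y : ℝ) / h ≤ 1.8424 * y / L₁ := by
        rw [div_le_div_iff₀ hh0 hL₁pos]
        nlinarith [mul_le_mul_of_nonneg_left hL₁h hy0.le]
      have h4 : 1.8424 * (y : ℝ) / L₁ ≤ 0.9212 * ((2 * y - 3 : ℕ) : ℝ) / L₁ + 1 := by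
        rw [hnr]
        have e : 0.9212 * (2 * (y : ℝ) - 3) / L₁ = 1.8424 * y / L₁ - 2.7636 / L₁ := by
          field_simp
          ring
        rw [e]
        have : 2.7636 / L₁ ≤ 1 := by
          rw [div_le_one hL₁pos]
          linarith
        linarith
      linarith [h2, h3, h4, hπ]
    · rw [not_le] at h6
      have hn32 : 32 ≤ 2 * y - 3 := by omega
      have hπ := ShnirelmanGoldbachTheorem.primeCounting_ge hn32
      have hlog14 : Real.log ((2 * y - 3 : ℕ) : ℝ) ≤ 14 := log_le_14_of_lt (by omega) h6
      have h5 : ((2 * y - 3 : ℕ) : ℝ) / 56 ≤ ((2 * y - 3 : ℕ) : ℝ) / (4 * Real.log ((2 * y - 3 : ℕ) : ℝ)) :=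
        div_le_div_of_nonneg_left hn0.le (by positivity) (by linarith)
      have h6' : (y : ℝ) / h ≤ (y : ℝ) / 28 := div_le_div_of_nonneg_left hy0.le (by norm_num) hhr
      have h7 : ((2 * y - 3 : ℕ) : ℝ) / 56 + 1 - (y : ℝ) / 28 = 53 / 56 := by
        rw [hnr]
        ring
      linarith [hπ, h5, h6', h7]
  · -- FOUR SHIFTS on `(e^{L₁}, e^{Λ₀})`
    rw [not_le] at hmid
    have h59 : (576460752303423488 : ℝ) < ((2 * y - 3 : ℕ) : ℝ) := by
      have h1 : Real.exp L₁ < ((2 * y - 3 : ℕ) : ℝ) := by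
        by_contra hc
        rw [not_lt] at hc
        have := Real.log_le_log hn0 hc
        rw [Real.log_exp] at this
        linarith
      exact lt_of_le_of_lt (numeral_le_exp_41.trans (Real.exp_le_exp.mpr h41)) h1
    have h59n : 576460752303423488 < 2 * y - 3 := by exact_mod_cast h59
    have hy58 : (288230376151711744 : ℝ) ≤ (y : ℝ) := by
      have : 288230376151711744 ≤ y := by omega
      exact_mod_cast this
    have h2y0 : (0 : ℝ) < ((2 * y : ℕ) : ℝ) := by push_cast; linarith
    set L := Real.log ((2 * y : ℕ) : ℝ) with hLdef
    have hLΛ : L < Λ₀ := by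
      have := Real.log_lt_log h2y0 hbig
      rwa [Real.log_exp] at this
    have hL₁L : L₁ ≤ L := by
      have h2y : ((2 * y - 3 : ℕ) : ℝ) ≤ ((2 * y : ℕ) : ℝ) := by rw [hnr]; push_cast; linarith
      exact (hmid.trans_le (Real.log_le_log hn0 h2y)).le
    have hL41 : (41 : ℝ) ≤ L := h41.trans hL₁L
    have hLpos : (0 : ℝ) < L := by linarith
    have hL4 : L ≤ 10000 := by linarith
    have he41 : Real.exp 41 ≤ ((2 * y : ℕ) : ℝ) := by
      have : Real.exp 41 ≤ Real.exp L := Real.exp_le_exp.mpr hL41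
      rwa [hLdef, Real.exp_log h2y0] at this
    -- the prime counts, Sylvester's constant
    have hπ : ∀ q : ℕ, q ≤ 41 → 0.93919 * (2 * (y : ℝ) - q) / L ≤ (Nat.primeCounting (2 * y - q) : ℝ) := by
      intro q hq
      have hqr : (q : ℝ) ≤ 41 := by exact_mod_cast hq
      have hnq : ((2 * y - q : ℕ) : ℝ) = 2 * (y : ℝ) - q := cast_two_mul_sub (by omega)
      have h6 : 10 ^ 12 ≤ 2 * y - q := by omega
      have hnq0 : (0 : ℝ) < ((2 * y - q : ℕ) : ℝ) := by rw [hnq]; linarith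
      have hnq1 : (1 : ℝ) < ((2 * y - q : ℕ) : ℝ) := by rw [hnq]; linarith
      have h1 : 0.93919 * ((2 * y - q : ℕ) : ℝ) / Real.log ((2 * y - q : ℕ) : ℝ)
          ≤ (Nat.primeCounting (2 * y - q) : ℝ) := by
        have := primeCountingLowerMul_sylvester
        unfold PrimeCountingLowerMul at this
        exact this (2 * y - q) h6
      have hlogq0 : 0 < Real.log ((2 * y - q : ℕ) : ℝ) := Real.log_pos hnq1
      have hlogq : Real.log ((2 * y - q : ℕ) : ℝ) ≤ L := by
        have h2y : ((2 * y - q : ℕ) : ℝ) ≤ ((2 * y : ℕ) : ℝ) := by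
          rw [hnq]; push_cast; linarith [Nat.cast_nonneg (α := ℝ) q]
        exact Real.log_le_log hnq0 h2y
      have h2 : 0.93919 * (2 * (y : ℝ) - q) / L
          ≤ 0.93919 * ((2 * y - q : ℕ) : ℝ) / Real.log ((2 * y - q : ℕ) : ℝ) := by
        rw [← hnq]
        exact div_le_div_of_nonneg_left (by positivity) hlogq0 hlogq
      linarith
    -- the pair counts (tree: explicit pair sieve above `e^41`)
    have hP : ∀ d : ℕ, d ≠ 0 → Even d →
        (#((Nat.primesLE (2 * y)).filter (fun p => (p + d).Prime)) : ℝ)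
          ≤ 17.75 * oddSingularFactor d * ((2 * y : ℕ) : ℝ) / L ^ 2 := by
      intro d hd hde
      exact TwoResidueSelbergExplicit.pairCount_le_kappa (N := 2 * y) (h := d) he41 hd hde
    rcases le_or_gt L L₂ with hmid2 | hmid2
    · -- FOUR SHIFTS on `(e^{L₁}, e^{L₂}]`
      have hq := hquad L hL₁L hmid2
      have hP2 := hP 2 (by norm_num) (by norm_num)
      have hP4 := hP 4 (by norm_num) (by norm_num)
      have hP6 := hP 6 (by norm_num) (by norm_num)
      have hP8 := hP 8 (by norm_num) (by norm_num)
      rw [oddSingularFactor_two'] at hP2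
      rw [oddSingularFactor_four] at hP4
      rw [oddSingularFactor_six] at hP6
      rw [oddSingularFactor_eight] at hP8
      -- combinatorics
      have hcomb := four_shift_count (y := y) (by omega)
      have hcombr : (Nat.primeCounting (2 * y - 3) : ℝ) + Nat.primeCounting (2 * y - 5)
          + Nat.primeCounting (2 * y - 7) + Nat.primeCounting (2 * y - 11)
          ≤ (#{b ∈ Ioc 0 y | b ∈ B} : ℝ) + 2
            + (2 * #((Nat.primesLE (2 * y)).filter (fun p => (p + 2).Prime))
              + 2 * #((Nat.primesLE (2 * y)).filter (fun p => (p + 4).Prime))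
              + #((Nat.primesLE (2 * y)).filter (fun p => (p + 8).Prime))
              + #((Nat.primesLE (2 * y)).filter (fun p => (p + 6).Prime))) := by
        exact_mod_cast hcomb
      have hπ3 := hπ 3 (by norm_num)
      have hπ5 := hπ 5 (by norm_num)
      have hπ7 := hπ 7 (by norm_num)
      have hπ11 := hπ 11 (by norm_num)
      push_cast at hπ3 hπ5 hπ7 hπ11
      have h2yr : ((2 * y : ℕ) : ℝ) = 2 * (y : ℝ) := by push_cast; ring
      rw [h2yr] at hP2 hP4 hP6 hP8
      set G : ℝ := (#{b ∈ Ioc 0 y | b ∈ B} : ℝ) with hG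
      set Y : ℝ := (y : ℝ) with hY
      -- `G ≥ (7.51352 Y − 24.41894)/L − 2 − 248.5 Y/L²`
      have hG1 : (7.51352 * Y - 24.41894) / L - 2 - 248.5 * Y / L ^ 2 ≤ G := by
        have e1 : (7.51352 * Y - 24.41894) / L = 0.93919 * (2 * Y - 3) / L + 0.93919 * (2 * Y - 5) / L
            + 0.93919 * (2 * Y - 7) / L + 0.93919 * (2 * Y - 11) / L := by
          field_simp
          ring
        have e2 : 248.5 * Y / L ^ 2 = 2 * (17.75 * 1 * (2 * Y) / L ^ 2) + 2 * (17.75 * 1 * (2 * Y) / L ^ 2)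
            + 17.75 * 1 * (2 * Y) / L ^ 2 + 17.75 * 2 * (2 * Y) / L ^ 2 := by
          field_simp
          ring
        rw [e1, e2]
        linarith [hcombr, hπ3, hπ5, hπ7, hπ11, hP2, hP4, hP6, hP8]
      have hL2 : (0 : ℝ) < L ^ 2 := by positivity
      have hkey : Y * L ^ 2 ≤ (h : ℝ) * G * L ^ 2 := by
        have e3 : ((7.51352 * Y - 24.41894) / L - 2 - 248.5 * Y / L ^ 2) * L ^ 2
            = 7.51352 * Y * L - 24.41894 * L - 2 * L ^ 2 - 248.5 * Y := by
          field_simp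
        have h1 : (7.51352 * Y * L - 24.41894 * L - 2 * L ^ 2 - 248.5 * Y) * h ≤ G * L ^ 2 * h := by
          rw [← e3]
          exact mul_le_mul_of_nonneg_right (mul_le_mul_of_nonneg_right hG1 hL2.le) hh0.le
        have h2 : Y * (L ^ 2 + h) ≤ Y * (h * (7.51352 * L - 248.5)) :=
          mul_le_mul_of_nonneg_left hq (by linarith)
        have h3 : 24.41894 * L + 2 * L ^ 2 ≤ Y := by
          nlinarith [mul_nonneg (sub_nonneg.2 hL4) hLpos.le]
        have h3' : (h : ℝ) * (24.41894 * L + 2 * L ^ 2) ≤ h * Y := mul_le_mul_of_nonneg_left h3 hh0.le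
        nlinarith [h1, h2, h3']
      have hfin := le_of_mul_le_mul_right hkey hL2
      rw [div_le_iff₀ hh0, mul_comm]
      exact hfin
    · rcases le_or_gt L L₃ with hmid3 | hmid3
      · -- SEVEN SHIFTS on `(e^{L₂}, e^{L₃}]`
        have hq := hquad7 L hmid2.le hmid3
        have hP2 := hP 2 (by norm_num) (by norm_num)
        have hP4 := hP 4 (by norm_num) (by norm_num)
        have hP6 := hP 6 (by norm_num) (by norm_num)
        have hP8 := hP 8 (by norm_num) (by norm_num)
        have hP10 := hP 10 (by norm_num) (by norm_num)
        have hP12 := hP 12 (by norm_num) (by norm_num)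
        have hP14 := hP 14 (by norm_num) (by norm_num)
        have hP16 := hP 16 (by norm_num) (by norm_num)
        rw [oddSingularFactor_two'] at hP2
        rw [oddSingularFactor_four] at hP4
        rw [oddSingularFactor_six] at hP6
        rw [oddSingularFactor_eight] at hP8
        rw [oddSingularFactor_ten] at hP10
        rw [oddSingularFactor_twelve] at hP12
        rw [oddSingularFactor_fourteen] at hP14
        rw [oddSingularFactor_sixteen] at hP16
        have hcomb := seven_shift_count (y := y) (by omega)
        have hcombr : (Nat.primeCounting (2 * y - 3) : ℝ) + Nat.primeCounting (2 * y - 5)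
            + Nat.primeCounting (2 * y - 7) + Nat.primeCounting (2 * y - 11) + Nat.primeCounting (2 * y - 13)
            + Nat.primeCounting (2 * y - 17) + Nat.primeCounting (2 * y - 19)
            ≤ (#{b ∈ Ioc 0 y | b ∈ B} : ℝ) + 5
              + (4 * #((Nat.primesLE (2 * y)).filter (fun p => (p + 2).Prime))
                + 3 * #((Nat.primesLE (2 * y)).filter (fun p => (p + 4).Prime))
                + 4 * #((Nat.primesLE (2 * y)).filter (fun p => (p + 6).Prime))
                + 3 * #((Nat.primesLE (2 * y)).filter (fun p => (p + 8).Prime))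
                + 2 * #((Nat.primesLE (2 * y)).filter (fun p => (p + 10).Prime))
                + 2 * #((Nat.primesLE (2 * y)).filter (fun p => (p + 12).Prime))
                + 2 * #((Nat.primesLE (2 * y)).filter (fun p => (p + 14).Prime))
                + #((Nat.primesLE (2 * y)).filter (fun p => (p + 16).Prime))) := by
          exact_mod_cast hcomb
        have hπ3 := hπ 3 (by norm_num)
        have hπ5 := hπ 5 (by norm_num)
        have hπ7 := hπ 7 (by norm_num)
        have hπ11 := hπ 11 (by norm_num)
        have hπ13 := hπ 13 (by norm_num)
        have hπ17 := hπ 17 (by norm_num)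
        have hπ19 := hπ 19 (by norm_num)
        push_cast at hπ3 hπ5 hπ7 hπ11 hπ13 hπ17 hπ19
        have h2yr : ((2 * y : ℕ) : ℝ) = 2 * (y : ℝ) := by push_cast; ring
        rw [h2yr] at hP2 hP4 hP6 hP8 hP10 hP12 hP14 hP16
        set G : ℝ := (#{b ∈ Ioc 0 y | b ∈ B} : ℝ) with hG
        set Y : ℝ := (y : ℝ) with hY
        have hY0 : 0 ≤ Y := le_trans (by norm_num) hy58
        have hL2 : (0 : ℝ) < L ^ 2 := by positivity
        have hG1 : (13.14866 * Y - 70.43925) / L - 5 - 996.37 * Y / L ^ 2 ≤ G := by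
          have e1 : (13.14866 * Y - 70.43925) / L
              = 0.93919 * (2 * Y - 3) / L + 0.93919 * (2 * Y - 5) / L + 0.93919 * (2 * Y - 7) / L + 0.93919 * (2 * Y - 11) / L + 0.93919 * (2 * Y - 13) / L + 0.93919 * (2 * Y - 17) / L + 0.93919 * (2 * Y - 19) / L := by
            field_simp
            ring
          have e2 : 4 * (17.75 * 1 * (2 * Y) / L ^ 2) + 3 * (17.75 * 1 * (2 * Y) / L ^ 2)
              + 4 * (17.75 * 2 * (2 * Y) / L ^ 2) + 3 * (17.75 * 1 * (2 * Y) / L ^ 2)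
              + 2 * (17.75 * (4 / 3) * (2 * Y) / L ^ 2) + 2 * (17.75 * 2 * (2 * Y) / L ^ 2)
              + 2 * (17.75 * (6 / 5) * (2 * Y) / L ^ 2) + 17.75 * 1 * (2 * Y) / L ^ 2
              = (29891 / 30) * Y / L ^ 2 := by
            field_simp
            ring
          have e3 : (29891 / 30 : ℝ) * Y / L ^ 2 ≤ 996.37 * Y / L ^ 2 :=
            div_le_div_of_nonneg_right (mul_le_mul_of_nonneg_right (by norm_num) hY0) hL2.le
          rw [e1]
          linarith [hcombr, hπ3, hπ5, hπ7, hπ11, hπ13, hπ17, hπ19, hP2, hP4, hP6, hP8, hP10, hP12, hP14, hP16,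
            e2, e3]
        have hkey : Y * L ^ 2 ≤ (h : ℝ) * G * L ^ 2 := by
          have e4 : ((13.14866 * Y - 70.43925) / L - 5 - 996.37 * Y / L ^ 2) * L ^ 2
              = 13.14866 * Y * L - 70.43925 * L - 5 * L ^ 2 - 996.37 * Y := by
            field_simp
          have h1 : (13.14866 * Y * L - 70.43925 * L - 5 * L ^ 2 - 996.37 * Y) * h ≤ G * L ^ 2 * h := by
            rw [← e4]
            exact mul_le_mul_of_nonneg_right (mul_le_mul_of_nonneg_right hG1 hL2.le) hh0.le
          have h2 : Y * (L ^ 2 + h) ≤ Y * (h * (13.14866 * L - 996.37)) :=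
            mul_le_mul_of_nonneg_left hq (by linarith)
          have h3 : 70.43925 * L + 5 * L ^ 2 ≤ Y := by
            nlinarith [mul_nonneg (sub_nonneg.2 hL4) hLpos.le]
          have h3' : (h : ℝ) * (70.43925 * L + 5 * L ^ 2) ≤ h * Y := mul_le_mul_of_nonneg_left h3 hh0.le
          nlinarith [h1, h2, h3']
        have hfin := le_of_mul_le_mul_right hkey hL2
        rw [div_le_iff₀ hh0, mul_comm]
        exact hfin
      · -- TWELVE SHIFTS on `(e^{L₃}, e^{Λ₀})`, pair sieve at the threshold `e^250`
        have hq := hquad12 L hmid3.le hLΛ.le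
        have he250 : Real.exp 250 ≤ ((2 * y : ℕ) : ℝ) := by
          have : Real.exp 250 ≤ Real.exp L := Real.exp_le_exp.mpr (hL₃.trans hmid3.le)
          rwa [hLdef, Real.exp_log h2y0] at this
        have hPt : ∀ d : ℕ, d ≠ 0 → Even d →
            (#((Nat.primesLE (2 * y)).filter (fun p => (p + d).Prime)) : ℝ)
              ≤ 13.82 * oddSingularFactor d * ((2 * y : ℕ) : ℝ) / L ^ 2 := by
          intro d hd hde
          rw [hLdef]
          exact pairCount_le_1382 (N := 2 * y) (h := d) he250 hd hde
        have hP2 := hPt 2 (by norm_num) (by norm_num)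
        have hP4 := hPt 4 (by norm_num) (by norm_num)
        have hP6 := hPt 6 (by norm_num) (by norm_num)
        have hP8 := hPt 8 (by norm_num) (by norm_num)
        have hP10 := hPt 10 (by norm_num) (by norm_num)
        have hP12 := hPt 12 (by norm_num) (by norm_num)
        have hP14 := hPt 14 (by norm_num) (by norm_num)
        have hP16 := hPt 16 (by norm_num) (by norm_num)
        have hP18 := hPt 18 (by norm_num) (by norm_num)
        have hP20 := hPt 20 (by norm_num) (by norm_num)
        have hP22 := hPt 22 (by norm_num) (by norm_num)
        have hP24 := hPt 24 (by norm_num) (by norm_num)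
        have hP26 := hPt 26 (by norm_num) (by norm_num)
        have hP28 := hPt 28 (by norm_num) (by norm_num)
        have hP30 := hPt 30 (by norm_num) (by norm_num)
        have hP32 := hPt 32 (by norm_num) (by norm_num)
        have hP34 := hPt 34 (by norm_num) (by norm_num)
        have hP36 := hPt 36 (by norm_num) (by norm_num)
        have hP38 := hPt 38 (by norm_num) (by norm_num)
        rw [oddSingularFactor_two'] at hP2
        rw [oddSingularFactor_four] at hP4
        rw [oddSingularFactor_six] at hP6
        rw [oddSingularFactor_eight] at hP8
        rw [oddSingularFactor_ten] at hP10
        rw [oddSingularFactor_twelve] at hP12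
        rw [oddSingularFactor_fourteen] at hP14
        rw [oddSingularFactor_sixteen] at hP16
        rw [oddSingularFactor_eighteen] at hP18
        rw [oddSingularFactor_twenty] at hP20
        rw [oddSingularFactor_twentytwo] at hP22
        rw [oddSingularFactor_twentyfour] at hP24
        rw [oddSingularFactor_twentysix] at hP26
        rw [oddSingularFactor_twentyeight] at hP28
        rw [oddSingularFactor_thirty] at hP30
        rw [oddSingularFactor_thirtytwo] at hP32
        rw [oddSingularFactor_thirtyfour] at hP34
        rw [oddSingularFactor_thirtysix] at hP36
        rw [oddSingularFactor_thirtyeight] at hP38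
        have hcomb := twelve_shift_count (y := y) (by omega)
        have hcombr : (Nat.primeCounting (2 * y - 3) : ℝ) + Nat.primeCounting (2 * y - 5)
            + Nat.primeCounting (2 * y - 7) + Nat.primeCounting (2 * y - 11) + Nat.primeCounting (2 * y - 13)
            + Nat.primeCounting (2 * y - 17) + Nat.primeCounting (2 * y - 19) + Nat.primeCounting (2 * y - 23)
            + Nat.primeCounting (2 * y - 29) + Nat.primeCounting (2 * y - 31) + Nat.primeCounting (2 * y - 37)
            + Nat.primeCounting (2 * y - 41)
            ≤ (#{b ∈ Ioc 0 y | b ∈ (({0, 1} : Set ℕ) ∪ {m | ∃ p q : ℕ, p.Prime ∧ q.Prime ∧ p + q = 2 * m})} : ℝ) + 10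
              + (5 * #((Nat.primesLE (2 * y)).filter (fun p => (p + 2).Prime))
                + 5 * #((Nat.primesLE (2 * y)).filter (fun p => (p + 4).Prime))
                + 7 * #((Nat.primesLE (2 * y)).filter (fun p => (p + 6).Prime))
                + 5 * #((Nat.primesLE (2 * y)).filter (fun p => (p + 8).Prime))
                + 5 * #((Nat.primesLE (2 * y)).filter (fun p => (p + 10).Prime))
                + 6 * #((Nat.primesLE (2 * y)).filter (fun p => (p + 12).Prime))
                + 4 * #((Nat.primesLE (2 * y)).filter (fun p => (p + 14).Prime))
                + 3 * #((Nat.primesLE (2 * y)).filter (fun p => (p + 16).Prime))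
                + 5 * #((Nat.primesLE (2 * y)).filter (fun p => (p + 18).Prime))
                + 3 * #((Nat.primesLE (2 * y)).filter (fun p => (p + 20).Prime))
                + 2 * #((Nat.primesLE (2 * y)).filter (fun p => (p + 22).Prime))
                + 4 * #((Nat.primesLE (2 * y)).filter (fun p => (p + 24).Prime))
                + 3 * #((Nat.primesLE (2 * y)).filter (fun p => (p + 26).Prime))
                + 2 * #((Nat.primesLE (2 * y)).filter (fun p => (p + 28).Prime))
                + 2 * #((Nat.primesLE (2 * y)).filter (fun p => (p + 30).Prime))
                + #((Nat.primesLE (2 * y)).filter (fun p => (p + 32).Prime))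
                + 2 * #((Nat.primesLE (2 * y)).filter (fun p => (p + 34).Prime))
                + #((Nat.primesLE (2 * y)).filter (fun p => (p + 36).Prime))
                + #((Nat.primesLE (2 * y)).filter (fun p => (p + 38).Prime))) := by
          exact_mod_cast hcomb
        have hπ3 := hπ 3 (by norm_num)
        have hπ5 := hπ 5 (by norm_num)
        have hπ7 := hπ 7 (by norm_num)
        have hπ11 := hπ 11 (by norm_num)
        have hπ13 := hπ 13 (by norm_num)
        have hπ17 := hπ 17 (by norm_num)
        have hπ19 := hπ 19 (by norm_num)
        have hπ23 := hπ 23 (by norm_num)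
        have hπ29 := hπ 29 (by norm_num)
        have hπ31 := hπ 31 (by norm_num)
        have hπ37 := hπ 37 (by norm_num)
        have hπ41 := hπ 41 (by norm_num)
        push_cast at hπ3 hπ5 hπ7 hπ11 hπ13 hπ17 hπ19 hπ23 hπ29 hπ31 hπ37 hπ41
        have h2yr : ((2 * y : ℕ) : ℝ) = 2 * (y : ℝ) := by push_cast; ring
        rw [h2yr] at hP2 hP4 hP6 hP8 hP10 hP12 hP14 hP16 hP18 hP20 hP22 hP24 hP26 hP28 hP30 hP32 hP34 hP36 hP38
        set G : ℝ := (#{b ∈ Ioc 0 y | b ∈ (({0, 1} : Set ℕ) ∪ {m | ∃ p q : ℕ, p.Prime ∧ q.Prime ∧ p + q = 2 * m})} : ℝ) with hG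
        set Y : ℝ := (y : ℝ) with hY
        have hY0 : 0 ≤ Y := le_trans (by norm_num) hy58
        have hL2 : (0 : ℝ) < L ^ 2 := by positivity
        have hG1 : (22.54056 * Y - 221.64884) / L - 10 - 2678 * Y / L ^ 2 ≤ G := by
          have e1 : (22.54056 * Y - 221.64884) / L
              = 0.93919 * (2 * Y - 3) / L + 0.93919 * (2 * Y - 5) / L + 0.93919 * (2 * Y - 7) / L + 0.93919 * (2 * Y - 11) / L
                + 0.93919 * (2 * Y - 13) / L + 0.93919 * (2 * Y - 17) / L + 0.93919 * (2 * Y - 19) / L + 0.93919 * (2 * Y - 23) / L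
                + 0.93919 * (2 * Y - 29) / L + 0.93919 * (2 * Y - 31) / L + 0.93919 * (2 * Y - 37) / L + 0.93919 * (2 * Y - 41) / L := by
            field_simp
            ring
          have e2 : 5 * (13.82 * 1 * (2 * Y) / L ^ 2)
              + 5 * (13.82 * 1 * (2 * Y) / L ^ 2)
              + 7 * (13.82 * 2 * (2 * Y) / L ^ 2)
              + 5 * (13.82 * 1 * (2 * Y) / L ^ 2)
              + 5 * (13.82 * (4 / 3) * (2 * Y) / L ^ 2)
              + 6 * (13.82 * 2 * (2 * Y) / L ^ 2)
              + 4 * (13.82 * (6 / 5) * (2 * Y) / L ^ 2)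
              + 3 * (13.82 * 1 * (2 * Y) / L ^ 2)
              + 5 * (13.82 * 2 * (2 * Y) / L ^ 2)
              + 3 * (13.82 * (4 / 3) * (2 * Y) / L ^ 2)
              + 2 * (13.82 * (10 / 9) * (2 * Y) / L ^ 2)
              + 4 * (13.82 * 2 * (2 * Y) / L ^ 2)
              + 3 * (13.82 * (12 / 11) * (2 * Y) / L ^ 2)
              + 2 * (13.82 * (6 / 5) * (2 * Y) / L ^ 2)
              + 2 * (13.82 * (8 / 3) * (2 * Y) / L ^ 2)
              + 13.82 * 1 * (2 * Y) / L ^ 2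
              + 2 * (13.82 * (16 / 15) * (2 * Y) / L ^ 2)
              + 13.82 * 2 * (2 * Y) / L ^ 2
              + 13.82 * (18 / 17) * (2 * Y) / L ^ 2
              = (112675151 / 42075) * Y / L ^ 2 := by
            field_simp
            ring
          have e3 : (112675151 / 42075 : ℝ) * Y / L ^ 2 ≤ 2678 * Y / L ^ 2 :=
            div_le_div_of_nonneg_right (mul_le_mul_of_nonneg_right (by norm_num) hY0) hL2.le
          rw [e1]
          linarith [hcombr, hπ3, hπ5, hπ7, hπ11, hπ13, hπ17, hπ19, hπ23, hπ29, hπ31, hπ37, hπ41,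
            hP2, hP4, hP6, hP8, hP10, hP12, hP14, hP16, hP18, hP20, hP22, hP24, hP26, hP28, hP30, hP32, hP34, hP36, hP38, e2, e3]
        have hkey : Y * L ^ 2 ≤ (h : ℝ) * G * L ^ 2 := by
          have e4 : ((22.54056 * Y - 221.64884) / L - 10 - 2678 * Y / L ^ 2) * L ^ 2
              = 22.54056 * Y * L - 221.64884 * L - 10 * L ^ 2 - 2678 * Y := by
            field_simp
          have h1 : (22.54056 * Y * L - 221.64884 * L - 10 * L ^ 2 - 2678 * Y) * h ≤ G * L ^ 2 * h := by
            rw [← e4]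
            exact mul_le_mul_of_nonneg_right (mul_le_mul_of_nonneg_right hG1 hL2.le) hh0.le
          have h2 : Y * (L ^ 2 + h) ≤ Y * (h * (22.54056 * L - 2678)) :=
            mul_le_mul_of_nonneg_left hq (by linarith)
          have h3 : 221.64884 * L + 10 * L ^ 2 ≤ Y := by
            nlinarith [mul_nonneg (sub_nonneg.2 hL4) hLpos.le]
          have h3' : (h : ℝ) * (221.64884 * L + 10 * L ^ 2) ≤ h * Y := mul_le_mul_of_nonneg_left h3 hh0.le
          nlinarith [h1, h2, h3']
        have hfin := le_of_mul_le_mul_right hkey hL2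
        rw [div_le_iff₀ hh0, mul_comm]
        exact hfin

/-! #### §3.4 Instances: `K = 57` unconditionally -/

/-- Numerics at `Λ = 390`: `17L² ≤ 16·13.57·TlowK(L/2 − 1.38632)` for `L ≥ 390` (`q(13.59, 390) = 1006`). [folklore] -/
private theorem kappa_numeric_390 {L : ℝ} (hL : 390 ≤ L) :
    17 * L ^ 2 ≤ 16 * (13.59 - 0.02) * TwoResidueSelbergExplicit.TlowK (L / 2 - 1.38632) := by
  unfold TwoResidueSelbergExplicit.TlowK
  nlinarith [hL, mul_self_nonneg (L - 390)]

/-- **`A = 13.59` above `e^390`**. [cite: BatemanDiamond2004, §13.4 (13.13)–(13.14)] -/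
theorem goldbachCount_le_1359 {N : ℕ} (hN : Real.exp 390 ≤ (N : ℝ)) (heven : Even N) :
    (SingularSeries.goldbachCount N : ℝ) ≤ 13.59 * oddSingularFactor N * (N : ℝ) / Real.log (N : ℝ) ^ 2 :=
  goldbachCount_le_of_numeric41 (by norm_num) (fun _ hL => kappa_numeric_390 hL) hN heven

/-- **Unconditional, above `e^400`**: at least `x/56` EVEN Goldbach numbers in `(0, x]`
(`Λs = 390`, `A = 13.59`, `c₁ = 0.441`; `(1/56)⁷·259.55·13.59⁸ = 0.17485 ≤ (0.4409·gHol 400 − 0.0057)⁸ = 0.18066`,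
slack ×1.033). [cite: Nathanson1996, Theorem 7.8 (proof, restricted to even N; explicit form proved here)] -/
theorem goldbach_even_count_ge_56_exp400 {x : ℕ} (hx : Real.exp 400 ≤ (x : ℝ)) :
    (x : ℝ) / 56 ≤ #{N ∈ Ioc 0 x | Even N ∧ ∃ p q : ℕ, p.Prime ∧ q.Prime ∧ p + q = N} := by
  have h := goldbach_even_count_ge_holder_gap10 (Λs := 390) (Λ₀ := 400) (A := 13.59) (c₁ := 0.441) (κ := 1 / 56)
    (by norm_num) (by norm_num) (by norm_num) (by norm_num) (by norm_num)
    (fun N hN hev => goldbachCount_le_1359 hN hev) (by norm_num) (by norm_num)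
    (fun y hy => sum_goldbachCount_ge_0441 ((Real.exp_le_exp.mpr (by norm_num)).trans hy))
    (by unfold gHol; norm_num) (by unfold gHol; norm_num) hx
  have e : (1 : ℝ) / 56 * x = x / 56 := by ring
  rw [e] at h
  exact h

/-- **Unconditional count for all `y ≥ 1`**: `B(y) ≥ y/28` (one shift below `e^51.5872 = e^{1.8424·28}`, four shifts on
`[51.5872, 150]`, seven on `[150, 250]`, twelve on `[250, 400]`, the count above `e^400`). [cite: Nathanson1996, Theorem 7.8 (explicit constant for the halved set proved here)] -/
theorem half_count_ge_allN_28 {y : ℕ} (hy : 1 ≤ y) :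
    (y : ℝ) / 28 ≤ #{b ∈ Ioc 0 y | b ∈ (({0, 1} : Set ℕ) ∪ {m | ∃ p q : ℕ, p.Prime ∧ q.Prime ∧ p + q = 2 * m})} := by
  have h := half_count_ge_allN_bonf12S (L₁ := 51.5872) (L₂ := 150) (L₃ := 250) (Λ₀ := 400) (h := 28) (by norm_num)
    (by norm_num) (by norm_num) (by norm_num) (by norm_num)
    (fun L h1 h2 => by
      push_cast
      nlinarith [mul_nonneg (sub_nonneg.2 h1) (sub_nonneg.2 h2)])
    (fun L h1 h2 => by
      push_cast
      nlinarith [mul_nonneg (sub_nonneg.2 h1) (sub_nonneg.2 h2)])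
    (fun L h1 h2 => by
      push_cast
      nlinarith [mul_nonneg (sub_nonneg.2 h1) (sub_nonneg.2 h2)])
    (fun x hx => by
      have h1 := goldbach_even_count_ge_56_exp400 hx
      have e : (x : ℝ) / (2 * ((28 : ℕ) : ℝ)) = (x : ℝ) / 56 := by norm_num
      rw [e]
      exact h1) hy
  exact_mod_cast h

/-- **The halved density, `1/28`**: `σ({0, 1} ∪ {m : 2m = p + q}) ≥ 1/28`, unconditionally. [cite: Nathanson1996, Theorem 7.8 (explicit constant for the halved set proved here)] -/
theorem schnirelmannDensity_half_ge_28 :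
    (1 : ℝ) / 28 ≤ schnirelmannDensity
      (({0, 1} : Set ℕ) ∪ {m | ∃ p q : ℕ, p.Prime ∧ q.Prime ∧ p + q = 2 * m}) := by
  have h := schnirelmannDensity_ge_of_count' (K := 28)
    (S := ({0, 1} : Set ℕ) ∪ {m | ∃ p q : ℕ, p.Prime ∧ q.Prime ∧ p + q = 2 * m})
    (fun N hN => by have := half_count_ge_allN_28 hN; exact_mod_cast this)
  exact_mod_cast h

/-- ★★★★★★★★★★★★ **The Shnirel'man–Goldbach theorem, explicit and unconditional — the best constant of this file: every
integer `N ≥ 2` is a sum of at most `57` primes** (four-regime glue: one / four / seven / twelve shifted copies of the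
primes, the twelve-shift regime with the pair sieve run at its own threshold `e^250` (`13.82` for `17.75`); Sylvester's
constant; sieve at `e^390` (`A = 13.59`), count at `e^400` (`|T| ≥ x/56`); `B(y) ≥ y/28`; halving, Mann: `28 • B = ℕ`,
`2·28 + 1`).  No hypotheses, no named facts. [cite: Nathanson1996, Thm 7.9 (explicit constant proved here)] -/
theorem schnirelmann_goldbach_le_57 (N : ℕ) (hN : 2 ≤ N) :
    ∃ M : Multiset ℕ, (∀ p ∈ M, p.Prime) ∧ Multiset.card M ≤ 57 ∧ M.sum = N := by
  have hσ : (1 : ℝ) / ((28 : ℕ) : ℝ) ≤ schnirelmannDensity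
      (({0, 1} : Set ℕ) ∪ {m | ∃ p q : ℕ, p.Prime ∧ q.Prime ∧ p + q = 2 * m}) := by
    have := schnirelmannDensity_half_ge_28
    exact_mod_cast this
  exact sum_of_primes_of_half_density_mann (h := 28) (by norm_num) hσ N hN

/-! ### Private copies (verbatim) of further helpers of §1–§19 used by §21 -/

/-- `r(N) ≤ N + 1`. [folklore] -/
private theorem goldbachCount_le_succ (N : ℕ) : SingularSeries.goldbachCount N ≤ N + 1 := by
  unfold SingularSeries.goldbachCount
  exact (card_filter_le _ _).trans (by rw [Finset.Nat.card_antidiagonal])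

/-- For odd `N`, `r(N) ≤ 2` (one of `p, q` is even, hence `= 2`). [folklore] -/
private theorem goldbachCount_le_two_of_odd {N : ℕ} (hN : Odd N) : SingularSeries.goldbachCount N ≤ 2 := by
  unfold SingularSeries.goldbachCount
  calc #{pq ∈ antidiagonal N | pq.1.Prime ∧ pq.2.Prime}
      ≤ #({(2, N - 2), (N - 2, 2)} : Finset (ℕ × ℕ)) := by
        refine card_le_card fun pq hpq => ?_
        rw [mem_filter, Finset.HasAntidiagonal.mem_antidiagonal] at hpq
        obtain ⟨hsum, hp, hq⟩ := hpq
        rw [mem_insert, mem_singleton]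
        rcases Nat.even_or_odd pq.1 with h1 | h1
        · have h2 : pq.1 = 2 := (Nat.Prime.even_iff hp).mp h1
          left
          exact Prod.ext h2 (by simp only; omega)
        · have h2 : Even pq.2 := by
            rw [← hsum] at hN
            exact (Nat.odd_add.mp hN).mp h1
          have h3 : pq.2 = 2 := (Nat.Prime.even_iff hq).mp h2
          right
          exact Prod.ext (by simp only; omega) h3
    _ ≤ 2 := card_le_two

/-- `t/log²t` is increasing on `[e², ∞)`. [folklore] -/
private theorem div_log_sq_mono {a b : ℝ} (ha : Real.exp 2 ≤ a) (hab : a ≤ b) :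
    a / Real.log a ^ 2 ≤ b / Real.log b ^ 2 := by
  have ha0 : 0 < a := lt_of_lt_of_le (Real.exp_pos 2) ha
  have hb0 : 0 < b := lt_of_lt_of_le ha0 hab
  have hu2 : 2 ≤ Real.log a := by
    have := Real.log_le_log (Real.exp_pos 2) ha
    rwa [Real.log_exp] at this
  have huv : Real.log a ≤ Real.log b := Real.log_le_log ha0 hab
  have hexp : b = a * Real.exp (Real.log b - Real.log a) := by
    rw [Real.exp_sub, Real.exp_log hb0, Real.exp_log ha0]
    field_simp
  set u := Real.log a with hu_def
  set v := Real.log b with hv_def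
  set d := v - u with hd
  have hd0 : 0 ≤ d := by rw [hd]; linarith
  have hq := Real.quadratic_le_exp_of_nonneg hd0
  have hu0 : (0 : ℝ) < u := by linarith
  have hv0 : (0 : ℝ) < v := by linarith
  rw [div_le_div_iff₀ (pow_pos hu0 2) (pow_pos hv0 2)]
  have hv : v = u + d := by rw [hd]; ring
  rw [hv, hexp]
  have hin : (u + d) ^ 2 ≤ (1 + d + d ^ 2 / 2) * u ^ 2 := by
    nlinarith [mul_nonneg hd0 (by nlinarith : (0 : ℝ) ≤ u ^ 2 - 2 * u),
      mul_nonneg (sq_nonneg d) (by nlinarith : (0 : ℝ) ≤ u ^ 2 / 2 - 1)]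
  calc a * (u + d) ^ 2 ≤ a * ((1 + d + d ^ 2 / 2) * u ^ 2) := mul_le_mul_of_nonneg_left hin ha0.le
    _ ≤ a * (Real.exp d * u ^ 2) :=
        mul_le_mul_of_nonneg_left (mul_le_mul_of_nonneg_right hq (sq_nonneg u)) ha0.le
    _ = a * Real.exp d * u ^ 2 := by ring

/-- `log⁴x ≤ 4096·√x` for `x ≥ 1` (`log x = 8 log x^{1/8} ≤ 8 x^{1/8}`). [folklore] -/
private theorem log_pow_four_le_sqrt {x : ℝ} (hx : 1 ≤ x) : Real.log x ^ 4 ≤ 4096 * Real.sqrt x := by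
  set t := Real.sqrt (Real.sqrt (Real.sqrt x)) with ht
  have hx0 : 0 ≤ x := by linarith
  have ht1 : 1 ≤ t := Real.one_le_sqrt.mpr (Real.one_le_sqrt.mpr (Real.one_le_sqrt.mpr hx))
  have ht0 : 0 < t := by linarith
  have ht2 : t ^ 2 = Real.sqrt (Real.sqrt x) := by rw [ht, Real.sq_sqrt (Real.sqrt_nonneg _)]
  have ht4 : t ^ 4 = Real.sqrt x := by
    rw [show t ^ 4 = (t ^ 2) ^ 2 by ring, ht2, Real.sq_sqrt (Real.sqrt_nonneg _)]
  have ht8 : t ^ 8 = x := by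
    rw [show t ^ 8 = (t ^ 4) ^ 2 by ring, ht4, Real.sq_sqrt hx0]
  have hlog : Real.log x = 8 * Real.log t := by
    rw [← ht8, Real.log_pow]; norm_num
  have hlt : Real.log t ≤ t := by linarith [Real.log_le_sub_one_of_pos ht0]
  have hl0 : 0 ≤ Real.log t := Real.log_nonneg ht1
  rw [hlog, ← ht4, show (8 * Real.log t) ^ 4 = 4096 * Real.log t ^ 4 by ring]
  exact mul_le_mul_of_nonneg_left (pow_le_pow_left₀ hl0 hlt 4) (by norm_num)

/-- **Odd `N` are negligible in the first moment**: `Σ_{odd N ≤ x} r(N) ≤ 2(x + 1)`. [folklore] -/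
private theorem sum_goldbachCount_odd_le (x : ℕ) :
    ∑ N ∈ (range (x + 1)).filter (fun N => ¬Even N), (SingularSeries.goldbachCount N : ℝ) ≤ 2 * ((x : ℝ) + 1) := by
  calc ∑ N ∈ (range (x + 1)).filter (fun N => ¬Even N), (SingularSeries.goldbachCount N : ℝ)
      ≤ ∑ N ∈ (range (x + 1)).filter (fun N => ¬Even N), (2 : ℝ) := sum_le_sum fun N hN => by
        rw [mem_filter] at hN
        exact_mod_cast goldbachCount_le_two_of_odd (Nat.not_even_iff_odd.mp hN.2)
    _ = #((range (x + 1)).filter (fun N => ¬Even N)) * 2 := by rw [sum_const, nsmul_eq_mul]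
    _ ≤ ((x : ℝ) + 1) * 2 := by
        apply mul_le_mul_of_nonneg_right _ (by norm_num)
        have : #((range (x + 1)).filter (fun N => ¬Even N)) ≤ x + 1 :=
          (card_filter_le _ _).trans (by rw [card_range])
        exact_mod_cast this
    _ = 2 * ((x : ℝ) + 1) := by ring

/-- `0 < log 1.01`. [folklore] -/
private theorem log_101_pos : 0 < Real.log ((101 : ℝ) / 100) := Real.log_pos (by norm_num)

/-- `log 1.01 ≤ 0.01`. [folklore] -/
private theorem log_101_le : Real.log ((101 : ℝ) / 100) ≤ 0.01 := by
  have h := Real.log_le_sub_one_of_pos (show (0 : ℝ) < 101 / 100 by norm_num)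
  have e : (101 : ℝ) / 100 - 1 = 0.01 := by norm_num
  rw [e] at h
  exact h

/-- Staircase / counting bookkeeping (verbatim private copy of the earlier modules' helper). [folklore] -/
private theorem stairT_zero (x : ℕ) : stairT x 0 = x := by simp [stairT]

/-- Staircase / counting bookkeeping (verbatim private copy of the earlier modules' helper). [folklore] -/
private theorem stairT_succ (x j : ℕ) : stairT x j = (101 / 100) * stairT x (j + 1) := by
  unfold stairT
  rw [pow_succ]
  field_simp

/-- Staircase / counting bookkeeping (verbatim private copy of the earlier modules' helper). [folklore] -/
private theorem stairT_eq_mul_pow (x j : ℕ) : stairT x j = (x : ℝ) * ((100 : ℝ) / 101) ^ j := by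
  unfold stairT
  rw [div_eq_mul_inv, ← inv_pow]
  norm_num

/-- Staircase / counting bookkeeping (verbatim private copy of the earlier modules' helper). [folklore] -/
private theorem stairT_nonneg (x j : ℕ) : 0 ≤ stairT x j := by unfold stairT; positivity

/-- Staircase / counting bookkeeping (verbatim private copy of the earlier modules' helper). [folklore] -/
private theorem stairT_pos {x : ℕ} (hx : 0 < x) (j : ℕ) : 0 < stairT x j := by
  unfold stairT
  have : (0 : ℝ) < x := by exact_mod_cast hx
  positivity

/-- Staircase / counting bookkeeping (verbatim private copy of the earlier modules' helper). [folklore] -/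
private theorem stairT_le_of_le (x : ℕ) {i j : ℕ} (hij : i ≤ j) : stairT x j ≤ stairT x i := by
  unfold stairT
  apply div_le_div_of_nonneg_left (Nat.cast_nonneg x) (by positivity)
  exact pow_le_pow_right₀ (by norm_num) hij

/-- Staircase / counting bookkeeping (verbatim private copy of the earlier modules' helper). [folklore] -/
private theorem stairT_le_self (x j : ℕ) : stairT x j ≤ x := by
  have := stairT_le_of_le x (Nat.zero_le j)
  rwa [stairT_zero] at this

/-- Staircase / counting bookkeeping (verbatim private copy of the earlier modules' helper). [folklore] -/
private theorem log_stairT {x : ℕ} (hx : 0 < x) (j : ℕ) : Real.log (stairT x j) = stairL x j := by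
  unfold stairT stairL
  have hx' : (0 : ℝ) < x := by exact_mod_cast hx
  rw [Real.log_div (ne_of_gt hx') (by positivity), Real.log_pow]

/-- Staircase / counting bookkeeping (verbatim private copy of the earlier modules' helper). [folklore] -/
private theorem stairL_succ (x j : ℕ) : stairL x j = stairL x (j + 1) + Real.log ((101 : ℝ) / 100) := by
  unfold stairL; push_cast; ring

/-- Staircase / counting bookkeeping (verbatim private copy of the earlier modules' helper). [folklore] -/
private theorem stairL_le_of_le (x : ℕ) {i j : ℕ} (hij : i ≤ j) : stairL x j ≤ stairL x i := by
  unfold stairL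
  have : (i : ℝ) ≤ j := by exact_mod_cast hij
  nlinarith [log_101_pos]

/-- `ℓ_j ≥ log x − 0.01·j`. [folklore] -/
private theorem stairL_ge (x j : ℕ) : Real.log (x : ℝ) - 0.01 * j ≤ stairL x j := by
  unfold stairL
  have hj : (0 : ℝ) ≤ j := Nat.cast_nonneg j
  nlinarith [log_101_le]

/-- A downward-closed subset of `range J` is an initial segment. [folklore] -/
private theorem filter_range_eq_range_card {p : ℕ → Prop} [DecidablePred p]
    (hp : ∀ i j, i ≤ j → p j → p i) (J : ℕ) :
    (range J).filter p = range #((range J).filter p) := by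
  set S := (range J).filter p with hS
  ext j
  rw [mem_range]
  constructor
  · intro hj
    have hsub : range (j + 1) ⊆ S := by
      intro i hi
      rw [mem_range] at hi
      rw [hS, mem_filter, mem_range] at hj ⊢
      exact ⟨by omega, hp i j (by omega) hj.2⟩
    have := card_le_card hsub
    rw [card_range] at this
    omega
  · intro hj
    by_contra hjS
    have hsub : S ⊆ range j := by
      intro i hi
      rw [mem_range]
      by_contra hij
      rw [not_lt] at hij
      apply hjS
      rw [hS, mem_filter, mem_range] at hi ⊢
      exact ⟨by omega, hp j i hij hi.2⟩
    have := card_le_card hsub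
    rw [card_range] at this
    omega

/-- Telescoping: `Σ_{j<s} c_j = Mf(s)`. [folklore] -/
private theorem sum_range_stairC (x s : ℕ) : ∑ j ∈ range s, stairC x j = stairMf x s := by
  unfold stairC
  rw [Finset.sum_range_sub]
  simp [stairMf]

/-- **The staircase identification**: for `N ≤ x` there is a block index `k < J` with `m(N) = M_k`,
`N ≤ t_k`, and `t_{k+1} < N` unless `k + 1 = J`. [folklore] -/
private theorem stairW_eq {x J N : ℕ} (hJ : 0 < J) (hNx : (N : ℝ) ≤ x) :
    ∃ k, k < J ∧ stairW x J N = stairM x k ∧ (N : ℝ) ≤ stairT x k ∧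
      (k + 1 < J → stairT x (k + 1) < N) := by
  set S := (range J).filter (fun j => (N : ℝ) ≤ stairT x j) with hS
  have hSeq : S = range #S :=
    filter_range_eq_range_card (fun i j hij hj => hj.trans (stairT_le_of_le x hij)) J
  have h0 : 0 ∈ S := by
    rw [hS, mem_filter, mem_range, stairT_zero]
    exact ⟨hJ, hNx⟩
  obtain ⟨k, hk⟩ : ∃ k, #S = k + 1 := ⟨#S - 1, by have := card_pos.mpr ⟨0, h0⟩; omega⟩
  rw [hk] at hSeq
  have hmem : ∀ j, j ∈ S ↔ j < k + 1 := fun j => by rw [hSeq, mem_range]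
  have hkS : k ∈ S := (hmem k).mpr (by omega)
  have hkS' := hkS
  rw [hS, mem_filter, mem_range] at hkS'
  refine ⟨k, hkS'.1, ?_, hkS'.2, fun hk1 => ?_⟩
  · unfold stairW
    rw [← hS, hSeq, sum_range_stairC]
    rfl
  · by_contra hle
    rw [not_lt] at hle
    have h1 : k + 1 ∈ S := by
      rw [hS, mem_filter, mem_range]
      exact ⟨hk1, hle⟩
    have := (hmem _).mp h1
    omega

/-- Staircase / counting bookkeeping (verbatim private copy of the earlier modules' helper). [folklore] -/
private theorem stairC_zero (x : ℕ) : stairC x 0 = stairM x 0 := by simp [stairC, stairMf]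

/-- Staircase / counting bookkeeping (verbatim private copy of the earlier modules' helper). [folklore] -/
private theorem stairC_succ (x j : ℕ) : stairC x (j + 1) = stairM x (j + 1) - stairM x j := by
  simp [stairC, stairMf]

/-- `M_j ≤ M_{j+1}` as soon as `ℓ_{j+2} ≥ 3`. [folklore] -/
private theorem stairM_mono {x : ℕ} (hx : 0 < x) {j : ℕ} (hℓ : 3 ≤ stairL x (j + 1 + 1)) :
    stairM x j ≤ stairM x (j + 1) := by
  unfold stairM
  have ht := stairT_pos hx (j + 1)
  rw [stairT_succ x j, div_le_div_iff₀ (by positivity) ht, stairL_succ x (j + 1)]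
  set l := stairL x (j + 1 + 1)
  set lam := Real.log ((101 : ℝ) / 100)
  have hlam := log_101_le
  have hlam0 := log_101_pos
  have h : (l + lam) ^ 2 ≤ 101 / 100 * l ^ 2 := by nlinarith
  nlinarith [mul_le_mul_of_nonneg_left h ht.le]

/-- `c_j ≥ 0` for `j < J` as soon as `ℓ_J ≥ 3`. [folklore] -/
private theorem stairC_nonneg {x : ℕ} (hx : 0 < x) {J j : ℕ} (hj : j < J) (hℓ : 3 ≤ stairL x J) :
    0 ≤ stairC x j := by
  cases j with
  | zero =>
      rw [stairC_zero]
      unfold stairM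
      exact div_nonneg (sq_nonneg _) (stairT_nonneg x 0)
  | succ i =>
      rw [stairC_succ, sub_nonneg]
      exact stairM_mono hx (hℓ.trans (stairL_le_of_le x (by omega)))

/-- **The swap**: `Σ_N r(N)·m(N) = Σ_j c_j·Σ_{N ≤ t_j} r(N)`. [folklore] -/
private theorem sum_mul_stairW (x J : ℕ) (E : Finset ℕ) (r : ℕ → ℝ) :
    ∑ N ∈ E, r N * stairW x J N
      = ∑ j ∈ range J, stairC x j * ∑ N ∈ E.filter (fun N : ℕ => (N : ℝ) ≤ stairT x j), r N := by
  unfold stairW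
  simp_rw [Finset.sum_filter, Finset.mul_sum]
  rw [Finset.sum_comm]
  refine sum_congr rfl fun j _ => sum_congr rfl fun N _ => ?_
  split_ifs <;> ring

/-- `{even N ≤ x : N ≤ t} = {even N ≤ ⌊t⌋}` for `0 ≤ t ≤ x`. [folklore] -/
private theorem filter_even_le_eq {x : ℕ} {t : ℝ} (ht0 : 0 ≤ t) (htx : t ≤ x) :
    ((range (x + 1)).filter Even).filter (fun N : ℕ => (N : ℝ) ≤ t) = (range (⌊t⌋₊ + 1)).filter Even := by
  ext N
  simp only [mem_filter, mem_range]
  constructor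
  · rintro ⟨⟨_, he⟩, hNt⟩
    exact ⟨by have := Nat.le_floor hNt; omega, he⟩
  · rintro ⟨hN, he⟩
    have hN' : N ≤ ⌊t⌋₊ := by omega
    have hNt : (N : ℝ) ≤ t := (Nat.le_floor_iff ht0).mp hN'
    have hNx : (N : ℝ) ≤ x := hNt.trans htx
    have hNx' : N ≤ x := by exact_mod_cast hNx
    exact ⟨⟨by omega, he⟩, hNt⟩

/-- **The level-`0` term**: `c_0·(x−1)²/ℓ_0² ≥ (1 − 0.01/Λ₀)²·(x − 2)` for `log x ≥ Λ₀ ≥ 1`. [folklore] -/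
private theorem stair_term_zero_ge {x : ℕ} (hx : 0 < x) {Λ₀ : ℝ} (hΛ₀ : 1 ≤ Λ₀) (hL : Λ₀ ≤ Real.log (x : ℝ)) :
    (1 - 0.01 / Λ₀) ^ 2 * ((x : ℝ) - 2)
      ≤ stairC x 0 * ((stairT x 0 - 1) ^ 2 / stairL x 0 ^ 2) := by
  rw [stairC_zero, stairT_zero]
  unfold stairM
  rw [stairT_zero]
  have hx' : (0 : ℝ) < x := by exact_mod_cast hx
  set L := Real.log (x : ℝ) with hL_def
  set lam := Real.log ((101 : ℝ) / 100)
  have hlam := log_101_le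
  have hlam0 := log_101_pos
  have hL0 : 0 < L := by linarith
  have hl0 : stairL x 0 = L := by simp [stairL, hL_def]
  have hl1 : stairL x (0 + 1) = L - lam := by simp [stairL, hL_def, lam]
  rw [hl0, hl1]
  -- `(L - lam)^2/x * ((x-1)^2/L^2) = ((L-lam)/L)^2 * ((x-1)^2/x) ≥ (1 - 0.01/Λ₀)^2 * (x - 2)`
  have h1 : 1 - 0.01 / Λ₀ ≤ (L - lam) / L := by
    rw [le_div_iff₀ hL0]
    have : lam ≤ 0.01 / Λ₀ * L := by
      have h2 : 0.01 / Λ₀ * Λ₀ = 0.01 := by field_simp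
      nlinarith [div_nonneg (by norm_num : (0:ℝ) ≤ 0.01) (by linarith : (0:ℝ) ≤ Λ₀)]
    nlinarith
  have h0 : 0 ≤ 1 - 0.01 / Λ₀ := by
    have : 0.01 / Λ₀ ≤ 0.01 / 1 := div_le_div_of_nonneg_left (by norm_num) (by norm_num) hΛ₀
    linarith
  have h2 : (1 - 0.01 / Λ₀) ^ 2 ≤ ((L - lam) / L) ^ 2 := pow_le_pow_left₀ h0 h1 2
  have h3 : (x : ℝ) - 2 ≤ ((x : ℝ) - 1) ^ 2 / x := by
    rw [le_div_iff₀ hx']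
    nlinarith
  have e : (L - lam) ^ 2 / (x : ℝ) * (((x : ℝ) - 1) ^ 2 / L ^ 2) = ((L - lam) / L) ^ 2 * (((x : ℝ) - 1) ^ 2 / x) := by
    rw [div_pow]
    field_simp
  rw [e]
  by_cases hx2 : (x : ℝ) - 2 ≤ 0
  · have : 0 ≤ ((L - lam) / L) ^ 2 * (((x : ℝ) - 1) ^ 2 / x) := by positivity
    nlinarith [sq_nonneg (1 - 0.01 / Λ₀)]
  · rw [not_le] at hx2
    exact mul_le_mul h2 h3 hx2.le (by positivity)

/-- **The level-`(k+1)` terms**: `c_{k+1}·(t_{k+1} − 1)²/ℓ_{k+1}² ≥ ((1 − 0.01/ℓ*)² − 100/101)·(t_{k+1} − 2)`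
whenever `3 ≤ ℓ* ≤ ℓ_{k+1}` and `t_{k+1} ≥ 2`. [folklore] -/
private theorem stair_term_succ_ge {x : ℕ} {ls : ℝ} (hls : 3 ≤ ls) {k : ℕ}
    (hℓ : ls ≤ stairL x (k + 1)) (ht2 : 2 ≤ stairT x (k + 1)) :
    ((1 - 0.01 / ls) ^ 2 - 100 / 101) * (stairT x (k + 1) - 2)
      ≤ stairC x (k + 1) * ((stairT x (k + 1) - 1) ^ 2 / stairL x (k + 1) ^ 2) := by
  rw [stairC_succ]
  unfold stairM
  rw [stairT_succ x k]
  set t := stairT x (k + 1) with ht_def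
  set l1 := stairL x (k + 1) with hl1_def
  set l2 := stairL x (k + 1 + 1) with hl2_def
  set lam := Real.log ((101 : ℝ) / 100)
  set β := (1 - 0.01 / ls) ^ 2 with hβ
  have hlam := log_101_le
  have hlam0 := log_101_pos
  have ht0 : 0 < t := by linarith
  have hls0 : 0 < ls := by linarith
  have hl10 : 0 < l1 := by linarith
  have hl12 : l1 = l2 + lam := stairL_succ x (k + 1)
  -- `(1 - 0.01/ls) * l1 ≤ l2`
  have hq : 0 ≤ 1 - 0.01 / ls := by
    have : 0.01 / ls ≤ 0.01 / 3 := div_le_div_of_nonneg_left (by norm_num) (by norm_num) hls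
    linarith
  have hge : (1 - 0.01 / ls) * l1 ≤ l2 := by
    have e1 : (1 - 0.01 / ls) * l1 = l1 - 0.01 * (l1 / ls) := by ring
    have h2 : 1 ≤ l1 / ls := by rw [le_div_iff₀ hls0]; linarith
    rw [e1]
    nlinarith
  have hsq : β * l1 ^ 2 ≤ l2 ^ 2 := by
    have h0 : 0 ≤ (1 - 0.01 / ls) * l1 := mul_nonneg hq hl10.le
    calc β * l1 ^ 2 = ((1 - 0.01 / ls) * l1) ^ 2 := by rw [hβ]; ring
      _ ≤ l2 ^ 2 := pow_le_pow_left₀ h0 hge 2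
  have hδ0 : 0 ≤ β - 100 / 101 := by
    have : 0.01 / ls ≤ 0.01 / 3 := div_le_div_of_nonneg_left (by norm_num) (by norm_num) hls
    rw [hβ]
    nlinarith
  -- the algebra
  have e1 : (l2 ^ 2 / t - l1 ^ 2 / (101 / 100 * t)) * ((t - 1) ^ 2 / l1 ^ 2)
      = (l2 ^ 2 - 100 / 101 * l1 ^ 2) * (t - 1) ^ 2 / (t * l1 ^ 2) := by
    field_simp
  have h2 : (β * l1 ^ 2 - 100 / 101 * l1 ^ 2) * (t - 1) ^ 2 / (t * l1 ^ 2)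
      ≤ (l2 ^ 2 - 100 / 101 * l1 ^ 2) * (t - 1) ^ 2 / (t * l1 ^ 2) := by
    apply div_le_div_of_nonneg_right _ (by positivity)
    exact mul_le_mul_of_nonneg_right (by linarith) (sq_nonneg _)
  have e3 : (β * l1 ^ 2 - 100 / 101 * l1 ^ 2) * (t - 1) ^ 2 / (t * l1 ^ 2) = (β - 100 / 101) * ((t - 1) ^ 2 / t) := by
    field_simp
  have h4 : (β - 100 / 101) * (t - 2) ≤ (β - 100 / 101) * ((t - 1) ^ 2 / t) := by
    apply mul_le_mul_of_nonneg_left _ hδ0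
    rw [le_div_iff₀ ht0]
    nlinarith
  rw [e1]
  linarith [h2, e3, h4]

/-- The geometric sum `Σ_{k<n} (100/101)^{k+1} = 100·(1 − (100/101)^n)`. [folklore] -/
private theorem geom_sum_101 (n : ℕ) :
    ∑ k ∈ range n, ((100 : ℝ) / 101) ^ (k + 1) = 100 * (1 - ((100 : ℝ) / 101) ^ n) := by
  induction n with
  | zero => simp
  | succ n ih => rw [sum_range_succ, ih, pow_succ]; ring

/-- Staircase / counting bookkeeping (verbatim private copy of the earlier modules' helper). [folklore] -/
private theorem stairW_nonneg {x : ℕ} (hx : 0 < x) {J : ℕ} (hℓ : 3 ≤ stairL x J) (N : ℕ) : 0 ≤ stairW x J N := by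
  unfold stairW
  refine sum_nonneg fun j hj => ?_
  rw [mem_filter, mem_range] at hj
  exact stairC_nonneg hx hj.1 hℓ

/-- `(Σ_T u)² ≤ |T|·Σ_T u²`. [folklore] -/
private theorem sq_sum_le_card_mul_sum_sq' (T : Finset ℕ) (u : ℕ → ℝ) :
    (∑ N ∈ T, u N) ^ 2 ≤ (#T : ℝ) * ∑ N ∈ T, u N ^ 2 := by
  have h := sum_mul_sq_le_sq_mul_sq T u (fun _ => (1 : ℝ))
  simp only [mul_one, one_pow, sum_const, nsmul_eq_mul] at h
  linarith

/-- **Hölder, exponent 8**: `(Σ_T u)⁸ ≤ |T|⁷·Σ_T u⁸` for `u ≥ 0` on `T`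
(`(Σu)² ≤ n·Σu²`, `(Σu²)² ≤ n·Σu⁴`, `(Σu⁴)² ≤ n·Σu⁸`). [folklore] -/
private theorem pow8_sum_le (T : Finset ℕ) (u : ℕ → ℝ) (hu : ∀ N ∈ T, 0 ≤ u N) :
    (∑ N ∈ T, u N) ^ 8 ≤ (#T : ℝ) ^ 7 * ∑ N ∈ T, u N ^ 8 := by
  set n : ℝ := (#T : ℝ) with hn
  have hn0 : 0 ≤ n := by positivity
  have hS1 : 0 ≤ ∑ N ∈ T, u N := sum_nonneg hu
  have hS2 : 0 ≤ ∑ N ∈ T, u N ^ 2 := sum_nonneg fun N _ => by positivity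
  have hS4 : 0 ≤ ∑ N ∈ T, u N ^ 4 := sum_nonneg fun N _ => by positivity
  have h1 : (∑ N ∈ T, u N) ^ 2 ≤ n * ∑ N ∈ T, u N ^ 2 := sq_sum_le_card_mul_sum_sq' T u
  have h2 : (∑ N ∈ T, u N ^ 2) ^ 2 ≤ n * ∑ N ∈ T, u N ^ 4 := by
    have h := sq_sum_le_card_mul_sum_sq' T (fun N => u N ^ 2)
    have e : ∑ N ∈ T, (u N ^ 2) ^ 2 = ∑ N ∈ T, u N ^ 4 := sum_congr rfl fun N _ => by ring
    rw [e] at h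
    exact h
  have h3 : (∑ N ∈ T, u N ^ 4) ^ 2 ≤ n * ∑ N ∈ T, u N ^ 8 := by
    have h := sq_sum_le_card_mul_sum_sq' T (fun N => u N ^ 4)
    have e : ∑ N ∈ T, (u N ^ 4) ^ 2 = ∑ N ∈ T, u N ^ 8 := sum_congr rfl fun N _ => by ring
    rw [e] at h
    exact h
  have h1' : ((∑ N ∈ T, u N) ^ 2) ^ 4 ≤ (n * ∑ N ∈ T, u N ^ 2) ^ 4 :=
    pow_le_pow_left₀ (sq_nonneg _) h1 4
  have h2' : (∑ N ∈ T, u N ^ 2) ^ 4 ≤ (n * ∑ N ∈ T, u N ^ 4) ^ 2 := by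
    have := pow_le_pow_left₀ (sq_nonneg _) h2 2
    calc (∑ N ∈ T, u N ^ 2) ^ 4 = ((∑ N ∈ T, u N ^ 2) ^ 2) ^ 2 := by ring
      _ ≤ _ := this
  calc (∑ N ∈ T, u N) ^ 8 = ((∑ N ∈ T, u N) ^ 2) ^ 4 := by ring
    _ ≤ (n * ∑ N ∈ T, u N ^ 2) ^ 4 := h1'
    _ = n ^ 4 * (∑ N ∈ T, u N ^ 2) ^ 4 := by ring
    _ ≤ n ^ 4 * (n * ∑ N ∈ T, u N ^ 4) ^ 2 := mul_le_mul_of_nonneg_left h2' (by positivity)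
    _ = n ^ 6 * (∑ N ∈ T, u N ^ 4) ^ 2 := by ring
    _ ≤ n ^ 6 * (n * ∑ N ∈ T, u N ^ 8) := mul_le_mul_of_nonneg_left h3 (by positivity)
    _ = n ^ 7 * ∑ N ∈ T, u N ^ 8 := by ring

/-- `e¹³ ≥ 442000`. [folklore] -/
private theorem exp_13_ge : (442000 : ℝ) ≤ Real.exp 13 := by
  have he : (2.718281828 : ℝ) ≤ Real.exp 1 := by have := Real.exp_one_gt_d9; linarith
  have h := pow_le_pow_left₀ (by norm_num) he 13
  rw [← Real.exp_nat_mul] at h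
  norm_num at h
  exact le_trans (by norm_num) h

/-- `2(x + 1) ≤ 10⁻⁴·x²/log²x` for `x ≥ e^41` (`log²x ≤ 2.4367√x`, `√x ≥ 2^29`). [folklore] -/
private theorem two_mul_succ_le_small41 {x : ℕ} (hx : Real.exp 41 ≤ (x : ℝ)) :
    2 * ((x : ℝ) + 1) ≤ 0.0001 * ((x : ℝ) ^ 2 / Real.log x ^ 2) := by
  have hx1 : (1 : ℝ) < x := lt_of_lt_of_le (by have := Real.add_one_le_exp (41 : ℝ); linarith) hx
  have hx0 : (0 : ℝ) < x := by linarith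
  set L := Real.log x with hL
  have hL41 : 41 ≤ L := by
    have := Real.log_le_log (Real.exp_pos 41) hx
    rwa [Real.log_exp] at this
  have hLpos : 0 < L ^ 2 := by positivity
  have hL4 : L ^ 4 ≤ 4096 * Real.sqrt x := log_pow_four_le_sqrt hx1.le
  have hLsq : (1681 : ℝ) ≤ L ^ 2 := by nlinarith
  have hL2 : L ^ 2 ≤ 2.4367 * Real.sqrt x := by
    have e : L ^ 4 = L ^ 2 * L ^ 2 := by ring
    nlinarith [Real.sqrt_nonneg (x : ℝ)]
  have hbig : (2 : ℝ) ^ 59 ≤ x := two_pow_59_le_exp_41.trans hx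
  have hsx : (2 : ℝ) ^ 29 ≤ Real.sqrt x :=
    Real.le_sqrt_of_sq_le (by
      rw [show ((2 : ℝ) ^ 29) ^ 2 = (2 : ℝ) ^ 58 by norm_num]
      exact le_trans (by norm_num) hbig)
  have hxx : Real.sqrt x * Real.sqrt x = x := Real.mul_self_sqrt hx0.le
  have key : 2 * ((x : ℝ) + 1) * L ^ 2 ≤ 0.0001 * (x : ℝ) ^ 2 := by
    have h1 : 2 * ((x : ℝ) + 1) * L ^ 2 ≤ 4 * x * (2.4367 * Real.sqrt x) := by
      have : 2 * ((x : ℝ) + 1) ≤ 4 * x := by linarith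
      exact mul_le_mul this hL2 (by positivity) (by positivity)
    have h2 : (1 : ℝ) ≤ Real.sqrt x / 2 ^ 29 := by
      rw [le_div_iff₀ (by positivity)]; linarith
    calc 2 * ((x : ℝ) + 1) * L ^ 2 ≤ 4 * x * (2.4367 * Real.sqrt x) := h1
      _ ≤ 4 * x * (2.4367 * Real.sqrt x) * (Real.sqrt x / 2 ^ 29) :=
          le_mul_of_one_le_right (by positivity) h2
      _ = (9.7468 / 2 ^ 29) * (x * (Real.sqrt x * Real.sqrt x)) := by ring
      _ = (9.7468 / 2 ^ 29) * (x : ℝ) ^ 2 := by rw [hxx]; ring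
      _ ≤ 0.0001 * (x : ℝ) ^ 2 := mul_le_mul_of_nonneg_right (by norm_num) (by positivity)
  calc 2 * ((x : ℝ) + 1) = 2 * ((x : ℝ) + 1) * L ^ 2 / L ^ 2 := by field_simp
    _ ≤ 0.0001 * (x : ℝ) ^ 2 / L ^ 2 := div_le_div_of_nonneg_right key hLpos.le
    _ = _ := by ring

/-- **First moment over even `N`, threshold `e^{Λs}`, `Λs ≥ 41`**: `S₁^{ev}(x) ≥ (c₁ − 10⁻⁴)·x²/log²x`. [folklore] -/
private theorem sum_even_goldbachCount_ge' {c₁ Λs : ℝ} (hΛs : 41 ≤ Λs) {x : ℕ} (hx : Real.exp Λs ≤ (x : ℝ))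
    (hS₁ : c₁ * ((x : ℝ) ^ 2 / Real.log x ^ 2) ≤ ∑ N ∈ range (x + 1), (SingularSeries.goldbachCount N : ℝ)) :
    (c₁ - 0.0001) * ((x : ℝ) ^ 2 / Real.log x ^ 2)
      ≤ ∑ N ∈ (range (x + 1)).filter Even, (SingularSeries.goldbachCount N : ℝ) := by
  have hsplit := sum_filter_add_sum_filter_not (range (x + 1)) Even
    (fun N => (SingularSeries.goldbachCount N : ℝ))
  have hodd := sum_goldbachCount_odd_le x
  have hsmall := two_mul_succ_le_small41 (((Real.exp_le_exp.mpr hΛs)).trans hx)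
  have e : (c₁ - 0.0001) * ((x : ℝ) ^ 2 / Real.log x ^ 2)
      = c₁ * ((x : ℝ) ^ 2 / Real.log x ^ 2) - 0.0001 * ((x : ℝ) ^ 2 / Real.log x ^ 2) := by ring
  rw [e]
  linarith

/-- **One level of the lower side, threshold `e^{Λs}`**: `Σ_{even N ≤ t_j} r(N) ≥ (c₁ − 10⁻⁴)·(t_j − 1)²/ℓ_j²`
when `t_j ≥ e^{Λs} + 1`. [folklore] -/
private theorem level_lower' {c₁ Λs : ℝ} (hΛs : 41 ≤ Λs)
    (hS₁ : ∀ y : ℕ, Real.exp Λs ≤ (y : ℝ) →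
      c₁ * ((y : ℝ) ^ 2 / Real.log y ^ 2) ≤ ∑ N ∈ range (y + 1), (SingularSeries.goldbachCount N : ℝ))
    (hc₁ : 0.0001 ≤ c₁) {x j : ℕ} (hx : 0 < x) (ht : Real.exp Λs + 1 ≤ stairT x j) :
    (c₁ - 0.0001) * ((stairT x j - 1) ^ 2 / stairL x j ^ 2)
      ≤ ∑ N ∈ ((range (x + 1)).filter Even).filter (fun N : ℕ => (N : ℝ) ≤ stairT x j),
          (SingularSeries.goldbachCount N : ℝ) := by
  set t := stairT x j with ht_def
  have heΛ : (1 : ℝ) < Real.exp Λs := by have := Real.add_one_le_exp Λs; linarith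
  have ht0 : 0 ≤ t := by linarith
  set y := ⌊t⌋₊ with hy_def
  have hy1 : t - 1 ≤ y := (Nat.sub_one_lt_floor t).le
  have hyt : (y : ℝ) ≤ t := Nat.floor_le ht0
  have hy : Real.exp Λs ≤ (y : ℝ) := by linarith
  have hy0 : (1 : ℝ) < y := by linarith
  rw [filter_even_le_eq ht0 (stairT_le_self x j)]
  have h := sum_even_goldbachCount_ge' hΛs hy (hS₁ y hy)
  refine le_trans ?_ h
  apply mul_le_mul_of_nonneg_left _ (by linarith)
  have hlogy : 0 < Real.log y := Real.log_pos hy0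
  have hlogle : Real.log y ≤ stairL x j := by
    rw [← log_stairT hx]
    exact Real.log_le_log (by linarith) hyt
  calc (t - 1) ^ 2 / stairL x j ^ 2 ≤ (y : ℝ) ^ 2 / stairL x j ^ 2 :=
        div_le_div_of_nonneg_right (pow_le_pow_left₀ (by linarith) hy1 2) (by positivity)
    _ ≤ (y : ℝ) ^ 2 / Real.log y ^ 2 :=
        div_le_div_of_nonneg_left (by positivity) (by positivity) (pow_le_pow_left₀ hlogy.le hlogle 2)

/-- `m(N) ≤ M_{J−1} = Σ_{j<J} c_j` (all increments are `≥ 0`). [folklore] -/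
private theorem stairW_le_stairMf {x : ℕ} (hx : 0 < x) {J : ℕ} (hℓ : 3 ≤ stairL x J) (N : ℕ) :
    stairW x J N ≤ stairMf x J := by
  unfold stairW
  rw [← sum_range_stairC x J]
  exact sum_le_sum_of_subset_of_nonneg (filter_subset _ _) fun j hj _ => stairC_nonneg hx (mem_range.mp hj) hℓ

/-- `ℓ² ≤ a²·e^{ℓ − a}` for `ℓ ≥ a ≥ 2` (`ℓ²e^{−ℓ}` is decreasing on `[2, ∞)`). [folklore] -/
private theorem sq_le_sq_mul_exp {a l : ℝ} (ha : 2 ≤ a) (hl : a ≤ l) : l ^ 2 ≤ a ^ 2 * Real.exp (l - a) := by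
  set u := l - a with hu
  have hu0 : 0 ≤ u := by linarith
  have ha0 : 0 ≤ a := by linarith
  have h1 : 1 + u / 2 ≤ Real.exp (u / 2) := by have := Real.add_one_le_exp (u / 2); linarith
  have h2 : (1 + u / 2) ^ 2 ≤ Real.exp (u / 2) ^ 2 := pow_le_pow_left₀ (by linarith) h1 2
  have h3 : Real.exp (u / 2) ^ 2 = Real.exp u := by rw [← Real.exp_nat_mul]; ring_nf
  rw [h3] at h2
  have hl' : l = a + u := by linarith
  rw [hl']
  have h4 : a ^ 2 * (1 + u / 2) ^ 2 ≤ a ^ 2 * Real.exp u := mul_le_mul_of_nonneg_left h2 (sq_nonneg a)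
  have h5 : 0 ≤ u * a * (a - 2) := mul_nonneg (mul_nonneg hu0 ha0) (sub_nonneg.2 ha)
  have h6 : 0 ≤ u ^ 2 * (a - 2) * (a + 2) := mul_nonneg (mul_nonneg (sq_nonneg u) (sub_nonneg.2 ha)) (by linarith)
  nlinarith [h4, h5, h6]

/-- `e¹⁸ ≥ 6.5·10⁷`. [folklore] -/
private theorem exp_18_ge : (65000000 : ℝ) ≤ Real.exp 18 := by
  have he : (2.718281828 : ℝ) ≤ Real.exp 1 := by have := Real.exp_one_gt_d9; linarith
  have h := pow_le_pow_left₀ (by norm_num) he 18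
  rw [← Real.exp_nat_mul] at h
  norm_num at h
  exact le_trans (by norm_num) h

/-! ## §21 ROUND-36 «LEVELS»: `J = 400` staircase levels in the flattened first moment — `K = 53`, `47` under (3.3)

The near-miss of ROUND-35 at `h = 27` (`κ = 1/54`): the Hölder line `κ⁷·259.55·A⁸ ≤ F⁸`, `F = 0.4409·gHol(Λ₀) − 0.0057
≈ 0.809`, needs `A ≤ 13.4`, i.e. a sieve threshold `Λs ≈ 700` beyond every glue window.  ONE INPUT VARIED: the number of
levels `J` of the geometric staircase weight `m(N)` (§13 of the tree's Flatten module): the lower side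
`Σ_{j<J} c_j (t_j − 1)²/ℓ_j² ≥ [(1 − 0.01/Λ₀)² + 100(1 − (100/101)^{J−1})·δ_J]·x − 21`, `δ_J = (1 − 0.01/(Λ₀ − 0.01J))² − 100/101`,
has `100(1 − (100/101)^{199}) ≥ 85.71` at `J = 200` but `≥ 98.07` at `J = 400` (`(100/101)^{399} ≤ 1/52`); the price is the
bottom level `ℓ_400 ≥ Λ₀ − 4` (threshold gap `Λs + 12 ≤ Λ₀`, discard `(Λ₀ − 4)²e^{4−Λ₀}·(e^{Λs}+1)² ≤ 0.0056x` unchanged).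
So `g: 1.849 → 1.966`, `F: 0.809 → 0.861`, `F⁸: 0.184 → 0.302`: at `(Λs, Λ₀, A) = (382, 394, 13.60)` the count is `x/52`
(`c₁ = 0.441`: `0.29547 ≤ 0.30221`) and `x/46` under (3.3) (`c₁ = 0.4995`: `0.69699 ≤ 0.82389`).  The glue at `h = 26`:
one shift below `e^{47.9024}`, four shifts on `[47.9, 150]`, seven on `[150, 225]`, twelve on `[225, 394]` (pair sieve at
`e^215`: `13.92`, weight `27.84·96.8871 ≤ 2698`; window `[167.8, 418.3]`); the small range `2y − 3 < 10⁶` of the one-shift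
regime now uses `π(n) ≥ (n+2)/45` (`n ≥ 88`, tree `RomanoffExplicit.primeCounting_ge_div45`) and `π(n) ≥ π(3) = 2`, which
is what lets `h` drop below `28`.  Under (3.3), `h = 23`: one shift below `e^46`, four on `[46, 140]`, seven on `[140, 215]`,
twelve on `[215, 394]` (`L² + 23 ≤ 23(24L − 2698)`, window `[157.3, 394.7]`). -/

/-! #### §3.1 The `J = 400` staircase (ONE input of §15/§17: the number of levels) -/

/-- `(100/101)¹⁹⁹ ≤ 0.1385`. [folklore] -/
private theorem q_pow_199_le' : ((100 : ℝ) / 101) ^ 199 ≤ 0.1385 := by norm_num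

/-- `(100/101)³⁹⁹ ≤ 1/52` (`0.1385²·100/101 = 0.01899…`). [folklore] -/
private theorem q_pow_399_le : ((100 : ℝ) / 101) ^ 399 ≤ 1 / 52 := by
  have h := q_pow_199_le'
  have h0 : (0 : ℝ) ≤ ((100 : ℝ) / 101) ^ 199 := by positivity
  have e : ((100 : ℝ) / 101) ^ 399 = ((100 : ℝ) / 101) ^ 199 * ((100 : ℝ) / 101) ^ 199 * ((100 : ℝ) / 101) := by
    rw [← pow_add, ← pow_succ]
  rw [e]
  have h2 : ((100 : ℝ) / 101) ^ 199 * ((100 : ℝ) / 101) ^ 199 ≤ 0.1385 * 0.1385 := mul_le_mul h h h0 (by norm_num)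
  nlinarith [h2]

/-- `Λ₀`-dependent lower constant of the `400`-level flattened first moment (`100·(1 − (100/101)³⁹⁹) ≥ 98.07`, bottom level
`ℓ₄₀₀ ≥ Λ₀ − 4`). [folklore] -/
noncomputable def gHol4 (Λ₀ : ℝ) : ℝ :=
  (1 - 0.01 / Λ₀) ^ 2 + 98.07 * ((1 - 0.01 / (Λ₀ - 4)) ^ 2 - 100 / 101)

/-- **The lower side, summed over `J = 400` levels**: `Σ_{j<400} c_j·(t_j − 1)²/ℓ_j² ≥ gHol4(Λ₀)·x − 21`
for `log x ≥ Λ₀ ≥ 44`. [folklore] -/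
private theorem stair_lower_sum_ge400 {x : ℕ} (hx : 0 < x) {Λ₀ : ℝ} (hΛ₀ : 44 ≤ Λ₀) (hL : Λ₀ ≤ Real.log (x : ℝ))
    (hx2 : (2 : ℝ) ≤ stairT x 400) :
    gHol4 Λ₀ * (x : ℝ) - 21 ≤ ∑ j ∈ range 400, stairC x j * ((stairT x j - 1) ^ 2 / stairL x j ^ 2) := by
  rw [sum_range_succ']
  set ls := Λ₀ - 4 with hls_def
  have hls3 : 3 ≤ ls := by linarith
  set δ := (1 - 0.01 / ls) ^ 2 - 100 / 101 with hδ_def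
  have hδ0 : 0 ≤ δ := by
    have : 0.01 / ls ≤ 0.01 / 3 := div_le_div_of_nonneg_left (by norm_num) (by norm_num) hls3
    rw [hδ_def]
    nlinarith
  have hδ1 : δ ≤ 0.01 := by
    have h0 : 0 ≤ 0.01 / ls := by positivity
    have : 0.01 / ls ≤ 0.01 / 3 := div_le_div_of_nonneg_left (by norm_num) (by norm_num) hls3
    rw [hδ_def]
    nlinarith
  -- the terms `k+1`, `k < 399`
  have hterm : ∀ k ∈ range 399, δ * (stairT x (k + 1) - 2)
      ≤ stairC x (k + 1) * ((stairT x (k + 1) - 1) ^ 2 / stairL x (k + 1) ^ 2) := by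
    intro k hk
    rw [mem_range] at hk
    apply stair_term_succ_ge hls3
    · have h1 := stairL_le_of_le x (show k + 1 ≤ 400 by omega)
      have h2 := stairL_ge x 400
      have : ls ≤ Real.log (x : ℝ) - 0.01 * ((400 : ℕ) : ℝ) := by push_cast; linarith
      linarith
    · exact hx2.trans (stairT_le_of_le x (by omega))
  have hsum1 : δ * ((x : ℝ) * (100 * (1 - ((100 : ℝ) / 101) ^ 399)) - 2 * 399)
      ≤ ∑ k ∈ range 399, stairC x (k + 1) * ((stairT x (k + 1) - 1) ^ 2 / stairL x (k + 1) ^ 2) := by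
    have h := sum_le_sum hterm
    have e : ∑ k ∈ range 399, δ * (stairT x (k + 1) - 2)
        = δ * ((x : ℝ) * (100 * (1 - ((100 : ℝ) / 101) ^ 399)) - 2 * 399) := by
      rw [← mul_sum, sum_sub_distrib, sum_const, card_range, ← geom_sum_101, mul_sum]
      simp only [stairT_eq_mul_pow, nsmul_eq_mul]
      push_cast
      ring
    rw [← e]
    exact h
  have hterm0 := stair_term_zero_ge hx (by linarith : (1 : ℝ) ≤ Λ₀) hL
  have hq399 : ((100 : ℝ) / 101) ^ 399 ≤ 1 / 52 := q_pow_399_le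
  have hx' : (0 : ℝ) < x := by exact_mod_cast hx
  generalize hQ : ((100 : ℝ) / 101) ^ 399 = Q at hq399 hsum1
  clear hQ
  have hmain : gHol4 Λ₀ * (x : ℝ) - 21
      ≤ (1 - 0.01 / Λ₀) ^ 2 * ((x : ℝ) - 2)
        + δ * ((x : ℝ) * (100 * (1 - Q)) - 2 * 399) := by
    have hS : 98.07 ≤ 100 * (1 - Q) := by linarith [hq399]
    have h1 : 98.07 * (x : ℝ) ≤ (x : ℝ) * (100 * (1 - Q)) := by
      nlinarith [mul_le_mul_of_nonneg_left hS hx'.le]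
    have h2 : (1 - 0.01 / Λ₀) ^ 2 ≤ 1 := by
      have h0 : 0 ≤ 0.01 / Λ₀ := by positivity
      have : 0.01 / Λ₀ ≤ 0.01 / 44 := div_le_div_of_nonneg_left (by norm_num) (by norm_num) hΛ₀
      nlinarith
    have hA : (1 - 0.01 / Λ₀) ^ 2 * (x : ℝ) - 2 ≤ (1 - 0.01 / Λ₀) ^ 2 * ((x : ℝ) - 2) := by
      nlinarith [sq_nonneg (1 - 0.01 / Λ₀)]
    have hB : 98.07 * δ * (x : ℝ) - 19
        ≤ δ * ((x : ℝ) * (100 * (1 - Q)) - 2 * 399) := by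
      have h3 := mul_le_mul_of_nonneg_left h1 hδ0
      nlinarith [hδ1]
    have e : gHol4 Λ₀ * (x : ℝ) = (1 - 0.01 / Λ₀) ^ 2 * (x : ℝ) + 98.07 * δ * (x : ℝ) := by
      unfold gHol4
      rw [← hls_def, ← hδ_def]
      ring
    linarith [hA, hB, e]
  linarith [hmain, hterm0, hsum1]

/-- **Main blocks, `J = 400`**: for even `N` with `t_{400} < N ≤ x`, `r(N)·m(N) ≤ A·f(N)`. [folklore] -/
private theorem stair_rm_le_main400 {x : ℕ} (hx : 0 < x) {Λ A : ℝ} (hΛ0 : 0 < Λ) (hA : 0 ≤ A)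
    (hpt : ∀ N : ℕ, Real.exp Λ ≤ (N : ℝ) → Even N →
      (SingularSeries.goldbachCount N : ℝ) ≤ A * oddSingularFactor N * (N : ℝ) / Real.log (N : ℝ) ^ 2)
    (hbot : Real.exp Λ ≤ stairT x 400) {N : ℕ} (heven : Even N) (hNx : (N : ℝ) ≤ x)
    (hNt : stairT x 400 < N) :
    (SingularSeries.goldbachCount N : ℝ) * stairW x 400 N ≤ A * oddSingularFactor N := by
  obtain ⟨k, hk, hW, hNk, hnext⟩ := stairW_eq (x := x) (J := 400) (N := N) (by norm_num) hNx
  have htk1 : stairT x (k + 1) < N := by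
    by_cases h : k + 1 < 400
    · exact hnext h
    · have : k + 1 = 400 := by omega
      rw [this]; exact hNt
  have hNΛ : Real.exp Λ ≤ (N : ℝ) := hbot.trans hNt.le
  have hN1 : (1 : ℝ) < N := lt_of_lt_of_le (by have := Real.add_one_le_exp Λ; linarith) hNΛ
  have hlogN : 0 < Real.log (N : ℝ) := Real.log_pos hN1
  have hr := hpt N hNΛ heven
  have hf := oddSingularFactor_nonneg N
  have hΛℓ : Λ ≤ stairL x 400 := by
    rw [← log_stairT hx]
    have := Real.log_le_log (Real.exp_pos Λ) hbot
    rwa [Real.log_exp] at this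
  have hl0 : 0 ≤ stairL x (k + 1) := (hΛ0.le.trans hΛℓ).trans (stairL_le_of_le x (by omega))
  have hl : stairL x (k + 1) ≤ Real.log (N : ℝ) := by
    rw [← log_stairT hx]
    exact Real.log_le_log (stairT_pos hx _) htk1.le
  have h1 : stairL x (k + 1) ^ 2 ≤ Real.log (N : ℝ) ^ 2 := pow_le_pow_left₀ hl0 hl 2
  have htk : 0 < stairT x k := stairT_pos hx k
  have hN0 : (0 : ℝ) < N := by linarith
  rw [hW]
  unfold stairM
  calc (SingularSeries.goldbachCount N : ℝ) * (stairL x (k + 1) ^ 2 / stairT x k)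
      ≤ A * oddSingularFactor N * (N : ℝ) / Real.log (N : ℝ) ^ 2 * (stairL x (k + 1) ^ 2 / stairT x k) :=
        mul_le_mul_of_nonneg_right hr (div_nonneg (sq_nonneg _) htk.le)
    _ = A * oddSingularFactor N * (((N : ℝ) / stairT x k) * (stairL x (k + 1) ^ 2 / Real.log (N : ℝ) ^ 2)) := by
        field_simp
    _ ≤ A * oddSingularFactor N * 1 := by
        apply mul_le_mul_of_nonneg_left _ (mul_nonneg hA hf)
        exact mul_le_one₀ ((div_le_one htk).mpr hNk) (div_nonneg (sq_nonneg _) (sq_nonneg _))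
          ((div_le_one (pow_pos hlogN 2)).mpr h1)
    _ = A * oddSingularFactor N := mul_one _

/-- **The bottom segment, `J = 400`**: for even `e^Λ ≤ N ≤ t_{400}`, `r(N)·m(N) ≤ A·f(N)`
(`m(N) = ℓ_{400}²/t_{399}`, `N/log²N ≤ t_{400}/ℓ_{400}²`, `t_{400} ≤ t_{399}`). [folklore] -/
private theorem stair_rm_le_bottom400 {x : ℕ} (hx : 0 < x) {Λ A : ℝ} (hΛ2 : 2 ≤ Λ) (hA : 0 ≤ A)
    (hpt : ∀ N : ℕ, Real.exp Λ ≤ (N : ℝ) → Even N →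
      (SingularSeries.goldbachCount N : ℝ) ≤ A * oddSingularFactor N * (N : ℝ) / Real.log (N : ℝ) ^ 2)
    {N : ℕ} (heven : Even N) (hNΛ : Real.exp Λ ≤ (N : ℝ)) (hNt : (N : ℝ) ≤ stairT x 400) :
    (SingularSeries.goldbachCount N : ℝ) * stairW x 400 N ≤ A * oddSingularFactor N := by
  have hNx : (N : ℝ) ≤ x := hNt.trans (stairT_le_self x 400)
  obtain ⟨k, hk, hW, hNk, hnext⟩ := stairW_eq (x := x) (J := 400) (N := N) (by norm_num) hNx
  have hk399 : k = 399 := by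
    by_contra hne
    have hlt : k + 1 < 400 := by omega
    have h1 := hnext hlt
    have h2 := stairT_le_of_le x (show k + 1 ≤ 400 by omega)
    linarith
  subst hk399
  rw [hW]
  unfold stairM
  have ht399 := stairT_pos hx 399
  have ht400 := stairT_pos hx 400
  have hℓ : Real.log (stairT x 400) = stairL x (399 + 1) := log_stairT hx 400
  have hr := hpt N hNΛ heven
  have he2 : Real.exp 2 ≤ (N : ℝ) := le_trans (Real.exp_le_exp.mpr hΛ2) hNΛ
  have hmono := div_log_sq_mono he2 hNt
  rw [hℓ] at hmono
  have hN1 : (1 : ℝ) < N := lt_of_lt_of_le (by have := Real.add_one_le_exp (2 : ℝ); linarith) he2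
  have hlogN : 0 < Real.log (N : ℝ) := Real.log_pos hN1
  have hf := oddSingularFactor_nonneg N
  calc (SingularSeries.goldbachCount N : ℝ) * (stairL x (399 + 1) ^ 2 / stairT x 399)
      ≤ A * oddSingularFactor N * (N : ℝ) / Real.log (N : ℝ) ^ 2 * (stairL x (399 + 1) ^ 2 / stairT x 399) :=
        mul_le_mul_of_nonneg_right hr (div_nonneg (sq_nonneg _) ht399.le)
    _ = A * oddSingularFactor N * ((N : ℝ) / Real.log (N : ℝ) ^ 2) * (stairL x (399 + 1) ^ 2 / stairT x 399) := by
        ring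
    _ ≤ A * oddSingularFactor N * (stairT x 400 / stairL x (399 + 1) ^ 2)
          * (stairL x (399 + 1) ^ 2 / stairT x 399) :=
        mul_le_mul_of_nonneg_right (mul_le_mul_of_nonneg_left hmono (mul_nonneg hA hf))
          (div_nonneg (sq_nonneg _) ht399.le)
    _ ≤ A * oddSingularFactor N * 1 := by
        rw [mul_assoc (A * oddSingularFactor N)]
        apply mul_le_mul_of_nonneg_left _ (mul_nonneg hA hf)
        have hℓ0 : 0 < stairL x (399 + 1) := by
          rw [← hℓ]
          have h1 := Real.log_le_log (by positivity) (hNΛ.trans hNt)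
          have h2 : Real.log (N : ℝ) ≤ Real.log (stairT x 400) := Real.log_le_log (by linarith) hNt
          linarith
        calc stairT x 400 / stairL x (399 + 1) ^ 2 * (stairL x (399 + 1) ^ 2 / stairT x 399)
            = stairT x 400 / stairT x 399 := by field_simp
          _ ≤ 1 := (div_le_one ht399).mpr (stairT_le_of_le x (by norm_num))
    _ = A * oddSingularFactor N := mul_one _

set_option maxHeartbeats 1600000 in
/-- **Hölder with the `J = 400` staircase weight, threshold gap `Λs + 12 ≤ Λ₀`** (ROUND-36 «LEVELS»; ONE input of the
tree's `goldbach_even_count_ge_holder_gap10` varied: the number of levels `J = 200 → 400`, so the lower constant is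
`gHol4(Λ₀) ≈ 1.97` instead of `gHol(Λ₀) ≈ 1.85`): the discard of the `N < e^{Λs}` is done at the bottom level
`m(N) ≤ ℓ_400²e^{−ℓ_400} ≤ (Λ₀−4)²e^{4−Λ₀}`, so `(e^{Λs}+1)²·(Λ₀−4)²·e^{4−Λ₀} ≤ 1.0001²·158404·e^{−18}·x ≤ 0.0056·x`
for `Λs + 12 ≤ Λ₀ ≤ 400`, `x ≥ e^{Λ₀}` (`Λ₀ ≥ 53.5`, `Λs ≥ 41`); the rest verbatim: if `r(N) ≤ A·f(N)·N/log²N` for even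
`N ≥ e^{Λs}` and `S₁(y) ≥ c₁·y²/log²y` for `y ≥ e^{Λs}`, then with `F = (c₁ − 10⁻⁴)·gHol4(Λ₀) − 0.0057`:
`#{even N ∈ (0,x] : N = p+q} ≥ κ·x` whenever `κ⁷·259.55·A⁸ ≤ F⁸`.
[cite: Nathanson1996, Thm 7.8 (Hölder variant proved here)] -/
theorem goldbach_even_count_ge_holder400 {Λs Λ₀ A c₁ κ : ℝ} (hΛs : 41 ≤ Λs) (h2Λ : Λs + 12 ≤ Λ₀)
    (hΛ₀ : 53.5 ≤ Λ₀) (hΛ₀4 : Λ₀ ≤ 400)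
    (hA : 1 ≤ A)
    (hpt : ∀ N : ℕ, Real.exp Λs ≤ (N : ℝ) → Even N →
      (SingularSeries.goldbachCount N : ℝ) ≤ A * oddSingularFactor N * (N : ℝ) / Real.log (N : ℝ) ^ 2)
    (hc₁ : 0.0001 ≤ c₁) (hc₁1 : c₁ ≤ 1)
    (hS₁ : ∀ y : ℕ, Real.exp Λs ≤ (y : ℝ) →
      c₁ * ((y : ℝ) ^ 2 / Real.log y ^ 2) ≤ ∑ N ∈ range (y + 1), (SingularSeries.goldbachCount N : ℝ))
    (hF0 : 0 ≤ (c₁ - 0.0001) * gHol4 Λ₀ - 0.0057)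
    (hκ : κ ^ 7 * (259.55 * A ^ 8) ≤ ((c₁ - 0.0001) * gHol4 Λ₀ - 0.0057) ^ 8)
    {x : ℕ} (hx : Real.exp Λ₀ ≤ (x : ℝ)) :
    κ * (x : ℝ) ≤ #{N ∈ Ioc 0 x | Even N ∧ ∃ p q : ℕ, p.Prime ∧ q.Prime ∧ p + q = N} := by
  -- basics
  have hx535 : Real.exp 53.5 ≤ (x : ℝ) := (Real.exp_le_exp.mpr hΛ₀).trans hx
  have hx1 : (1 : ℝ) < x := lt_of_lt_of_le (by have := Real.add_one_le_exp (53.5 : ℝ); linarith) hx535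
  have hx0 : (0 : ℝ) < x := by linarith
  have hxN : 0 < x := by exact_mod_cast hx0
  set L := Real.log (x : ℝ) with hL_def
  have hLΛ₀ : Λ₀ ≤ L := by
    have := Real.log_le_log (Real.exp_pos Λ₀) hx
    rwa [Real.log_exp] at this
  have hΛs0 : 0 < Λs := by linarith
  have hA0 : 0 ≤ A := by linarith
  -- the bottom level `ℓ_400 ≥ Λ₀ − 4 ≥ 49.5`
  have hℓ400 : Λ₀ - 4 ≤ stairL x 400 := by
    have := stairL_ge x 400
    push_cast at this
    linarith
  have hℓ495 : 49.5 ≤ stairL x 400 := by linarith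
  have hℓ3 : 3 ≤ stairL x 400 := by linarith
  have ht400 : stairT x 400 = Real.exp (stairL x 400) := by
    rw [← log_stairT hxN 400, Real.exp_log (stairT_pos hxN 400)]
  have hbotΛ : Real.exp Λs ≤ stairT x 400 := by rw [ht400]; exact Real.exp_le_exp.mpr (by linarith)
  have hbotS : Real.exp Λs + 1 ≤ stairT x 400 := by
    rw [ht400]
    have h1 : Real.exp (Λs + 1) ≤ Real.exp (stairL x 400) := Real.exp_le_exp.mpr (by linarith)
    have h2 : Real.exp (Λs + 1) = Real.exp Λs * Real.exp 1 := by rw [Real.exp_add]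
    have h3 : (2 : ℝ) ≤ Real.exp 1 := by have := Real.add_one_le_exp (1 : ℝ); linarith
    have h4 : (1 : ℝ) ≤ Real.exp Λs := by have := Real.add_one_le_exp Λs; linarith
    nlinarith [Real.exp_pos Λs]
  have hbot2 : (2 : ℝ) ≤ stairT x 400 := by
    have h4 : (1 : ℝ) ≤ Real.exp Λs := by have := Real.add_one_le_exp Λs; linarith
    linarith
  -- notation
  set r : ℕ → ℝ := fun N => (SingularSeries.goldbachCount N : ℝ) with hr
  set f : ℕ → ℝ := fun N => oddSingularFactor N with hf_def
  set m : ℕ → ℝ := stairW x 400 with hm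
  have hm0 : ∀ N, 0 ≤ m N := fun N => stairW_nonneg hxN hℓ3 N
  set c₁' := c₁ - 0.0001 with hc₁'
  have hc₁'0 : 0 ≤ c₁' := by rw [hc₁']; linarith
  have hc₁'1 : c₁' ≤ 1 := by rw [hc₁']; linarith
  set g := gHol4 Λ₀ with hg
  set F := c₁' * g - 0.0057 with hF_def
  set E : Finset ℕ := (range (x + 1)).filter Even with hE
  -- LOWER: `Σ_E r·m ≥ c₁'·(g·x − 21)`
  have hlower : c₁' * (g * x - 21) ≤ ∑ N ∈ E, r N * m N := by
    rw [hm, sum_mul_stairW x 400 E r]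
    have hterm : ∀ j ∈ range 400, stairC x j * (c₁' * ((stairT x j - 1) ^ 2 / stairL x j ^ 2))
        ≤ stairC x j * ∑ N ∈ E.filter (fun N : ℕ => (N : ℝ) ≤ stairT x j), r N := by
      intro j hj
      rw [mem_range] at hj
      apply mul_le_mul_of_nonneg_left _ (stairC_nonneg hxN hj hℓ3)
      rw [hE, hr]
      exact level_lower' hΛs hS₁ hc₁ hxN (hbotS.trans (stairT_le_of_le x hj.le))
    refine le_trans ?_ (sum_le_sum hterm)
    have e : ∑ j ∈ range 400, stairC x j * (c₁' * ((stairT x j - 1) ^ 2 / stairL x j ^ 2))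
        = c₁' * ∑ j ∈ range 400, stairC x j * ((stairT x j - 1) ^ 2 / stairL x j ^ 2) := by
      rw [mul_sum]
      exact sum_congr rfl fun j _ => by ring
    rw [e]
    exact mul_le_mul_of_nonneg_left (stair_lower_sum_ge400 hxN (by linarith) hLΛ₀ hbot2) hc₁'0
  -- the small `N < e^{Λs}`: `Σ r·m ≤ 0.0056·x`
  set Ehi : Finset ℕ := E.filter (fun N : ℕ => Real.exp Λs ≤ (N : ℝ)) with hEhi
  set Elo : Finset ℕ := E.filter (fun N : ℕ => ¬(Real.exp Λs ≤ (N : ℝ))) with hElo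
  have hsplit : ∑ N ∈ E, r N * m N = ∑ N ∈ Ehi, r N * m N + ∑ N ∈ Elo, r N * m N :=
    (sum_filter_add_sum_filter_not E (fun N : ℕ => Real.exp Λs ≤ (N : ℝ)) (fun N => r N * m N)).symm
  have hMtop : stairMf x 400 ≤ (Λ₀ - 4) ^ 2 * Real.exp (-(Λ₀ - 4)) := by
    show stairM x 399 ≤ _
    unfold stairM
    have ht399 := stairT_pos hxN 399
    have h1 : stairL x (399 + 1) ^ 2 / stairT x 399 ≤ stairL x 400 ^ 2 / stairT x 400 :=
      div_le_div_of_nonneg_left (sq_nonneg _) (stairT_pos hxN 400) (stairT_le_of_le x (by norm_num))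
    refine h1.trans ?_
    rw [ht400, div_le_iff₀ (Real.exp_pos _)]
    have h2 := sq_le_sq_mul_exp (a := Λ₀ - 4) (by linarith) hℓ400
    have e : (Λ₀ - 4) ^ 2 * Real.exp (stairL x 400 - (Λ₀ - 4))
        = (Λ₀ - 4) ^ 2 * Real.exp (-(Λ₀ - 4)) * Real.exp (stairL x 400) := by
      rw [show stairL x 400 - (Λ₀ - 4) = -(Λ₀ - 4) + stairL x 400 by ring, Real.exp_add]; ring
    linarith [e]
  have hlo : ∑ N ∈ Elo, r N * m N ≤ 0.0056 * x := by
    have hterm : ∀ N ∈ Elo, r N * m N ≤ (Real.exp Λs + 1) * ((Λ₀ - 4) ^ 2 * Real.exp (-(Λ₀ - 4))) := by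
      intro N hN
      rw [hElo, mem_filter] at hN
      have hNlt : (N : ℝ) < Real.exp Λs := not_le.mp hN.2
      have h1 : r N ≤ Real.exp Λs + 1 := by
        have : r N ≤ (N : ℝ) + 1 := by
          show (SingularSeries.goldbachCount N : ℝ) ≤ (N : ℝ) + 1
          exact_mod_cast goldbachCount_le_succ N
        linarith
      have h2 : m N ≤ (Λ₀ - 4) ^ 2 * Real.exp (-(Λ₀ - 4)) := (stairW_le_stairMf hxN hℓ3 N).trans hMtop
      have hr0 : 0 ≤ r N := Nat.cast_nonneg _
      exact mul_le_mul h1 h2 (hm0 N) (by positivity)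
    have hcard : (#Elo : ℝ) ≤ Real.exp Λs + 1 := by
      have hsub : Elo ⊆ range (⌊Real.exp Λs⌋₊ + 1) := by
        intro N hN
        rw [hElo, mem_filter] at hN
        have hNlt : (N : ℝ) < Real.exp Λs := not_le.mp hN.2
        rw [mem_range]
        have := Nat.le_floor hNlt.le
        omega
      have h1 := card_le_card hsub
      rw [card_range] at h1
      have h2 : (#Elo : ℝ) ≤ (⌊Real.exp Λs⌋₊ : ℝ) + 1 := by exact_mod_cast h1
      have h3 : (⌊Real.exp Λs⌋₊ : ℝ) ≤ Real.exp Λs := Nat.floor_le (Real.exp_pos Λs).le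
      linarith
    have hs := sum_le_sum hterm
    rw [sum_const, nsmul_eq_mul] at hs
    refine hs.trans ?_
    -- `(e^Λs + 1)² · (Λ₀−4)² · e^{4−Λ₀} ≤ 0.0056·x` from `Λs + 12 ≤ Λ₀ ≤ 400` and `e^{Λ₀} ≤ x`
    have heΛ' : Real.exp Λs + 1 ≤ 1.0001 * Real.exp Λs := by
      have : (10000 : ℝ) ≤ Real.exp Λs := by
        have h13 := exp_13_ge
        have : Real.exp 13 ≤ Real.exp Λs := Real.exp_le_exp.mpr (by linarith)
        linarith
      linarith
    have hpos1 : 0 ≤ Real.exp Λs + 1 := by positivity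
    have hx18 : Real.exp (2 * Λs) * Real.exp (-(Λ₀ - 4)) ≤ Real.exp (-18) * x := by
      have e1 : Real.exp (2 * Λs) * Real.exp (-(Λ₀ - 4)) = Real.exp (2 * Λs + -(Λ₀ - 4)) := by
        rw [← Real.exp_add]
      have e2 : Real.exp (2 * Λs + -(Λ₀ - 4)) ≤ Real.exp (-18 + Λ₀) := Real.exp_le_exp.mpr (by linarith)
      have e3 : Real.exp (-18 + Λ₀) = Real.exp (-18) * Real.exp Λ₀ := Real.exp_add _ _
      rw [e1]
      refine e2.trans ?_
      rw [e3]
      exact mul_le_mul_of_nonneg_left hx (Real.exp_pos _).le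
    have h18 : Real.exp (-18) ≤ 1 / 65000000 := by
      rw [Real.exp_neg, one_div]
      exact inv_anti₀ (by norm_num) exp_18_ge
    have hΛsq : (Λ₀ - 4) ^ 2 ≤ 158404 := by nlinarith [hΛ₀4, hΛ₀]
    have e2Λ : Real.exp Λs * Real.exp Λs = Real.exp (2 * Λs) := by rw [← Real.exp_add]; ring_nf
    calc (#Elo : ℝ) * ((Real.exp Λs + 1) * ((Λ₀ - 4) ^ 2 * Real.exp (-(Λ₀ - 4))))
        ≤ (Real.exp Λs + 1) * ((Real.exp Λs + 1) * ((Λ₀ - 4) ^ 2 * Real.exp (-(Λ₀ - 4)))) :=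
          mul_le_mul_of_nonneg_right hcard (by positivity)
      _ ≤ (1.0001 * Real.exp Λs) * ((1.0001 * Real.exp Λs) * ((Λ₀ - 4) ^ 2 * Real.exp (-(Λ₀ - 4)))) :=
          mul_le_mul heΛ' (mul_le_mul_of_nonneg_right heΛ' (by positivity)) (by positivity) (by positivity)
      _ = 1.0001 ^ 2 * ((Λ₀ - 4) ^ 2 * (Real.exp (2 * Λs) * Real.exp (-(Λ₀ - 4)))) := by rw [← e2Λ]; ring
      _ ≤ 1.0001 ^ 2 * ((Λ₀ - 4) ^ 2 * (Real.exp (-18) * x)) :=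
          mul_le_mul_of_nonneg_left (mul_le_mul_of_nonneg_left hx18 (sq_nonneg _)) (by norm_num)
      _ ≤ 1.0001 ^ 2 * (158404 * ((1 / 65000000) * x)) :=
          mul_le_mul_of_nonneg_left (mul_le_mul hΛsq (mul_le_mul_of_nonneg_right h18 hx0.le)
            (by positivity) (by norm_num)) (by norm_num)
      _ ≤ 0.0056 * x := by nlinarith
  -- UPPER, pointwise on `T = {N ∈ Ehi : r(N) > 0}`: `r·m ≤ A·f`
  set T : Finset ℕ := Ehi.filter fun N => 0 < SingularSeries.goldbachCount N with hT
  have hpoint : ∀ N ∈ T, r N * m N ≤ A * f N := by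
    intro N hN
    rw [hT, mem_filter, hEhi, mem_filter, hE, mem_filter, mem_range] at hN
    obtain ⟨⟨⟨hNx, hev⟩, hNΛ⟩, _⟩ := hN
    have hNx' : (N : ℝ) ≤ x := by exact_mod_cast Nat.lt_succ_iff.mp hNx
    by_cases hQ : stairT x 400 < (N : ℝ)
    · exact stair_rm_le_main400 hxN hΛs0 hA0 hpt hbotΛ hev hNx' hQ
    · exact stair_rm_le_bottom400 hxN (by linarith) hA0 hpt hev hNΛ (not_lt.mp hQ)
  have hsumT : ∑ N ∈ Ehi, r N * m N = ∑ N ∈ T, r N * m N := by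
    have h := Finset.sum_filter_of_ne (s := Ehi) (f := fun N => r N * m N)
      (p := fun N => 0 < SingularSeries.goldbachCount N) (fun N _ hne => by
        by_contra h0
        apply hne
        simp only [not_lt, Nat.le_zero] at h0
        simp [hr, h0])
    rw [hT, h]
  have hupper : ∑ N ∈ T, r N * m N ≤ A * ∑ N ∈ T, f N := by
    rw [mul_sum]
    exact sum_le_sum hpoint
  -- `F·x ≤ A·Σ_T f`
  have hx21 : (21 : ℝ) + 0.0056 * x ≤ 0.0057 * x + 0 := by
    have : (210000 : ℝ) ≤ x := by
      have h13 := exp_13_ge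
      have : Real.exp 13 ≤ Real.exp 53.5 := Real.exp_le_exp.mpr (by norm_num)
      linarith
    linarith
  have hFx : F * x ≤ A * ∑ N ∈ T, f N := by
    have h1 : c₁' * (g * x - 21) - 0.0056 * x ≤ ∑ N ∈ T, r N * m N := by
      rw [← hsumT]; linarith [hsplit, hlower, hlo]
    have h2 : F * x ≤ c₁' * (g * x - 21) - 0.0056 * x := by
      rw [hF_def]
      have : c₁' * 21 ≤ 21 := by nlinarith
      nlinarith
    exact h2.trans (h1.trans hupper)
  -- Hölder on `T`
  set Ep : Finset ℕ := (Ioc 0 x).filter Even with hEp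
  have hTA : T ⊆ {N ∈ Ioc 0 x | Even N ∧ ∃ p q : ℕ, p.Prime ∧ q.Prime ∧ p + q = N} := by
    intro N hN
    rw [hT, mem_filter, hEhi, mem_filter, hE, mem_filter, mem_range] at hN
    obtain ⟨⟨⟨hNx, he⟩, _⟩, hpos⟩ := hN
    unfold SingularSeries.goldbachCount at hpos
    obtain ⟨pq, hpq⟩ := card_pos.mp hpos
    rw [mem_filter, Finset.HasAntidiagonal.mem_antidiagonal] at hpq
    have hN2 : 2 ≤ N := by
      have := hpq.2.1.two_le
      omega
    rw [mem_filter, mem_Ioc]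
    exact ⟨⟨by omega, by omega⟩, he, pq.1, pq.2, hpq.2.1, hpq.2.2, hpq.1⟩
  have hTEp : T ⊆ Ep := by
    intro N hN
    have h := hTA hN
    rw [mem_filter] at h
    rw [hEp, mem_filter]
    exact ⟨h.1, h.2.1⟩
  have hf0 : ∀ N ∈ T, 0 ≤ f N := fun N _ => oddSingularFactor_nonneg N
  have hHolder : (∑ N ∈ T, f N) ^ 8 ≤ (#T : ℝ) ^ 7 * (259.55 * x) := by
    have h1 := pow8_sum_le T f hf0
    have h2 : ∑ N ∈ T, f N ^ 8 ≤ 259.55 * x :=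
      (sum_le_sum_of_subset_of_nonneg hTEp fun N _ _ => by positivity).trans
        (sum_even_oddSingularFactor_pow8_le x)
    exact h1.trans (mul_le_mul_of_nonneg_left h2 (by positivity))
  set Ax : ℝ := ((#{N ∈ Ioc 0 x | Even N ∧ ∃ p q : ℕ, p.Prime ∧ q.Prime ∧ p + q = N} : ℕ) : ℝ) with hAx
  have hTcard : (#T : ℝ) ≤ Ax := by rw [hAx]; exact_mod_cast card_le_card hTA
  -- the final algebra: `(F x)⁸ ≤ A⁸·|T|⁷·259.55·x` and `κ⁷·259.55·A⁸ ≤ F⁸` give `|T| ≥ κ·x`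
  have hF0' : 0 ≤ F := hF0
  have hFx0 : 0 ≤ F * x := mul_nonneg hF0' hx0.le
  have hchain : (F * x) ^ 8 ≤ A ^ 8 * ((#T : ℝ) ^ 7 * (259.55 * x)) := by
    calc (F * x) ^ 8 ≤ (A * ∑ N ∈ T, f N) ^ 8 := pow_le_pow_left₀ hFx0 hFx 8
      _ = A ^ 8 * (∑ N ∈ T, f N) ^ 8 := by ring
      _ ≤ A ^ 8 * ((#T : ℝ) ^ 7 * (259.55 * x)) := mul_le_mul_of_nonneg_left hHolder (by positivity)
  by_contra hcon
  rw [not_le] at hcon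
  have hTlt : (#T : ℝ) < κ * x := lt_of_le_of_lt hTcard hcon
  have h7 : (#T : ℝ) ^ 7 < (κ * x) ^ 7 := pow_lt_pow_left₀ hTlt (by positivity) (by norm_num)
  have hlt : A ^ 8 * ((#T : ℝ) ^ 7 * (259.55 * x)) < A ^ 8 * ((κ * x) ^ 7 * (259.55 * x)) := by
    apply mul_lt_mul_of_pos_left _ (by positivity)
    exact mul_lt_mul_of_pos_right h7 (by positivity)
  have e1 : A ^ 8 * ((κ * x) ^ 7 * (259.55 * x)) = κ ^ 7 * (259.55 * A ^ 8) * (x : ℝ) ^ 8 := by ring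
  have e2 : (F * x) ^ 8 = F ^ 8 * (x : ℝ) ^ 8 := by ring
  have hκx : κ ^ 7 * (259.55 * A ^ 8) * (x : ℝ) ^ 8 ≤ F ^ 8 * (x : ℝ) ^ 8 :=
    mul_le_mul_of_nonneg_right hκ (by positivity)
  linarith [hchain, hlt, e1, e2, hκx]

/-! #### §3.2 The pair sieve at `e^215`; the four-regime glues with `h ≥ 23` (unconditional) and under (3.3) -/

/-- Numerics at `Λ = 215`: `17L² ≤ 16·13.90·TlowK(L/2 − 1.38632)` for `L ≥ 215`. [folklore] -/
private theorem kappa_numeric_215 {L : ℝ} (hL : 215 ≤ L) :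
    17 * L ^ 2 ≤ 16 * (13.92 - 0.02) * TwoResidueSelbergExplicit.TlowK (L / 2 - 1.38632) := by
  unfold TwoResidueSelbergExplicit.TlowK
  nlinarith [hL, mul_self_nonneg (L - 215)]

/-- **Pair sieve from `e^215` with constant `13.92`**: `#{p ≤ N : p + h prime} ≤ 13.92·f(h)·N/log²N`. [cite: BatemanDiamond2004, §13.4 (13.13)–(13.14) (explicit pair-sieve constant at the threshold e^215; proved here)] -/
theorem pairCount_le_1392 {N h : ℕ} (hN : Real.exp 215 ≤ (N : ℝ)) (hh : h ≠ 0) (heven : Even h) :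
    ((((Nat.primesLE N).filter fun p => (p + h).Prime).card : ℕ) : ℝ)
      ≤ 13.92 * oddSingularFactor h * (N : ℝ) / Real.log (N : ℝ) ^ 2 :=
  pairCount_le_of_numeric41 (by norm_num) (fun _ hL => kappa_numeric_215 hL) hN hh heven

set_option maxHeartbeats 4000000 in
/-- **All `y ≥ 1` for the halved set, FOUR-REGIME glue (ROUND-36 form)**: as ROUND-35's `half_count_ge_allN_bonf12S`
(one shift with `c₀ = 0.9212` below `e^{L₁}`, `L₁ ≤ 1.8424h`; four / seven shifts with Sylvester's `0.93919` and the pair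
constant `17.75` on `[L₁, L₂]` / `[L₂, L₃]`; twelve shifts `q ∈ {3,5,…,41}` on `[L₃, Λ₀]`), with two relaxations:
the twelve-shift regime starts at `L₃ ≥ 215` with the pair sieve run at `e^215` (`pairCount_le_1392`, weight
`27.84·96.8871 ≤ 2698`: `L² + h ≤ h·(22.54056·L − 2698)`), and `h ≥ 23` suffices (below `10⁶` the one-shift regime uses
the pointwise Chebyshev bound `π(n) ≥ (n+2)/45`, `n ≥ 88`, of the tree instead of `n/(4 log n)`).
[cite: Nathanson1996, Thm 7.7 (all-`x` form); BatemanDiamond2004, Thm 13.8 (pair sieve, explicit form proved in the tree)] -/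
theorem half_count_ge_allN_lev {L₁ L₂ L₃ Λ₀ : ℝ} {h : ℕ} (h23 : 23 ≤ h) (h41 : 41 ≤ L₁) (hL₁h : L₁ ≤ 1.8424 * h)
    (hL₃ : 215 ≤ L₃) (hΛ4 : Λ₀ ≤ 10000)
    (hquad : ∀ L : ℝ, L₁ ≤ L → L ≤ L₂ → L ^ 2 + h ≤ h * (7.51352 * L - 248.5))
    (hquad7 : ∀ L : ℝ, L₂ ≤ L → L ≤ L₃ → L ^ 2 + h ≤ h * (13.14866 * L - 996.37))
    (hquad12 : ∀ L : ℝ, L₃ ≤ L → L ≤ Λ₀ → L ^ 2 + h ≤ h * (22.54056 * L - 2698))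
    (hlarge : ∀ x : ℕ, Real.exp Λ₀ ≤ (x : ℝ) →
      (x : ℝ) / (2 * h) ≤ #{N ∈ Ioc 0 x | Even N ∧ ∃ p q : ℕ, p.Prime ∧ q.Prime ∧ p + q = N})
    {y : ℕ} (hy : 1 ≤ y) :
    (y : ℝ) / h ≤ #{b ∈ Ioc 0 y | b ∈ (({0, 1} : Set ℕ) ∪ {m | ∃ p q : ℕ, p.Prime ∧ q.Prime ∧ p + q = 2 * m})} := by
  set B : Set ℕ := ({0, 1} : Set ℕ) ∪ {m | ∃ p q : ℕ, p.Prime ∧ q.Prime ∧ p + q = 2 * m} with hB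
  have hhr : (23 : ℝ) ≤ h := by exact_mod_cast h23
  have hh0 : (0 : ℝ) < h := by linarith
  have hL₁pos : (0 : ℝ) < L₁ := by linarith
  by_cases hbig : Real.exp Λ₀ ≤ ((2 * y : ℕ) : ℝ)
  · have h1 := hlarge (2 * y) hbig
    have h2 := even_goldbach_card_le_half y
    have e : ((2 * y : ℕ) : ℝ) / (2 * h) = (y : ℝ) / h := by
      push_cast
      field_simp
    rw [e] at h1
    exact h1.trans (by exact_mod_cast h2)
  rw [not_le] at hbig
  by_cases hsmall : y ≤ h
  · have h1 : 1 ≤ #{b ∈ Ioc 0 y | b ∈ B} :=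
      card_pos.mpr ⟨1, by
        rw [mem_filter, mem_Ioc]
        exact ⟨⟨by omega, hy⟩, Or.inl (by simp)⟩⟩
    have h1' : (1 : ℝ) ≤ #{b ∈ Ioc 0 y | b ∈ B} := by exact_mod_cast h1
    have h2 : (y : ℝ) / h ≤ 1 := by
      rw [div_le_one hh0]
      exact_mod_cast hsmall
    linarith
  rw [not_le] at hsmall
  have hy29 : 24 ≤ y := by omega
  have hnr : ((2 * y - 3 : ℕ) : ℝ) = 2 * (y : ℝ) - 3 := cast_two_mul_sub_three (by omega)
  have hy29r : (24 : ℝ) ≤ y := by exact_mod_cast hy29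
  have hy0 : (0 : ℝ) < y := by linarith
  have hn55 : 45 ≤ 2 * y - 3 := by omega
  have hn0 : (0 : ℝ) < ((2 * y - 3 : ℕ) : ℝ) := by rw [hnr]; linarith
  have hn1 : (1 : ℝ) < ((2 * y - 3 : ℕ) : ℝ) := by rw [hnr]; linarith
  have hlogpos : 0 < Real.log ((2 * y - 3 : ℕ) : ℝ) := Real.log_pos hn1
  by_cases hmid : Real.log ((2 * y - 3 : ℕ) : ℝ) ≤ L₁
  · -- ONE SHIFT below `e^{L₁}` (§15)
    have hemb := primeCounting_shift_le_half_count (y := y) (by omega)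
    have hembr : (Nat.primeCounting (2 * y - 3) : ℝ) + 1 ≤ #{b ∈ Ioc 0 y | b ∈ B} := by exact_mod_cast hemb
    refine le_trans ?_ hembr
    by_cases h6 : 10 ^ 6 ≤ 2 * y - 3
    · have hπ : 0.9212 * ((2 * y - 3 : ℕ) : ℝ) / Real.log ((2 * y - 3 : ℕ) : ℝ)
          ≤ (Nat.primeCounting (2 * y - 3) : ℝ) := by
        have := primeCountingLowerMul_09212
        unfold PrimeCountingLowerMul at this
        exact this (2 * y - 3) h6
      have h2 : 0.9212 * ((2 * y - 3 : ℕ) : ℝ) / L₁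
          ≤ 0.9212 * ((2 * y - 3 : ℕ) : ℝ) / Real.log ((2 * y - 3 : ℕ) : ℝ) :=
        div_le_div_of_nonneg_left (by positivity) hlogpos hmid
      have h3 : (y : ℝ) / h ≤ 1.8424 * y / L₁ := by
        rw [div_le_div_iff₀ hh0 hL₁pos]
        nlinarith [mul_le_mul_of_nonneg_left hL₁h hy0.le]
      have h4 : 1.8424 * (y : ℝ) / L₁ ≤ 0.9212 * ((2 * y - 3 : ℕ) : ℝ) / L₁ + 1 := by
        rw [hnr]
        have e : 0.9212 * (2 * (y : ℝ) - 3) / L₁ = 1.8424 * y / L₁ - 2.7636 / L₁ := by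
          field_simp
          ring
        rw [e]
        have : 2.7636 / L₁ ≤ 1 := by
          rw [div_le_one hL₁pos]
          linarith
        linarith
      linarith [h2, h3, h4, hπ]
    · rw [not_le] at h6
      -- `2y − 3 < 10⁶`: Chebyshev pointwise `(n + 2)/45 ≤ π(n)` for `n ≥ 88` (tree), `π(n) ≥ π(3) = 2` below
      by_cases h88 : 88 ≤ 2 * y - 3
      · have hlog14 : Real.log ((2 * y - 3 : ℕ) : ℝ) ≤ 14 := log_le_14_of_lt (by omega) h6
        have hπ := primeCounting_ge_div45 h88 (by linarith)
        rw [hnr] at hπ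
        have h6' : (y : ℝ) / h ≤ (y : ℝ) / 23 := div_le_div_of_nonneg_left hy0.le (by norm_num) hhr
        have h7 : (y : ℝ) / 23 ≤ (2 * (y : ℝ) - 3 + 2) / 45 + 1 := by
          rw [div_le_iff₀ (by norm_num : (0 : ℝ) < 23)]
          linarith
        linarith [hπ, h6', h7]
      · rw [not_le] at h88
        have hπ3 : Nat.primeCounting 3 = 2 := by decide
        have hmono := Nat.monotone_primeCounting (show 3 ≤ 2 * y - 3 by omega)
        rw [hπ3] at hmono
        have hπ2 : (2 : ℝ) ≤ (Nat.primeCounting (2 * y - 3) : ℝ) := by exact_mod_cast hmono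
        have hy45 : (y : ℝ) ≤ 45 := by exact_mod_cast (show y ≤ 45 by omega)
        have h7 : (y : ℝ) / h ≤ 2 := by
          rw [div_le_iff₀ hh0]
          linarith
        linarith
  · -- FOUR SHIFTS on `(e^{L₁}, e^{Λ₀})`
    rw [not_le] at hmid
    have h59 : (576460752303423488 : ℝ) < ((2 * y - 3 : ℕ) : ℝ) := by
      have h1 : Real.exp L₁ < ((2 * y - 3 : ℕ) : ℝ) := by
        by_contra hc
        rw [not_lt] at hc
        have := Real.log_le_log hn0 hc
        rw [Real.log_exp] at this
        linarith
      exact lt_of_le_of_lt (numeral_le_exp_41.trans (Real.exp_le_exp.mpr h41)) h1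
    have h59n : 576460752303423488 < 2 * y - 3 := by exact_mod_cast h59
    have hy58 : (288230376151711744 : ℝ) ≤ (y : ℝ) := by
      have : 288230376151711744 ≤ y := by omega
      exact_mod_cast this
    have h2y0 : (0 : ℝ) < ((2 * y : ℕ) : ℝ) := by push_cast; linarith
    set L := Real.log ((2 * y : ℕ) : ℝ) with hLdef
    have hLΛ : L < Λ₀ := by
      have := Real.log_lt_log h2y0 hbig
      rwa [Real.log_exp] at this
    have hL₁L : L₁ ≤ L := by
      have h2y : ((2 * y - 3 : ℕ) : ℝ) ≤ ((2 * y : ℕ) : ℝ) := by rw [hnr]; push_cast; linarith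
      exact (hmid.trans_le (Real.log_le_log hn0 h2y)).le
    have hL41 : (41 : ℝ) ≤ L := h41.trans hL₁L
    have hLpos : (0 : ℝ) < L := by linarith
    have hL4 : L ≤ 10000 := by linarith
    have he41 : Real.exp 41 ≤ ((2 * y : ℕ) : ℝ) := by
      have : Real.exp 41 ≤ Real.exp L := Real.exp_le_exp.mpr hL41
      rwa [hLdef, Real.exp_log h2y0] at this
    -- the prime counts, Sylvester's constant
    have hπ : ∀ q : ℕ, q ≤ 41 → 0.93919 * (2 * (y : ℝ) - q) / L ≤ (Nat.primeCounting (2 * y - q) : ℝ) := by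
      intro q hq
      have hqr : (q : ℝ) ≤ 41 := by exact_mod_cast hq
      have hnq : ((2 * y - q : ℕ) : ℝ) = 2 * (y : ℝ) - q := cast_two_mul_sub (by omega)
      have h6 : 10 ^ 12 ≤ 2 * y - q := by omega
      have hnq0 : (0 : ℝ) < ((2 * y - q : ℕ) : ℝ) := by rw [hnq]; linarith
      have hnq1 : (1 : ℝ) < ((2 * y - q : ℕ) : ℝ) := by rw [hnq]; linarith
      have h1 : 0.93919 * ((2 * y - q : ℕ) : ℝ) / Real.log ((2 * y - q : ℕ) : ℝ)
          ≤ (Nat.primeCounting (2 * y - q) : ℝ) := by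
        have := primeCountingLowerMul_sylvester
        unfold PrimeCountingLowerMul at this
        exact this (2 * y - q) h6
      have hlogq0 : 0 < Real.log ((2 * y - q : ℕ) : ℝ) := Real.log_pos hnq1
      have hlogq : Real.log ((2 * y - q : ℕ) : ℝ) ≤ L := by
        have h2y : ((2 * y - q : ℕ) : ℝ) ≤ ((2 * y : ℕ) : ℝ) := by
          rw [hnq]; push_cast; linarith [Nat.cast_nonneg (α := ℝ) q]
        exact Real.log_le_log hnq0 h2y
      have h2 : 0.93919 * (2 * (y : ℝ) - q) / L
          ≤ 0.93919 * ((2 * y - q : ℕ) : ℝ) / Real.log ((2 * y - q : ℕ) : ℝ) := by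
        rw [← hnq]
        exact div_le_div_of_nonneg_left (by positivity) hlogq0 hlogq
      linarith
    -- the pair counts (tree: explicit pair sieve above `e^41`)
    have hP : ∀ d : ℕ, d ≠ 0 → Even d →
        (#((Nat.primesLE (2 * y)).filter (fun p => (p + d).Prime)) : ℝ)
          ≤ 17.75 * oddSingularFactor d * ((2 * y : ℕ) : ℝ) / L ^ 2 := by
      intro d hd hde
      exact TwoResidueSelbergExplicit.pairCount_le_kappa (N := 2 * y) (h := d) he41 hd hde
    rcases le_or_gt L L₂ with hmid2 | hmid2
    · -- FOUR SHIFTS on `(e^{L₁}, e^{L₂}]`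
      have hq := hquad L hL₁L hmid2
      have hP2 := hP 2 (by norm_num) (by norm_num)
      have hP4 := hP 4 (by norm_num) (by norm_num)
      have hP6 := hP 6 (by norm_num) (by norm_num)
      have hP8 := hP 8 (by norm_num) (by norm_num)
      rw [oddSingularFactor_two'] at hP2
      rw [oddSingularFactor_four] at hP4
      rw [oddSingularFactor_six] at hP6
      rw [oddSingularFactor_eight] at hP8
      -- combinatorics
      have hcomb := four_shift_count (y := y) (by omega)
      have hcombr : (Nat.primeCounting (2 * y - 3) : ℝ) + Nat.primeCounting (2 * y - 5)
          + Nat.primeCounting (2 * y - 7) + Nat.primeCounting (2 * y - 11)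
          ≤ (#{b ∈ Ioc 0 y | b ∈ B} : ℝ) + 2
            + (2 * #((Nat.primesLE (2 * y)).filter (fun p => (p + 2).Prime))
              + 2 * #((Nat.primesLE (2 * y)).filter (fun p => (p + 4).Prime))
              + #((Nat.primesLE (2 * y)).filter (fun p => (p + 8).Prime))
              + #((Nat.primesLE (2 * y)).filter (fun p => (p + 6).Prime))) := by
        exact_mod_cast hcomb
      have hπ3 := hπ 3 (by norm_num)
      have hπ5 := hπ 5 (by norm_num)
      have hπ7 := hπ 7 (by norm_num)
      have hπ11 := hπ 11 (by norm_num)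
      push_cast at hπ3 hπ5 hπ7 hπ11
      have h2yr : ((2 * y : ℕ) : ℝ) = 2 * (y : ℝ) := by push_cast; ring
      rw [h2yr] at hP2 hP4 hP6 hP8
      set G : ℝ := (#{b ∈ Ioc 0 y | b ∈ B} : ℝ) with hG
      set Y : ℝ := (y : ℝ) with hY
      -- `G ≥ (7.51352 Y − 24.41894)/L − 2 − 248.5 Y/L²`
      have hG1 : (7.51352 * Y - 24.41894) / L - 2 - 248.5 * Y / L ^ 2 ≤ G := by
        have e1 : (7.51352 * Y - 24.41894) / L = 0.93919 * (2 * Y - 3) / L + 0.93919 * (2 * Y - 5) / L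
            + 0.93919 * (2 * Y - 7) / L + 0.93919 * (2 * Y - 11) / L := by
          field_simp
          ring
        have e2 : 248.5 * Y / L ^ 2 = 2 * (17.75 * 1 * (2 * Y) / L ^ 2) + 2 * (17.75 * 1 * (2 * Y) / L ^ 2)
            + 17.75 * 1 * (2 * Y) / L ^ 2 + 17.75 * 2 * (2 * Y) / L ^ 2 := by
          field_simp
          ring
        rw [e1, e2]
        linarith [hcombr, hπ3, hπ5, hπ7, hπ11, hP2, hP4, hP6, hP8]
      have hL2 : (0 : ℝ) < L ^ 2 := by positivity
      have hkey : Y * L ^ 2 ≤ (h : ℝ) * G * L ^ 2 := by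
        have e3 : ((7.51352 * Y - 24.41894) / L - 2 - 248.5 * Y / L ^ 2) * L ^ 2
            = 7.51352 * Y * L - 24.41894 * L - 2 * L ^ 2 - 248.5 * Y := by
          field_simp
        have h1 : (7.51352 * Y * L - 24.41894 * L - 2 * L ^ 2 - 248.5 * Y) * h ≤ G * L ^ 2 * h := by
          rw [← e3]
          exact mul_le_mul_of_nonneg_right (mul_le_mul_of_nonneg_right hG1 hL2.le) hh0.le
        have h2 : Y * (L ^ 2 + h) ≤ Y * (h * (7.51352 * L - 248.5)) :=
          mul_le_mul_of_nonneg_left hq (by linarith)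
        have h3 : 24.41894 * L + 2 * L ^ 2 ≤ Y := by
          nlinarith [mul_nonneg (sub_nonneg.2 hL4) hLpos.le]
        have h3' : (h : ℝ) * (24.41894 * L + 2 * L ^ 2) ≤ h * Y := mul_le_mul_of_nonneg_left h3 hh0.le
        nlinarith [h1, h2, h3']
      have hfin := le_of_mul_le_mul_right hkey hL2
      rw [div_le_iff₀ hh0, mul_comm]
      exact hfin
    · rcases le_or_gt L L₃ with hmid3 | hmid3
      · -- SEVEN SHIFTS on `(e^{L₂}, e^{L₃}]`
        have hq := hquad7 L hmid2.le hmid3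
        have hP2 := hP 2 (by norm_num) (by norm_num)
        have hP4 := hP 4 (by norm_num) (by norm_num)
        have hP6 := hP 6 (by norm_num) (by norm_num)
        have hP8 := hP 8 (by norm_num) (by norm_num)
        have hP10 := hP 10 (by norm_num) (by norm_num)
        have hP12 := hP 12 (by norm_num) (by norm_num)
        have hP14 := hP 14 (by norm_num) (by norm_num)
        have hP16 := hP 16 (by norm_num) (by norm_num)
        rw [oddSingularFactor_two'] at hP2
        rw [oddSingularFactor_four] at hP4
        rw [oddSingularFactor_six] at hP6
        rw [oddSingularFactor_eight] at hP8
        rw [oddSingularFactor_ten] at hP10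
        rw [oddSingularFactor_twelve] at hP12
        rw [oddSingularFactor_fourteen] at hP14
        rw [oddSingularFactor_sixteen] at hP16
        have hcomb := seven_shift_count (y := y) (by omega)
        have hcombr : (Nat.primeCounting (2 * y - 3) : ℝ) + Nat.primeCounting (2 * y - 5)
            + Nat.primeCounting (2 * y - 7) + Nat.primeCounting (2 * y - 11) + Nat.primeCounting (2 * y - 13)
            + Nat.primeCounting (2 * y - 17) + Nat.primeCounting (2 * y - 19)
            ≤ (#{b ∈ Ioc 0 y | b ∈ B} : ℝ) + 5
              + (4 * #((Nat.primesLE (2 * y)).filter (fun p => (p + 2).Prime))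
                + 3 * #((Nat.primesLE (2 * y)).filter (fun p => (p + 4).Prime))
                + 4 * #((Nat.primesLE (2 * y)).filter (fun p => (p + 6).Prime))
                + 3 * #((Nat.primesLE (2 * y)).filter (fun p => (p + 8).Prime))
                + 2 * #((Nat.primesLE (2 * y)).filter (fun p => (p + 10).Prime))
                + 2 * #((Nat.primesLE (2 * y)).filter (fun p => (p + 12).Prime))
                + 2 * #((Nat.primesLE (2 * y)).filter (fun p => (p + 14).Prime))
                + #((Nat.primesLE (2 * y)).filter (fun p => (p + 16).Prime))) := by
          exact_mod_cast hcomb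
        have hπ3 := hπ 3 (by norm_num)
        have hπ5 := hπ 5 (by norm_num)
        have hπ7 := hπ 7 (by norm_num)
        have hπ11 := hπ 11 (by norm_num)
        have hπ13 := hπ 13 (by norm_num)
        have hπ17 := hπ 17 (by norm_num)
        have hπ19 := hπ 19 (by norm_num)
        push_cast at hπ3 hπ5 hπ7 hπ11 hπ13 hπ17 hπ19
        have h2yr : ((2 * y : ℕ) : ℝ) = 2 * (y : ℝ) := by push_cast; ring
        rw [h2yr] at hP2 hP4 hP6 hP8 hP10 hP12 hP14 hP16
        set G : ℝ := (#{b ∈ Ioc 0 y | b ∈ B} : ℝ) with hG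
        set Y : ℝ := (y : ℝ) with hY
        have hY0 : 0 ≤ Y := le_trans (by norm_num) hy58
        have hL2 : (0 : ℝ) < L ^ 2 := by positivity
        have hG1 : (13.14866 * Y - 70.43925) / L - 5 - 996.37 * Y / L ^ 2 ≤ G := by
          have e1 : (13.14866 * Y - 70.43925) / L
              = 0.93919 * (2 * Y - 3) / L + 0.93919 * (2 * Y - 5) / L + 0.93919 * (2 * Y - 7) / L + 0.93919 * (2 * Y - 11) / L + 0.93919 * (2 * Y - 13) / L + 0.93919 * (2 * Y - 17) / L + 0.93919 * (2 * Y - 19) / L := by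
            field_simp
            ring
          have e2 : 4 * (17.75 * 1 * (2 * Y) / L ^ 2) + 3 * (17.75 * 1 * (2 * Y) / L ^ 2)
              + 4 * (17.75 * 2 * (2 * Y) / L ^ 2) + 3 * (17.75 * 1 * (2 * Y) / L ^ 2)
              + 2 * (17.75 * (4 / 3) * (2 * Y) / L ^ 2) + 2 * (17.75 * 2 * (2 * Y) / L ^ 2)
              + 2 * (17.75 * (6 / 5) * (2 * Y) / L ^ 2) + 17.75 * 1 * (2 * Y) / L ^ 2
              = (29891 / 30) * Y / L ^ 2 := by
            field_simp
            ring
          have e3 : (29891 / 30 : ℝ) * Y / L ^ 2 ≤ 996.37 * Y / L ^ 2 :=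
            div_le_div_of_nonneg_right (mul_le_mul_of_nonneg_right (by norm_num) hY0) hL2.le
          rw [e1]
          linarith [hcombr, hπ3, hπ5, hπ7, hπ11, hπ13, hπ17, hπ19, hP2, hP4, hP6, hP8, hP10, hP12, hP14, hP16,
            e2, e3]
        have hkey : Y * L ^ 2 ≤ (h : ℝ) * G * L ^ 2 := by
          have e4 : ((13.14866 * Y - 70.43925) / L - 5 - 996.37 * Y / L ^ 2) * L ^ 2
              = 13.14866 * Y * L - 70.43925 * L - 5 * L ^ 2 - 996.37 * Y := by
            field_simp
          have h1 : (13.14866 * Y * L - 70.43925 * L - 5 * L ^ 2 - 996.37 * Y) * h ≤ G * L ^ 2 * h := by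
            rw [← e4]
            exact mul_le_mul_of_nonneg_right (mul_le_mul_of_nonneg_right hG1 hL2.le) hh0.le
          have h2 : Y * (L ^ 2 + h) ≤ Y * (h * (13.14866 * L - 996.37)) :=
            mul_le_mul_of_nonneg_left hq (by linarith)
          have h3 : 70.43925 * L + 5 * L ^ 2 ≤ Y := by
            nlinarith [mul_nonneg (sub_nonneg.2 hL4) hLpos.le]
          have h3' : (h : ℝ) * (70.43925 * L + 5 * L ^ 2) ≤ h * Y := mul_le_mul_of_nonneg_left h3 hh0.le
          nlinarith [h1, h2, h3']
        have hfin := le_of_mul_le_mul_right hkey hL2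
        rw [div_le_iff₀ hh0, mul_comm]
        exact hfin
      · -- TWELVE SHIFTS on `(e^{L₃}, e^{Λ₀})`, pair sieve at the threshold `e^215`
        have hq := hquad12 L hmid3.le hLΛ.le
        have he215 : Real.exp 215 ≤ ((2 * y : ℕ) : ℝ) := by
          have : Real.exp 215 ≤ Real.exp L := Real.exp_le_exp.mpr (hL₃.trans hmid3.le)
          rwa [hLdef, Real.exp_log h2y0] at this
        have hPt : ∀ d : ℕ, d ≠ 0 → Even d →
            (#((Nat.primesLE (2 * y)).filter (fun p => (p + d).Prime)) : ℝ)
              ≤ 13.92 * oddSingularFactor d * ((2 * y : ℕ) : ℝ) / L ^ 2 := by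
          intro d hd hde
          rw [hLdef]
          exact pairCount_le_1392 (N := 2 * y) (h := d) he215 hd hde
        have hQ2 := hPt 2 (by norm_num) (by norm_num)
        have hQ4 := hPt 4 (by norm_num) (by norm_num)
        have hQ6 := hPt 6 (by norm_num) (by norm_num)
        have hQ8 := hPt 8 (by norm_num) (by norm_num)
        have hQ10 := hPt 10 (by norm_num) (by norm_num)
        have hQ12 := hPt 12 (by norm_num) (by norm_num)
        have hQ14 := hPt 14 (by norm_num) (by norm_num)
        have hQ16 := hPt 16 (by norm_num) (by norm_num)
        have hQ18 := hPt 18 (by norm_num) (by norm_num)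
        have hQ20 := hPt 20 (by norm_num) (by norm_num)
        have hQ22 := hPt 22 (by norm_num) (by norm_num)
        have hQ24 := hPt 24 (by norm_num) (by norm_num)
        have hQ26 := hPt 26 (by norm_num) (by norm_num)
        have hQ28 := hPt 28 (by norm_num) (by norm_num)
        have hQ30 := hPt 30 (by norm_num) (by norm_num)
        have hQ32 := hPt 32 (by norm_num) (by norm_num)
        have hQ34 := hPt 34 (by norm_num) (by norm_num)
        have hQ36 := hPt 36 (by norm_num) (by norm_num)
        have hQ38 := hPt 38 (by norm_num) (by norm_num)
        rw [oddSingularFactor_two'] at hQ2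
        rw [oddSingularFactor_four] at hQ4
        rw [oddSingularFactor_six] at hQ6
        rw [oddSingularFactor_eight] at hQ8
        rw [oddSingularFactor_ten] at hQ10
        rw [oddSingularFactor_twelve] at hQ12
        rw [oddSingularFactor_fourteen] at hQ14
        rw [oddSingularFactor_sixteen] at hQ16
        rw [oddSingularFactor_eighteen] at hQ18
        rw [oddSingularFactor_twenty] at hQ20
        rw [oddSingularFactor_twentytwo] at hQ22
        rw [oddSingularFactor_twentyfour] at hQ24
        rw [oddSingularFactor_twentysix] at hQ26
        rw [oddSingularFactor_twentyeight] at hQ28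
        rw [oddSingularFactor_thirty] at hQ30
        rw [oddSingularFactor_thirtytwo] at hQ32
        rw [oddSingularFactor_thirtyfour] at hQ34
        rw [oddSingularFactor_thirtysix] at hQ36
        rw [oddSingularFactor_thirtyeight] at hQ38
        have hcomb := twelve_shift_count (y := y) (by omega)
        have hcombr : (Nat.primeCounting (2 * y - 3) : ℝ) + Nat.primeCounting (2 * y - 5)
            + Nat.primeCounting (2 * y - 7) + Nat.primeCounting (2 * y - 11) + Nat.primeCounting (2 * y - 13)
            + Nat.primeCounting (2 * y - 17) + Nat.primeCounting (2 * y - 19) + Nat.primeCounting (2 * y - 23)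
            + Nat.primeCounting (2 * y - 29) + Nat.primeCounting (2 * y - 31) + Nat.primeCounting (2 * y - 37)
            + Nat.primeCounting (2 * y - 41)
            ≤ (#{b ∈ Ioc 0 y | b ∈ (({0, 1} : Set ℕ) ∪ {m | ∃ p q : ℕ, p.Prime ∧ q.Prime ∧ p + q = 2 * m})} : ℝ) + 10
              + (5 * #((Nat.primesLE (2 * y)).filter (fun p => (p + 2).Prime))
                + 5 * #((Nat.primesLE (2 * y)).filter (fun p => (p + 4).Prime))
                + 7 * #((Nat.primesLE (2 * y)).filter (fun p => (p + 6).Prime))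
                + 5 * #((Nat.primesLE (2 * y)).filter (fun p => (p + 8).Prime))
                + 5 * #((Nat.primesLE (2 * y)).filter (fun p => (p + 10).Prime))
                + 6 * #((Nat.primesLE (2 * y)).filter (fun p => (p + 12).Prime))
                + 4 * #((Nat.primesLE (2 * y)).filter (fun p => (p + 14).Prime))
                + 3 * #((Nat.primesLE (2 * y)).filter (fun p => (p + 16).Prime))
                + 5 * #((Nat.primesLE (2 * y)).filter (fun p => (p + 18).Prime))
                + 3 * #((Nat.primesLE (2 * y)).filter (fun p => (p + 20).Prime))
                + 2 * #((Nat.primesLE (2 * y)).filter (fun p => (p + 22).Prime))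
                + 4 * #((Nat.primesLE (2 * y)).filter (fun p => (p + 24).Prime))
                + 3 * #((Nat.primesLE (2 * y)).filter (fun p => (p + 26).Prime))
                + 2 * #((Nat.primesLE (2 * y)).filter (fun p => (p + 28).Prime))
                + 2 * #((Nat.primesLE (2 * y)).filter (fun p => (p + 30).Prime))
                + #((Nat.primesLE (2 * y)).filter (fun p => (p + 32).Prime))
                + 2 * #((Nat.primesLE (2 * y)).filter (fun p => (p + 34).Prime))
                + #((Nat.primesLE (2 * y)).filter (fun p => (p + 36).Prime))
                + #((Nat.primesLE (2 * y)).filter (fun p => (p + 38).Prime))) := by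
          exact_mod_cast hcomb
        have hπ3 := hπ 3 (by norm_num)
        have hπ5 := hπ 5 (by norm_num)
        have hπ7 := hπ 7 (by norm_num)
        have hπ11 := hπ 11 (by norm_num)
        have hπ13 := hπ 13 (by norm_num)
        have hπ17 := hπ 17 (by norm_num)
        have hπ19 := hπ 19 (by norm_num)
        have hπ23 := hπ 23 (by norm_num)
        have hπ29 := hπ 29 (by norm_num)
        have hπ31 := hπ 31 (by norm_num)
        have hπ37 := hπ 37 (by norm_num)
        have hπ41 := hπ 41 (by norm_num)
        push_cast at hπ3 hπ5 hπ7 hπ11 hπ13 hπ17 hπ19 hπ23 hπ29 hπ31 hπ37 hπ41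
        have h2yr : ((2 * y : ℕ) : ℝ) = 2 * (y : ℝ) := by push_cast; ring
        rw [h2yr] at hQ2 hQ4 hQ6 hQ8 hQ10 hQ12 hQ14 hQ16 hQ18 hQ20 hQ22 hQ24 hQ26 hQ28 hQ30 hQ32 hQ34 hQ36 hQ38
        set G : ℝ := (#{b ∈ Ioc 0 y | b ∈ (({0, 1} : Set ℕ) ∪ {m | ∃ p q : ℕ, p.Prime ∧ q.Prime ∧ p + q = 2 * m})} : ℝ) with hG
        set Y : ℝ := (y : ℝ) with hY
        have hY0 : 0 ≤ Y := le_trans (by norm_num) hy58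
        have hL2 : (0 : ℝ) < L ^ 2 := by positivity
        have hG1 : (22.54056 * Y - 221.64884) / L - 10 - 2698 * Y / L ^ 2 ≤ G := by
          have e1 : (22.54056 * Y - 221.64884) / L
              = 0.93919 * (2 * Y - 3) / L + 0.93919 * (2 * Y - 5) / L + 0.93919 * (2 * Y - 7) / L + 0.93919 * (2 * Y - 11) / L
                + 0.93919 * (2 * Y - 13) / L + 0.93919 * (2 * Y - 17) / L + 0.93919 * (2 * Y - 19) / L + 0.93919 * (2 * Y - 23) / L
                + 0.93919 * (2 * Y - 29) / L + 0.93919 * (2 * Y - 31) / L + 0.93919 * (2 * Y - 37) / L + 0.93919 * (2 * Y - 41) / L := by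
            field_simp
            ring
          have e2 : 5 * (13.92 * 1 * (2 * Y) / L ^ 2)
              + 5 * (13.92 * 1 * (2 * Y) / L ^ 2)
              + 7 * (13.92 * 2 * (2 * Y) / L ^ 2)
              + 5 * (13.92 * 1 * (2 * Y) / L ^ 2)
              + 5 * (13.92 * (4 / 3) * (2 * Y) / L ^ 2)
              + 6 * (13.92 * 2 * (2 * Y) / L ^ 2)
              + 4 * (13.92 * (6 / 5) * (2 * Y) / L ^ 2)
              + 3 * (13.92 * 1 * (2 * Y) / L ^ 2)
              + 5 * (13.92 * 2 * (2 * Y) / L ^ 2)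
              + 3 * (13.92 * (4 / 3) * (2 * Y) / L ^ 2)
              + 2 * (13.92 * (10 / 9) * (2 * Y) / L ^ 2)
              + 4 * (13.92 * 2 * (2 * Y) / L ^ 2)
              + 3 * (13.92 * (12 / 11) * (2 * Y) / L ^ 2)
              + 2 * (13.92 * (6 / 5) * (2 * Y) / L ^ 2)
              + 2 * (13.92 * (8 / 3) * (2 * Y) / L ^ 2)
              + 13.92 * 1 * (2 * Y) / L ^ 2
              + 2 * (13.92 * (16 / 15) * (2 * Y) / L ^ 2)
              + 13.92 * 2 * (2 * Y) / L ^ 2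
              + 13.92 * (18 / 17) * (2 * Y) / L ^ 2
              = (37830152 / 14025) * Y / L ^ 2 := by
            field_simp
            ring
          have e3 : (37830152 / 14025 : ℝ) * Y / L ^ 2 ≤ 2698 * Y / L ^ 2 :=
            div_le_div_of_nonneg_right (mul_le_mul_of_nonneg_right (by norm_num) hY0) hL2.le
          rw [e1]
          linarith [hcombr, hπ3, hπ5, hπ7, hπ11, hπ13, hπ17, hπ19, hπ23, hπ29, hπ31, hπ37, hπ41,
            hQ2, hQ4, hQ6, hQ8, hQ10, hQ12, hQ14, hQ16, hQ18, hQ20, hQ22, hQ24, hQ26, hQ28, hQ30, hQ32, hQ34, hQ36, hQ38, e2, e3]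
        have hkey : Y * L ^ 2 ≤ (h : ℝ) * G * L ^ 2 := by
          have e4 : ((22.54056 * Y - 221.64884) / L - 10 - 2698 * Y / L ^ 2) * L ^ 2
              = 22.54056 * Y * L - 221.64884 * L - 10 * L ^ 2 - 2698 * Y := by
            field_simp
          have h1 : (22.54056 * Y * L - 221.64884 * L - 10 * L ^ 2 - 2698 * Y) * h ≤ G * L ^ 2 * h := by
            rw [← e4]
            exact mul_le_mul_of_nonneg_right (mul_le_mul_of_nonneg_right hG1 hL2.le) hh0.le
          have h2 : Y * (L ^ 2 + h) ≤ Y * (h * (22.54056 * L - 2698)) :=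
            mul_le_mul_of_nonneg_left hq (by linarith)
          have h3 : 221.64884 * L + 10 * L ^ 2 ≤ Y := by
            nlinarith [mul_nonneg (sub_nonneg.2 hL4) hLpos.le]
          have h3' : (h : ℝ) * (221.64884 * L + 10 * L ^ 2) ≤ h * Y := mul_le_mul_of_nonneg_left h3 hh0.le
          nlinarith [h1, h2, h3']
        have hfin := le_of_mul_le_mul_right hkey hL2
        rw [div_le_iff₀ hh0, mul_comm]
        exact hfin

set_option maxHeartbeats 4000000 in
/-- **All `y ≥ 1` under (3.3), FOUR-REGIME glue (1 / 4 / 7 / 12 shifts)**: as the tree's `half_count_ge_allN_bonf7_RS`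
(`c₀ = 1`; four shifts on `[L₁, L₂]`: `L² + h ≤ h·(8L − 248.5)`; seven on `[L₂, L₃]`: `L² + h ≤ h·(14L − 996.37)`), plus
twelve shifts `q ∈ {3,5,…,41}` on `[L₃, Λ₀]`, `L₃ ≥ 215`, with the pair sieve run at `e^215` (`pairCount_le_1392`):
`L² + h ≤ h·(24L − 2698)`.
[cite: RosserSchoenfeld1962, Theorem 2, eq. (3.3) (as input); Nathanson1996, Thm 7.7 (all-`x` form)] -/
theorem half_count_ge_allN_lev_RS (hRS : Literature.NumberTheory.LFunctions.RosserSchoenfeld1962_theorem2)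
    {L₁ L₂ L₃ Λ₀ : ℝ} {h : ℕ} (h18 : 18 ≤ h) (h41 : 41 ≤ L₁) (hL₁h : L₁ ≤ 2 * h)
    (hL₃ : 215 ≤ L₃) (hΛ4 : Λ₀ ≤ 10000)
    (hquad : ∀ L : ℝ, L₁ ≤ L → L ≤ L₂ → L ^ 2 + h ≤ h * (8 * L - 248.5))
    (hquad7 : ∀ L : ℝ, L₂ ≤ L → L ≤ L₃ → L ^ 2 + h ≤ h * (14 * L - 996.37))
    (hquad12 : ∀ L : ℝ, L₃ ≤ L → L ≤ Λ₀ → L ^ 2 + h ≤ h * (24 * L - 2698))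
    (hlarge : ∀ x : ℕ, Real.exp Λ₀ ≤ (x : ℝ) →
      (x : ℝ) / (2 * h) ≤ #{N ∈ Ioc 0 x | Even N ∧ ∃ p q : ℕ, p.Prime ∧ q.Prime ∧ p + q = N})
    {y : ℕ} (hy : 1 ≤ y) :
    (y : ℝ) / h ≤ #{b ∈ Ioc 0 y | b ∈ (({0, 1} : Set ℕ) ∪ {m | ∃ p q : ℕ, p.Prime ∧ q.Prime ∧ p + q = 2 * m})} := by
  set B : Set ℕ := ({0, 1} : Set ℕ) ∪ {m | ∃ p q : ℕ, p.Prime ∧ q.Prime ∧ p + q = 2 * m} with hB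
  have hhr : (18 : ℝ) ≤ h := by exact_mod_cast h18
  have hh0 : (0 : ℝ) < h := by linarith
  have hL₁pos : (0 : ℝ) < L₁ := by linarith
  by_cases hbig : Real.exp Λ₀ ≤ ((2 * y : ℕ) : ℝ)
  · have h1 := hlarge (2 * y) hbig
    have h2 := even_goldbach_card_le_half y
    have e : ((2 * y : ℕ) : ℝ) / (2 * h) = (y : ℝ) / h := by
      push_cast
      field_simp
    rw [e] at h1
    exact h1.trans (by exact_mod_cast h2)
  rw [not_le] at hbig
  by_cases hsmall : y ≤ h
  · have h1 : 1 ≤ #{b ∈ Ioc 0 y | b ∈ B} :=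
      card_pos.mpr ⟨1, by
        rw [mem_filter, mem_Ioc]
        exact ⟨⟨by omega, hy⟩, Or.inl (by simp)⟩⟩
    have h1' : (1 : ℝ) ≤ #{b ∈ Ioc 0 y | b ∈ B} := by exact_mod_cast h1
    have h2 : (y : ℝ) / h ≤ 1 := by
      rw [div_le_one hh0]
      exact_mod_cast hsmall
    linarith
  rw [not_le] at hsmall
  have hy29 : 19 ≤ y := by omega
  have hnr : ((2 * y - 3 : ℕ) : ℝ) = 2 * (y : ℝ) - 3 := cast_two_mul_sub_three (by omega)
  have hy29r : (19 : ℝ) ≤ y := by exact_mod_cast hy29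
  have hy0 : (0 : ℝ) < y := by linarith
  have hn55 : 35 ≤ 2 * y - 3 := by omega
  have hn0 : (0 : ℝ) < ((2 * y - 3 : ℕ) : ℝ) := by rw [hnr]; linarith
  have hn1 : (1 : ℝ) < ((2 * y - 3 : ℕ) : ℝ) := by rw [hnr]; linarith
  have hlogpos : 0 < Real.log ((2 * y - 3 : ℕ) : ℝ) := Real.log_pos hn1
  by_cases hmid : Real.log ((2 * y - 3 : ℕ) : ℝ) ≤ L₁
  · -- ONE SHIFT below `e^{L₁}` (§15, RS)
    have hemb := primeCounting_shift_le_half_count (y := y) (by omega)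
    have hembr : (Nat.primeCounting (2 * y - 3) : ℝ) + 1 ≤ #{b ∈ Ioc 0 y | b ∈ B} := by exact_mod_cast hemb
    refine le_trans ?_ hembr
    by_cases h67 : 67 ≤ 2 * y - 3
    · have hπ : 1 * ((2 * y - 3 : ℕ) : ℝ) / Real.log ((2 * y - 3 : ℕ) : ℝ)
          ≤ (Nat.primeCounting (2 * y - 3) : ℝ) := by
        have := primeCountingLowerMul_one_of_RS hRS
        unfold PrimeCountingLowerMul at this
        exact this (2 * y - 3) h67
      rw [one_mul] at hπ
      have h2 : ((2 * y - 3 : ℕ) : ℝ) / L₁ ≤ ((2 * y - 3 : ℕ) : ℝ) / Real.log ((2 * y - 3 : ℕ) : ℝ) :=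
        div_le_div_of_nonneg_left hn0.le hlogpos hmid
      have h3 : (y : ℝ) / h ≤ 2 * y / L₁ := by
        rw [div_le_div_iff₀ hh0 hL₁pos]
        nlinarith [mul_le_mul_of_nonneg_left hL₁h hy0.le]
      have h4 : 2 * (y : ℝ) / L₁ ≤ ((2 * y - 3 : ℕ) : ℝ) / L₁ + 1 := by
        rw [hnr]
        have e : (2 * (y : ℝ) - 3) / L₁ = 2 * y / L₁ - 3 / L₁ := by
          field_simp
        rw [e]
        have : 3 / L₁ ≤ 1 := by
          rw [div_le_one hL₁pos]
          linarith
        linarith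
      linarith [h2, h3, h4, hπ]
    · rw [not_le] at h67
      have hn32 : 32 ≤ 2 * y - 3 := by omega
      have hπ := ShnirelmanGoldbachTheorem.primeCounting_ge hn32
      have hlog7 : Real.log ((2 * y - 3 : ℕ) : ℝ) ≤ 7 := by
        have hy7 : ((2 * y - 3 : ℕ) : ℝ) ≤ (2 : ℝ) ^ 7 := by
          have : ((2 * y - 3 : ℕ) : ℝ) < 67 := by exact_mod_cast h67
          have h27 : (67 : ℝ) ≤ (2 : ℝ) ^ 7 := by norm_num
          linarith
        have he : (2 : ℝ) ≤ Real.exp 1 := by have := Real.add_one_le_exp (1 : ℝ); linarith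
        have h7 : (2 : ℝ) ^ 7 ≤ Real.exp 7 := by
          rw [show (7 : ℝ) = ((7 : ℕ) : ℝ) * 1 by norm_num, Real.exp_nat_mul]
          exact pow_le_pow_left₀ (by norm_num) he 7
        have := Real.log_le_log hn0 (hy7.trans h7)
        rwa [Real.log_exp] at this
      have h5 : ((2 * y - 3 : ℕ) : ℝ) / 28 ≤ ((2 * y - 3 : ℕ) : ℝ) / (4 * Real.log ((2 * y - 3 : ℕ) : ℝ)) :=
        div_le_div_of_nonneg_left hn0.le (by positivity) (by linarith)
      have h6' : (y : ℝ) / h ≤ (y : ℝ) / 18 := div_le_div_of_nonneg_left hy0.le (by norm_num) hhr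
      have h7 : ((2 * y - 3 : ℕ) : ℝ) / 28 + 1 - (y : ℝ) / 18 = (4 * (y : ℝ) + 225) / 252 := by
        rw [hnr]
        ring
      have h8 : 0 ≤ (4 * (y : ℝ) + 225) / 252 := by positivity
      linarith [hπ, h5, h6', h7, h8]
  · -- FOUR SHIFTS on `(e^{L₁}, e^{Λ₀})`, `c₀ = 1`
    rw [not_le] at hmid
    have h59 : (576460752303423488 : ℝ) < ((2 * y - 3 : ℕ) : ℝ) := by
      have h1 : Real.exp L₁ < ((2 * y - 3 : ℕ) : ℝ) := by
        by_contra hc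
        rw [not_lt] at hc
        have := Real.log_le_log hn0 hc
        rw [Real.log_exp] at this
        linarith
      exact lt_of_le_of_lt (numeral_le_exp_41.trans (Real.exp_le_exp.mpr h41)) h1
    have h59n : 576460752303423488 < 2 * y - 3 := by exact_mod_cast h59
    have hy58 : (288230376151711744 : ℝ) ≤ (y : ℝ) := by
      have : 288230376151711744 ≤ y := by omega
      exact_mod_cast this
    have h2y0 : (0 : ℝ) < ((2 * y : ℕ) : ℝ) := by push_cast; linarith
    set L := Real.log ((2 * y : ℕ) : ℝ) with hLdef
    have hLΛ : L < Λ₀ := by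
      have := Real.log_lt_log h2y0 hbig
      rwa [Real.log_exp] at this
    have hL₁L : L₁ ≤ L := by
      have h2y : ((2 * y - 3 : ℕ) : ℝ) ≤ ((2 * y : ℕ) : ℝ) := by rw [hnr]; push_cast; linarith
      exact (hmid.trans_le (Real.log_le_log hn0 h2y)).le
    have hL41 : (41 : ℝ) ≤ L := h41.trans hL₁L
    have hLpos : (0 : ℝ) < L := by linarith
    have hL4 : L ≤ 10000 := by linarith
    have he41 : Real.exp 41 ≤ ((2 * y : ℕ) : ℝ) := by
      have : Real.exp 41 ≤ Real.exp L := Real.exp_le_exp.mpr hL41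
      rwa [hLdef, Real.exp_log h2y0] at this
    have hπ : ∀ q : ℕ, q ≤ 41 → (2 * (y : ℝ) - q) / L ≤ (Nat.primeCounting (2 * y - q) : ℝ) := by
      intro q hq
      have hqr : (q : ℝ) ≤ 41 := by exact_mod_cast hq
      have hnq : ((2 * y - q : ℕ) : ℝ) = 2 * (y : ℝ) - q := cast_two_mul_sub (by omega)
      have h67 : 67 ≤ 2 * y - q := by omega
      have hnq0 : (0 : ℝ) < ((2 * y - q : ℕ) : ℝ) := by rw [hnq]; linarith
      have hnq1 : (1 : ℝ) < ((2 * y - q : ℕ) : ℝ) := by rw [hnq]; linarith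
      have h1 : 1 * ((2 * y - q : ℕ) : ℝ) / Real.log ((2 * y - q : ℕ) : ℝ)
          ≤ (Nat.primeCounting (2 * y - q) : ℝ) := by
        have := primeCountingLowerMul_one_of_RS hRS
        unfold PrimeCountingLowerMul at this
        exact this (2 * y - q) h67
      rw [one_mul] at h1
      have hlogq0 : 0 < Real.log ((2 * y - q : ℕ) : ℝ) := Real.log_pos hnq1
      have hlogq : Real.log ((2 * y - q : ℕ) : ℝ) ≤ L := by
        have h2y : ((2 * y - q : ℕ) : ℝ) ≤ ((2 * y : ℕ) : ℝ) := by
          rw [hnq]; push_cast; linarith [Nat.cast_nonneg (α := ℝ) q]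
        exact Real.log_le_log hnq0 h2y
      have h2 : (2 * (y : ℝ) - q) / L ≤ ((2 * y - q : ℕ) : ℝ) / Real.log ((2 * y - q : ℕ) : ℝ) := by
        rw [← hnq]
        exact div_le_div_of_nonneg_left hnq0.le hlogq0 hlogq
      linarith
    have hP : ∀ d : ℕ, d ≠ 0 → Even d →
        (#((Nat.primesLE (2 * y)).filter (fun p => (p + d).Prime)) : ℝ)
          ≤ 17.75 * oddSingularFactor d * ((2 * y : ℕ) : ℝ) / L ^ 2 := by
      intro d hd hde
      exact TwoResidueSelbergExplicit.pairCount_le_kappa (N := 2 * y) (h := d) he41 hd hde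
    rcases le_or_gt L L₂ with hmid2 | hmid2
    · -- FOUR SHIFTS on `(e^{L₁}, e^{L₂}]`
      have hq := hquad L hL₁L hmid2
      have hP2 := hP 2 (by norm_num) (by norm_num)
      have hP4 := hP 4 (by norm_num) (by norm_num)
      have hP6 := hP 6 (by norm_num) (by norm_num)
      have hP8 := hP 8 (by norm_num) (by norm_num)
      rw [oddSingularFactor_two'] at hP2
      rw [oddSingularFactor_four] at hP4
      rw [oddSingularFactor_six] at hP6
      rw [oddSingularFactor_eight] at hP8
      have hcomb := four_shift_count (y := y) (by omega)
      have hcombr : (Nat.primeCounting (2 * y - 3) : ℝ) + Nat.primeCounting (2 * y - 5)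
          + Nat.primeCounting (2 * y - 7) + Nat.primeCounting (2 * y - 11)
          ≤ (#{b ∈ Ioc 0 y | b ∈ B} : ℝ) + 2
            + (2 * #((Nat.primesLE (2 * y)).filter (fun p => (p + 2).Prime))
              + 2 * #((Nat.primesLE (2 * y)).filter (fun p => (p + 4).Prime))
              + #((Nat.primesLE (2 * y)).filter (fun p => (p + 8).Prime))
              + #((Nat.primesLE (2 * y)).filter (fun p => (p + 6).Prime))) := by
        exact_mod_cast hcomb
      have hπ3 := hπ 3 (by norm_num)
      have hπ5 := hπ 5 (by norm_num)
      have hπ7 := hπ 7 (by norm_num)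
      have hπ11 := hπ 11 (by norm_num)
      push_cast at hπ3 hπ5 hπ7 hπ11
      have h2yr : ((2 * y : ℕ) : ℝ) = 2 * (y : ℝ) := by push_cast; ring
      rw [h2yr] at hP2 hP4 hP6 hP8
      set G : ℝ := (#{b ∈ Ioc 0 y | b ∈ B} : ℝ) with hG
      set Y : ℝ := (y : ℝ) with hY
      have hG1 : (8 * Y - 26) / L - 2 - 248.5 * Y / L ^ 2 ≤ G := by
        have e1 : (8 * Y - 26) / L = (2 * Y - 3) / L + (2 * Y - 5) / L + (2 * Y - 7) / L + (2 * Y - 11) / L := by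
          field_simp
          ring
        have e2 : 248.5 * Y / L ^ 2 = 2 * (17.75 * 1 * (2 * Y) / L ^ 2) + 2 * (17.75 * 1 * (2 * Y) / L ^ 2)
            + 17.75 * 1 * (2 * Y) / L ^ 2 + 17.75 * 2 * (2 * Y) / L ^ 2 := by
          field_simp
          ring
        rw [e1, e2]
        linarith [hcombr, hπ3, hπ5, hπ7, hπ11, hP2, hP4, hP6, hP8]
      have hL2 : (0 : ℝ) < L ^ 2 := by positivity
      have hkey : Y * L ^ 2 ≤ (h : ℝ) * G * L ^ 2 := by
        have e3 : ((8 * Y - 26) / L - 2 - 248.5 * Y / L ^ 2) * L ^ 2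
            = 8 * Y * L - 26 * L - 2 * L ^ 2 - 248.5 * Y := by
          field_simp
        have h1 : (8 * Y * L - 26 * L - 2 * L ^ 2 - 248.5 * Y) * h ≤ G * L ^ 2 * h := by
          rw [← e3]
          exact mul_le_mul_of_nonneg_right (mul_le_mul_of_nonneg_right hG1 hL2.le) hh0.le
        have h2 : Y * (L ^ 2 + h) ≤ Y * (h * (8 * L - 248.5)) :=
          mul_le_mul_of_nonneg_left hq (by linarith)
        have h3 : 26 * L + 2 * L ^ 2 ≤ Y := by
          nlinarith [mul_nonneg (sub_nonneg.2 hL4) hLpos.le]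
        have h3' : (h : ℝ) * (26 * L + 2 * L ^ 2) ≤ h * Y := mul_le_mul_of_nonneg_left h3 hh0.le
        nlinarith [h1, h2, h3']
      have hfin := le_of_mul_le_mul_right hkey hL2
      rw [div_le_iff₀ hh0, mul_comm]
      exact hfin
    · rcases le_or_gt L L₃ with hmid3 | hmid3
      · -- SEVEN SHIFTS on `(e^{L₂}, e^{L₃}]`
        have hq := hquad7 L hmid2.le hmid3
        have hP2 := hP 2 (by norm_num) (by norm_num)
        have hP4 := hP 4 (by norm_num) (by norm_num)
        have hP6 := hP 6 (by norm_num) (by norm_num)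
        have hP8 := hP 8 (by norm_num) (by norm_num)
        have hP10 := hP 10 (by norm_num) (by norm_num)
        have hP12 := hP 12 (by norm_num) (by norm_num)
        have hP14 := hP 14 (by norm_num) (by norm_num)
        have hP16 := hP 16 (by norm_num) (by norm_num)
        rw [oddSingularFactor_two'] at hP2
        rw [oddSingularFactor_four] at hP4
        rw [oddSingularFactor_six] at hP6
        rw [oddSingularFactor_eight] at hP8
        rw [oddSingularFactor_ten] at hP10
        rw [oddSingularFactor_twelve] at hP12
        rw [oddSingularFactor_fourteen] at hP14
        rw [oddSingularFactor_sixteen] at hP16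
        have hcomb := seven_shift_count (y := y) (by omega)
        have hcombr : (Nat.primeCounting (2 * y - 3) : ℝ) + Nat.primeCounting (2 * y - 5)
            + Nat.primeCounting (2 * y - 7) + Nat.primeCounting (2 * y - 11) + Nat.primeCounting (2 * y - 13)
            + Nat.primeCounting (2 * y - 17) + Nat.primeCounting (2 * y - 19)
            ≤ (#{b ∈ Ioc 0 y | b ∈ B} : ℝ) + 5
              + (4 * #((Nat.primesLE (2 * y)).filter (fun p => (p + 2).Prime))
                + 3 * #((Nat.primesLE (2 * y)).filter (fun p => (p + 4).Prime))
                + 4 * #((Nat.primesLE (2 * y)).filter (fun p => (p + 6).Prime))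
                + 3 * #((Nat.primesLE (2 * y)).filter (fun p => (p + 8).Prime))
                + 2 * #((Nat.primesLE (2 * y)).filter (fun p => (p + 10).Prime))
                + 2 * #((Nat.primesLE (2 * y)).filter (fun p => (p + 12).Prime))
                + 2 * #((Nat.primesLE (2 * y)).filter (fun p => (p + 14).Prime))
                + #((Nat.primesLE (2 * y)).filter (fun p => (p + 16).Prime))) := by
          exact_mod_cast hcomb
        have hπ3 := hπ 3 (by norm_num)
        have hπ5 := hπ 5 (by norm_num)
        have hπ7 := hπ 7 (by norm_num)
        have hπ11 := hπ 11 (by norm_num)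
        have hπ13 := hπ 13 (by norm_num)
        have hπ17 := hπ 17 (by norm_num)
        have hπ19 := hπ 19 (by norm_num)
        push_cast at hπ3 hπ5 hπ7 hπ11 hπ13 hπ17 hπ19
        have h2yr : ((2 * y : ℕ) : ℝ) = 2 * (y : ℝ) := by push_cast; ring
        rw [h2yr] at hP2 hP4 hP6 hP8 hP10 hP12 hP14 hP16
        set G : ℝ := (#{b ∈ Ioc 0 y | b ∈ B} : ℝ) with hG
        set Y : ℝ := (y : ℝ) with hY
        have hY0 : 0 ≤ Y := le_trans (by norm_num) hy58
        have hL2 : (0 : ℝ) < L ^ 2 := by positivity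
        have hG1 : (14 * Y - 75) / L - 5 - 996.37 * Y / L ^ 2 ≤ G := by
          have e1 : (14 * Y - 75) / L
              = (2 * Y - 3) / L + (2 * Y - 5) / L + (2 * Y - 7) / L + (2 * Y - 11) / L + (2 * Y - 13) / L + (2 * Y - 17) / L + (2 * Y - 19) / L := by
            field_simp
            ring
          have e2 : 4 * (17.75 * 1 * (2 * Y) / L ^ 2) + 3 * (17.75 * 1 * (2 * Y) / L ^ 2)
              + 4 * (17.75 * 2 * (2 * Y) / L ^ 2) + 3 * (17.75 * 1 * (2 * Y) / L ^ 2)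
              + 2 * (17.75 * (4 / 3) * (2 * Y) / L ^ 2) + 2 * (17.75 * 2 * (2 * Y) / L ^ 2)
              + 2 * (17.75 * (6 / 5) * (2 * Y) / L ^ 2) + 17.75 * 1 * (2 * Y) / L ^ 2
              = (29891 / 30) * Y / L ^ 2 := by
            field_simp
            ring
          have e3 : (29891 / 30 : ℝ) * Y / L ^ 2 ≤ 996.37 * Y / L ^ 2 :=
            div_le_div_of_nonneg_right (mul_le_mul_of_nonneg_right (by norm_num) hY0) hL2.le
          rw [e1]
          linarith [hcombr, hπ3, hπ5, hπ7, hπ11, hπ13, hπ17, hπ19, hP2, hP4, hP6, hP8, hP10, hP12, hP14, hP16,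
            e2, e3]
        have hkey : Y * L ^ 2 ≤ (h : ℝ) * G * L ^ 2 := by
          have e4 : ((14 * Y - 75) / L - 5 - 996.37 * Y / L ^ 2) * L ^ 2
              = 14 * Y * L - 75 * L - 5 * L ^ 2 - 996.37 * Y := by
            field_simp
          have h1 : (14 * Y * L - 75 * L - 5 * L ^ 2 - 996.37 * Y) * h ≤ G * L ^ 2 * h := by
            rw [← e4]
            exact mul_le_mul_of_nonneg_right (mul_le_mul_of_nonneg_right hG1 hL2.le) hh0.le
          have h2 : Y * (L ^ 2 + h) ≤ Y * (h * (14 * L - 996.37)) :=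
            mul_le_mul_of_nonneg_left hq (by linarith)
          have h3 : 75 * L + 5 * L ^ 2 ≤ Y := by
            nlinarith [mul_nonneg (sub_nonneg.2 hL4) hLpos.le]
          have h3' : (h : ℝ) * (75 * L + 5 * L ^ 2) ≤ h * Y := mul_le_mul_of_nonneg_left h3 hh0.le
          nlinarith [h1, h2, h3']
        have hfin := le_of_mul_le_mul_right hkey hL2
        rw [div_le_iff₀ hh0, mul_comm]
        exact hfin
      · -- TWELVE SHIFTS on `(e^{L₃}, e^{Λ₀})`, pair sieve at the threshold `e^215`
        have hq := hquad12 L hmid3.le hLΛ.le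
        have he215 : Real.exp 215 ≤ ((2 * y : ℕ) : ℝ) := by
          have : Real.exp 215 ≤ Real.exp L := Real.exp_le_exp.mpr (hL₃.trans hmid3.le)
          rwa [hLdef, Real.exp_log h2y0] at this
        have hPt : ∀ d : ℕ, d ≠ 0 → Even d →
            (#((Nat.primesLE (2 * y)).filter (fun p => (p + d).Prime)) : ℝ)
              ≤ 13.92 * oddSingularFactor d * ((2 * y : ℕ) : ℝ) / L ^ 2 := by
          intro d hd hde
          rw [hLdef]
          exact pairCount_le_1392 (N := 2 * y) (h := d) he215 hd hde
        have hQ2 := hPt 2 (by norm_num) (by norm_num)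
        have hQ4 := hPt 4 (by norm_num) (by norm_num)
        have hQ6 := hPt 6 (by norm_num) (by norm_num)
        have hQ8 := hPt 8 (by norm_num) (by norm_num)
        have hQ10 := hPt 10 (by norm_num) (by norm_num)
        have hQ12 := hPt 12 (by norm_num) (by norm_num)
        have hQ14 := hPt 14 (by norm_num) (by norm_num)
        have hQ16 := hPt 16 (by norm_num) (by norm_num)
        have hQ18 := hPt 18 (by norm_num) (by norm_num)
        have hQ20 := hPt 20 (by norm_num) (by norm_num)
        have hQ22 := hPt 22 (by norm_num) (by norm_num)
        have hQ24 := hPt 24 (by norm_num) (by norm_num)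
        have hQ26 := hPt 26 (by norm_num) (by norm_num)
        have hQ28 := hPt 28 (by norm_num) (by norm_num)
        have hQ30 := hPt 30 (by norm_num) (by norm_num)
        have hQ32 := hPt 32 (by norm_num) (by norm_num)
        have hQ34 := hPt 34 (by norm_num) (by norm_num)
        have hQ36 := hPt 36 (by norm_num) (by norm_num)
        have hQ38 := hPt 38 (by norm_num) (by norm_num)
        rw [oddSingularFactor_two'] at hQ2
        rw [oddSingularFactor_four] at hQ4
        rw [oddSingularFactor_six] at hQ6
        rw [oddSingularFactor_eight] at hQ8
        rw [oddSingularFactor_ten] at hQ10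
        rw [oddSingularFactor_twelve] at hQ12
        rw [oddSingularFactor_fourteen] at hQ14
        rw [oddSingularFactor_sixteen] at hQ16
        rw [oddSingularFactor_eighteen] at hQ18
        rw [oddSingularFactor_twenty] at hQ20
        rw [oddSingularFactor_twentytwo] at hQ22
        rw [oddSingularFactor_twentyfour] at hQ24
        rw [oddSingularFactor_twentysix] at hQ26
        rw [oddSingularFactor_twentyeight] at hQ28
        rw [oddSingularFactor_thirty] at hQ30
        rw [oddSingularFactor_thirtytwo] at hQ32
        rw [oddSingularFactor_thirtyfour] at hQ34
        rw [oddSingularFactor_thirtysix] at hQ36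
        rw [oddSingularFactor_thirtyeight] at hQ38
        have hcomb := twelve_shift_count (y := y) (by omega)
        have hcombr : (Nat.primeCounting (2 * y - 3) : ℝ) + Nat.primeCounting (2 * y - 5)
            + Nat.primeCounting (2 * y - 7) + Nat.primeCounting (2 * y - 11) + Nat.primeCounting (2 * y - 13)
            + Nat.primeCounting (2 * y - 17) + Nat.primeCounting (2 * y - 19) + Nat.primeCounting (2 * y - 23)
            + Nat.primeCounting (2 * y - 29) + Nat.primeCounting (2 * y - 31) + Nat.primeCounting (2 * y - 37)
            + Nat.primeCounting (2 * y - 41)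
            ≤ (#{b ∈ Ioc 0 y | b ∈ (({0, 1} : Set ℕ) ∪ {m | ∃ p q : ℕ, p.Prime ∧ q.Prime ∧ p + q = 2 * m})} : ℝ) + 10
              + (5 * #((Nat.primesLE (2 * y)).filter (fun p => (p + 2).Prime))
                + 5 * #((Nat.primesLE (2 * y)).filter (fun p => (p + 4).Prime))
                + 7 * #((Nat.primesLE (2 * y)).filter (fun p => (p + 6).Prime))
                + 5 * #((Nat.primesLE (2 * y)).filter (fun p => (p + 8).Prime))
                + 5 * #((Nat.primesLE (2 * y)).filter (fun p => (p + 10).Prime))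
                + 6 * #((Nat.primesLE (2 * y)).filter (fun p => (p + 12).Prime))
                + 4 * #((Nat.primesLE (2 * y)).filter (fun p => (p + 14).Prime))
                + 3 * #((Nat.primesLE (2 * y)).filter (fun p => (p + 16).Prime))
                + 5 * #((Nat.primesLE (2 * y)).filter (fun p => (p + 18).Prime))
                + 3 * #((Nat.primesLE (2 * y)).filter (fun p => (p + 20).Prime))
                + 2 * #((Nat.primesLE (2 * y)).filter (fun p => (p + 22).Prime))
                + 4 * #((Nat.primesLE (2 * y)).filter (fun p => (p + 24).Prime))
                + 3 * #((Nat.primesLE (2 * y)).filter (fun p => (p + 26).Prime))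
                + 2 * #((Nat.primesLE (2 * y)).filter (fun p => (p + 28).Prime))
                + 2 * #((Nat.primesLE (2 * y)).filter (fun p => (p + 30).Prime))
                + #((Nat.primesLE (2 * y)).filter (fun p => (p + 32).Prime))
                + 2 * #((Nat.primesLE (2 * y)).filter (fun p => (p + 34).Prime))
                + #((Nat.primesLE (2 * y)).filter (fun p => (p + 36).Prime))
                + #((Nat.primesLE (2 * y)).filter (fun p => (p + 38).Prime))) := by
          exact_mod_cast hcomb
        have hπ3 := hπ 3 (by norm_num)
        have hπ5 := hπ 5 (by norm_num)
        have hπ7 := hπ 7 (by norm_num)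
        have hπ11 := hπ 11 (by norm_num)
        have hπ13 := hπ 13 (by norm_num)
        have hπ17 := hπ 17 (by norm_num)
        have hπ19 := hπ 19 (by norm_num)
        have hπ23 := hπ 23 (by norm_num)
        have hπ29 := hπ 29 (by norm_num)
        have hπ31 := hπ 31 (by norm_num)
        have hπ37 := hπ 37 (by norm_num)
        have hπ41 := hπ 41 (by norm_num)
        push_cast at hπ3 hπ5 hπ7 hπ11 hπ13 hπ17 hπ19 hπ23 hπ29 hπ31 hπ37 hπ41
        have h2yr : ((2 * y : ℕ) : ℝ) = 2 * (y : ℝ) := by push_cast; ring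
        rw [h2yr] at hQ2 hQ4 hQ6 hQ8 hQ10 hQ12 hQ14 hQ16 hQ18 hQ20 hQ22 hQ24 hQ26 hQ28 hQ30 hQ32 hQ34 hQ36 hQ38
        set G : ℝ := (#{b ∈ Ioc 0 y | b ∈ (({0, 1} : Set ℕ) ∪ {m | ∃ p q : ℕ, p.Prime ∧ q.Prime ∧ p + q = 2 * m})} : ℝ) with hG
        set Y : ℝ := (y : ℝ) with hY
        have hY0 : 0 ≤ Y := le_trans (by norm_num) hy58
        have hL2 : (0 : ℝ) < L ^ 2 := by positivity
        have hG1 : (24 * Y - 236) / L - 10 - 2698 * Y / L ^ 2 ≤ G := by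
          have e1 : (24 * Y - 236) / L
              = (2 * Y - 3) / L + (2 * Y - 5) / L + (2 * Y - 7) / L + (2 * Y - 11) / L
                + (2 * Y - 13) / L + (2 * Y - 17) / L + (2 * Y - 19) / L + (2 * Y - 23) / L
                + (2 * Y - 29) / L + (2 * Y - 31) / L + (2 * Y - 37) / L + (2 * Y - 41) / L := by
            field_simp
            ring
          have e2 : 5 * (13.92 * 1 * (2 * Y) / L ^ 2)
              + 5 * (13.92 * 1 * (2 * Y) / L ^ 2)
              + 7 * (13.92 * 2 * (2 * Y) / L ^ 2)
              + 5 * (13.92 * 1 * (2 * Y) / L ^ 2)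
              + 5 * (13.92 * (4 / 3) * (2 * Y) / L ^ 2)
              + 6 * (13.92 * 2 * (2 * Y) / L ^ 2)
              + 4 * (13.92 * (6 / 5) * (2 * Y) / L ^ 2)
              + 3 * (13.92 * 1 * (2 * Y) / L ^ 2)
              + 5 * (13.92 * 2 * (2 * Y) / L ^ 2)
              + 3 * (13.92 * (4 / 3) * (2 * Y) / L ^ 2)
              + 2 * (13.92 * (10 / 9) * (2 * Y) / L ^ 2)
              + 4 * (13.92 * 2 * (2 * Y) / L ^ 2)
              + 3 * (13.92 * (12 / 11) * (2 * Y) / L ^ 2)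
              + 2 * (13.92 * (6 / 5) * (2 * Y) / L ^ 2)
              + 2 * (13.92 * (8 / 3) * (2 * Y) / L ^ 2)
              + 13.92 * 1 * (2 * Y) / L ^ 2
              + 2 * (13.92 * (16 / 15) * (2 * Y) / L ^ 2)
              + 13.92 * 2 * (2 * Y) / L ^ 2
              + 13.92 * (18 / 17) * (2 * Y) / L ^ 2
              = (37830152 / 14025) * Y / L ^ 2 := by
            field_simp
            ring
          have e3 : (37830152 / 14025 : ℝ) * Y / L ^ 2 ≤ 2698 * Y / L ^ 2 :=
            div_le_div_of_nonneg_right (mul_le_mul_of_nonneg_right (by norm_num) hY0) hL2.le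
          rw [e1]
          linarith [hcombr, hπ3, hπ5, hπ7, hπ11, hπ13, hπ17, hπ19, hπ23, hπ29, hπ31, hπ37, hπ41,
            hQ2, hQ4, hQ6, hQ8, hQ10, hQ12, hQ14, hQ16, hQ18, hQ20, hQ22, hQ24, hQ26, hQ28, hQ30, hQ32, hQ34, hQ36, hQ38, e2, e3]
        have hkey : Y * L ^ 2 ≤ (h : ℝ) * G * L ^ 2 := by
          have e4 : ((24 * Y - 236) / L - 10 - 2698 * Y / L ^ 2) * L ^ 2
              = 24 * Y * L - 236 * L - 10 * L ^ 2 - 2698 * Y := by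
            field_simp
          have h1 : (24 * Y * L - 236 * L - 10 * L ^ 2 - 2698 * Y) * h ≤ G * L ^ 2 * h := by
            rw [← e4]
            exact mul_le_mul_of_nonneg_right (mul_le_mul_of_nonneg_right hG1 hL2.le) hh0.le
          have h2 : Y * (L ^ 2 + h) ≤ Y * (h * (24 * L - 2698)) :=
            mul_le_mul_of_nonneg_left hq (by linarith)
          have h3 : 236 * L + 10 * L ^ 2 ≤ Y := by
            nlinarith [mul_nonneg (sub_nonneg.2 hL4) hLpos.le]
          have h3' : (h : ℝ) * (236 * L + 10 * L ^ 2) ≤ h * Y := mul_le_mul_of_nonneg_left h3 hh0.le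
          nlinarith [h1, h2, h3']
        have hfin := le_of_mul_le_mul_right hkey hL2
        rw [div_le_iff₀ hh0, mul_comm]
        exact hfin


/-! #### §3.3 Instances: `K = 53` unconditionally, `K = 47` under (3.3) -/

/-- Numerics at `Λ = 382`: `17L² ≤ 16·13.58·TlowK(L/2 − 1.38632)` for `L ≥ 382`. [folklore] -/
private theorem kappa_numeric_382 {L : ℝ} (hL : 382 ≤ L) :
    17 * L ^ 2 ≤ 16 * (13.60 - 0.02) * TwoResidueSelbergExplicit.TlowK (L / 2 - 1.38632) := by
  unfold TwoResidueSelbergExplicit.TlowK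
  nlinarith [hL, mul_self_nonneg (L - 382)]

/-- **`A = 13.60` above `e^382`**. [cite: BatemanDiamond2004, §13.4 (13.13)–(13.14)] -/
theorem goldbachCount_le_1360 {N : ℕ} (hN : Real.exp 382 ≤ (N : ℝ)) (heven : Even N) :
    (SingularSeries.goldbachCount N : ℝ) ≤ 13.60 * oddSingularFactor N * (N : ℝ) / Real.log (N : ℝ) ^ 2 :=
  goldbachCount_le_of_numeric41 (by norm_num) (fun _ hL => kappa_numeric_382 hL) hN heven

/-- **Unconditional, above `e^394`**: at least `x/52` EVEN Goldbach numbers in `(0, x]` (`J = 400` levels;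
`Λs = 382`, `A = 13.60`, `c₁ = 0.441`; `(1/52)⁷·259.55·13.60⁸ = 0.29547 ≤ (0.4409·gHol4 394 − 0.0057)⁸ = 0.30221`).
[cite: Nathanson1996, Theorem 7.8 (proof, restricted to even N; explicit form proved here)] -/
theorem goldbach_even_count_ge_52_exp394 {x : ℕ} (hx : Real.exp 394 ≤ (x : ℝ)) :
    (x : ℝ) / 52 ≤ #{N ∈ Ioc 0 x | Even N ∧ ∃ p q : ℕ, p.Prime ∧ q.Prime ∧ p + q = N} := by
  have h := goldbach_even_count_ge_holder400 (Λs := 382) (Λ₀ := 394) (A := 13.60) (c₁ := 0.441) (κ := 1 / 52)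
    (by norm_num) (by norm_num) (by norm_num) (by norm_num) (by norm_num)
    (fun N hN hev => goldbachCount_le_1360 hN hev) (by norm_num) (by norm_num)
    (fun y hy => sum_goldbachCount_ge_0441 ((Real.exp_le_exp.mpr (by norm_num)).trans hy))
    (by unfold gHol4; norm_num) (by unfold gHol4; norm_num) hx
  have e : (1 : ℝ) / 52 * x = x / 52 := by ring
  rw [e] at h
  exact h

/-- **Under (3.3), above `e^394`**: at least `x/46` EVEN Goldbach numbers in `(0, x]` (`J = 400` levels; `Λs = 382`,
`A = 13.60`, `c₁ = 0.4995`; `(1/46)⁷·259.55·13.60⁸ = 0.69699 ≤ (0.4994·gHol4 394 − 0.0057)⁸ = 0.82389`).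
[cite: RosserSchoenfeld1962, Theorem 2, eq. (3.3) (as input)] -/
theorem goldbach_even_count_ge_of_RS_46 (hRS : Literature.NumberTheory.LFunctions.RosserSchoenfeld1962_theorem2)
    {x : ℕ} (hx : Real.exp 394 ≤ (x : ℝ)) :
    (x : ℝ) / 46 ≤ #{N ∈ Ioc 0 x | Even N ∧ ∃ p q : ℕ, p.Prime ∧ q.Prime ∧ p + q = N} := by
  have h := goldbach_even_count_ge_holder400 (Λs := 382) (Λ₀ := 394) (A := 13.60) (c₁ := 0.4995) (κ := 1 / 46)
    (by norm_num) (by norm_num) (by norm_num) (by norm_num) (by norm_num)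
    (fun N hN hev => goldbachCount_le_1360 hN hev) (by norm_num) (by norm_num)
    (fun y hy => sum_goldbachCount_ge_of_RS' hRS ((Real.exp_le_exp.mpr (by norm_num)).trans hy))
    (by unfold gHol4; norm_num) (by unfold gHol4; norm_num) hx
  have e : (1 : ℝ) / 46 * x = x / 46 := by ring
  rw [e] at h
  exact h

/-- **Unconditional count for all `y ≥ 1`**: `B(y) ≥ y/26` (one shift below `e^47.9024 = e^{1.8424·26}`, four shifts on
`[47.9024, 150]`, seven on `[150, 225]`, twelve on `[225, 394]`, the count above `e^394`). [cite: Nathanson1996, Theorem 7.8 (explicit constant for the halved set proved here)] -/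
theorem half_count_ge_allN_26 {y : ℕ} (hy : 1 ≤ y) :
    (y : ℝ) / 26 ≤ #{b ∈ Ioc 0 y | b ∈ (({0, 1} : Set ℕ) ∪ {m | ∃ p q : ℕ, p.Prime ∧ q.Prime ∧ p + q = 2 * m})} := by
  have h := half_count_ge_allN_lev (L₁ := 47.9024) (L₂ := 150) (L₃ := 225) (Λ₀ := 394) (h := 26) (by norm_num)
    (by norm_num) (by norm_num) (by norm_num) (by norm_num)
    (fun L h1 h2 => by
      push_cast
      nlinarith [mul_nonneg (sub_nonneg.2 h1) (sub_nonneg.2 h2)])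
    (fun L h1 h2 => by
      push_cast
      nlinarith [mul_nonneg (sub_nonneg.2 h1) (sub_nonneg.2 h2)])
    (fun L h1 h2 => by
      push_cast
      nlinarith [mul_nonneg (sub_nonneg.2 h1) (sub_nonneg.2 h2)])
    (fun x hx => by
      have h1 := goldbach_even_count_ge_52_exp394 hx
      have e : (x : ℝ) / (2 * ((26 : ℕ) : ℝ)) = (x : ℝ) / 52 := by norm_num
      rw [e]
      exact h1) hy
  exact_mod_cast h

/-- **Under (3.3), all `y ≥ 1`**: `B(y) ≥ y/23` (one shift below `e^46`, four shifts on `[46, 140]`, seven on `[140, 215]`,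
twelve on `[215, 394]`, the count above `e^394`). [cite: RosserSchoenfeld1962, Theorem 2, eq. (3.3) (as input)] -/
theorem half_count_ge_allN_of_RS_23 (hRS : Literature.NumberTheory.LFunctions.RosserSchoenfeld1962_theorem2)
    {y : ℕ} (hy : 1 ≤ y) :
    (y : ℝ) / 23 ≤ #{b ∈ Ioc 0 y | b ∈ (({0, 1} : Set ℕ) ∪ {m | ∃ p q : ℕ, p.Prime ∧ q.Prime ∧ p + q = 2 * m})} := by
  have h := half_count_ge_allN_lev_RS hRS (L₁ := 46) (L₂ := 140) (L₃ := 215) (Λ₀ := 394) (h := 23) (by norm_num)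
    (by norm_num) (by norm_num) (by norm_num) (by norm_num)
    (fun L h1 h2 => by
      push_cast
      nlinarith [mul_nonneg (sub_nonneg.2 h1) (sub_nonneg.2 h2)])
    (fun L h1 h2 => by
      push_cast
      nlinarith [mul_nonneg (sub_nonneg.2 h1) (sub_nonneg.2 h2)])
    (fun L h1 h2 => by
      push_cast
      nlinarith [mul_nonneg (sub_nonneg.2 h1) (sub_nonneg.2 h2)])
    (fun x hx => by
      have h1 := goldbach_even_count_ge_of_RS_46 hRS hx
      have e : (x : ℝ) / (2 * ((23 : ℕ) : ℝ)) = (x : ℝ) / 46 := by norm_num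
      rw [e]
      exact h1) hy
  exact_mod_cast h

/-- **The halved density, `1/26`**: `σ({0, 1} ∪ {m : 2m = p + q}) ≥ 1/26`, unconditionally. [cite: Nathanson1996, Theorem 7.8 (explicit constant for the halved set proved here)] -/
theorem schnirelmannDensity_half_ge_26 :
    (1 : ℝ) / 26 ≤ schnirelmannDensity
      (({0, 1} : Set ℕ) ∪ {m | ∃ p q : ℕ, p.Prime ∧ q.Prime ∧ p + q = 2 * m}) := by
  have h := schnirelmannDensity_ge_of_count' (K := 26)
    (S := ({0, 1} : Set ℕ) ∪ {m | ∃ p q : ℕ, p.Prime ∧ q.Prime ∧ p + q = 2 * m})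
    (fun N hN => by have := half_count_ge_allN_26 hN; exact_mod_cast this)
  exact_mod_cast h

/-- **The halved density under (3.3), `1/23`**. [cite: RosserSchoenfeld1962, Theorem 2, eq. (3.3) (as input)] -/
theorem schnirelmannDensity_half_ge_of_RS_23 (hRS : Literature.NumberTheory.LFunctions.RosserSchoenfeld1962_theorem2) :
    (1 : ℝ) / 23 ≤ schnirelmannDensity
      (({0, 1} : Set ℕ) ∪ {m | ∃ p q : ℕ, p.Prime ∧ q.Prime ∧ p + q = 2 * m}) := by
  have h := schnirelmannDensity_ge_of_count' (K := 23)
    (S := ({0, 1} : Set ℕ) ∪ {m | ∃ p q : ℕ, p.Prime ∧ q.Prime ∧ p + q = 2 * m})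
    (fun N hN => by have := half_count_ge_allN_of_RS_23 hRS hN; exact_mod_cast this)
  exact_mod_cast h

/-- ★★★★★★★★★★★★★ **The Shnirel'man–Goldbach theorem, explicit and unconditional — the best constant of this file:
every integer `N ≥ 2` is a sum of at most `53` primes** (`J = 400` staircase levels in the flattened first moment; four-regime
glue with one / four / seven / twelve shifted copies of the primes; Sylvester's constant; sieve at `e^382` (`A = 13.60`), count
at `e^394` (`|T| ≥ x/52`); `B(y) ≥ y/26`; halving, Mann: `26 • B = ℕ`, `2·26 + 1`).  No hypotheses, no named facts.
[cite: Nathanson1996, Thm 7.9 (explicit constant proved here)] -/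
theorem schnirelmann_goldbach_le_53 (N : ℕ) (hN : 2 ≤ N) :
    ∃ M : Multiset ℕ, (∀ p ∈ M, p.Prime) ∧ Multiset.card M ≤ 53 ∧ M.sum = N := by
  have hσ : (1 : ℝ) / ((26 : ℕ) : ℝ) ≤ schnirelmannDensity
      (({0, 1} : Set ℕ) ∪ {m | ∃ p q : ℕ, p.Prime ∧ q.Prime ∧ p + q = 2 * m}) := by
    have := schnirelmannDensity_half_ge_26
    exact_mod_cast this
  exact sum_of_primes_of_half_density_mann (h := 26) (by norm_num) hσ N hN

/-- ★★★★★★★★★★★★★ **Under Rosser–Schoenfeld (3.3): every integer `N ≥ 2` is a sum of at most `47` primes** (`J = 400`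
levels, `c₁ = 0.4995`, count `x/46` above `e^394`, four-regime RS glue with `h = 23`, Mann).
[cite: RosserSchoenfeld1962, Theorem 2, eq. (3.3) (as input); Nathanson1996, Thm 7.9] -/
theorem schnirelmann_goldbach_of_RS_le_47 (hRS : Literature.NumberTheory.LFunctions.RosserSchoenfeld1962_theorem2)
    (N : ℕ) (hN : 2 ≤ N) :
    ∃ M : Multiset ℕ, (∀ p ∈ M, p.Prime) ∧ Multiset.card M ≤ 47 ∧ M.sum = N := by
  have hσ : (1 : ℝ) / ((23 : ℕ) : ℝ) ≤ schnirelmannDensity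
      (({0, 1} : Set ℕ) ∪ {m | ∃ p q : ℕ, p.Prime ∧ q.Prime ∧ p + q = 2 * m}) := by
    have := schnirelmannDensity_half_ge_of_RS_23 hRS
    exact_mod_cast this
  exact sum_of_primes_of_half_density_mann (h := 23) (by norm_num) hσ N hN

end Literature.NumberTheory.Sieve.ShnirelmanGoldbachExplicit
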